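import Literature.NumberTheory.Sieve.PolymathProductLatticeBounds
import Literature.NumberTheory.Sieve.PolymathProductHoeffdingBounds
import Literature.Analysis.Convolution.ConvolutionPowerIntegerArithmetic
import Literature.Analysis.SpecialFunctions.KernelLog
import Literature.NumberTheory.Sieve.MaynardProductKernelCert4500
import Mathlib.Analysis.Convex.SpecificFunctions.Basic
import HarnessLib

/-! # Kernel certificates for the NUMERATOR and the DENOMINATOR of Maynard's functional at Polymath's product test function, `k = 3750`
(Hoeffding-recentred lattice form; soundness library — the `decide +kernel` facts are evaluated by the route-side files that instantiate it)

`N = ∫_{(0,1]} (∫₀^{1−w} g)² (g²)^{⋆3749}(w) dw ≥ 1.9076·10⁻⁶ · m₂^{3749}` for Polymath's product test function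
(`g = 1_{[0,3/4]}/(249/2000 + 3749 t)`, `m₂ = ∫ g² = 10⁶/466771167`), through the registered stub `stub_numHoeffdingCert`
of the line `Cruxes/NumLB3749/Lines/birth.lean` (linewriter-parity-certcluster-1): a finite lattice inequality on the
`3749`-fold discrete convolution power of the exact cell masses `p_j = cellMass g² h j`, `h = 2⁻²⁰`, recentred by Hoeffding's
inequality (shift `δ = 1729 h`, tail parameter `λ = 150 h`).

ENGINE.  This file is the landed `k = 4500` template `Literature.NumberTheory.Sieve.MaynardProductKernelCert4500`
(parity-ideate-p3 ROUND-17/18: Kronecker-packed fixed-point floor chain `2^48`, digit width `2^100`, `2^20` slots, block log-weights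
from `KernelLog.logIv`, exact-integer side condition, `decide +kernel`) re-instantiated at `k = 3750`, `c = 249/2000`, `T = 3/4`,
`N1 = 2^20`, with ONE mathematical change: the block weight `ellT` interpolates the 1024-entry log table linearly between grid points
(`GG = 769` cells) instead of rounding down to the grid — still a lower bound because `V ↦ log (c + 3749 V h)` is increasing and
concave (`ellT_sound`); the margin of this crux (`1.16·10⁻³` relative) does not afford the `GG·h` shift of the rounded table.
Parameter choice and margins: float model of the exact certificate functional (this hand, `fmodel.c`, reproduces the cell's
`A_true = 1.909822·10⁻⁶`): at `N1 = 2^20, Λ = 150, W = 16` the certified sum is `≈ 1.90835·10⁻⁶·m₂^{3749}` against the constant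
`1.9076·10⁻⁶` (relative margin `≈ 3.7·10⁻⁴`; fixed-point and table losses `≲ 3·10⁻⁵`); lattices `2^19` and coarser fail.
Everything from the template is kept verbatim up to the parameter values, the namespace, the docstrings, `ellT`/`grid_ok`/`weight_ge`,
the memory-light program variants (four exact leaves per super-digit, 8-cell block leaves above `2^18`, 64-entry log sub-tables, a mask-first
chain step `stepG` and the 15-step addition chain `chainF` for `3749`, quarter facts `FactQ` for the side conditions), and the final assemblies
`stub_of_facts` / `stub_of_factsD`: from the Boolean kernel facts `FactN`, `FactQ`, `FactS`, `FactD` (to be decided by `decide +kernel` in the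
route-side files) they conclude VERBATIM the registered stubs `stub_numHoeffdingCert` / `stub_denHoeffdingCert` of the Parity route
`MaynardProductExact` (cruxes `NumLB3749`, `DenUB3750`, items stmt-Parity-19245 / 19251).  The exact GMP mirror of this program (prover folder
`work/model/mirror.c`) reports all facts TRUE: certified numerator `1.907992·10⁻⁶·m₂^{3749}` (threshold `1.9076·10⁻⁶`), certified denominator
`0.4167960·m₂^{3750}` (threshold `0.41694`), side-condition slack `1.9` / `2.4` cells.  No summit is proved here. -/

set_option autoImplicit false
set_option maxRecDepth 4096

open Finset MeasureTheory Set
open Literature.Analysis.Convolution Literature.NumberTheory.Sieve Literature.NumberTheory.Sieve.MaynardTao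
open Literature.Analysis.SpecialFunctions.KernelLog (logIv logIv_sound)
-- generic lemmas shared with the `k = 4500` certificate (same statements; not re-declared here)
open Literature.NumberTheory.Sieve.MaynardTao.ProductKernelCert (tail_arith dconvPow_zero_slot two_pow_pos' le_ceilDiv_mul
  shiftRight_eq_div exp_neg_le_pow cond2_arith eexpr_arith cond1_arith two_pow_160 calc_aux)

namespace Literature.NumberTheory.Sieve.MaynardTao.ProductKernelCert3750

/-! ## Parameters -/
section Params
/-- `k = nK + 2 = 3750`. [folklore] -/
def nK : ℕ := 3748
/-- Checker plumbing `cn`: an exact-integer constant / function of the `k = 3750` kernel certificate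
(see the module docstring; adapted from `MaynardProductKernelCert4500`). [folklore] -/
def cn : ℕ := 249
/-- Checker plumbing `cd`: an exact-integer constant / function of the `k = 3750` kernel certificate
(see the module docstring; adapted from `MaynardProductKernelCert4500`). [folklore] -/
def cd : ℕ := 2000
/-- Checker plumbing `Tn`: an exact-integer constant / function of the `k = 3750` kernel certificate
(see the module docstring; adapted from `MaynardProductKernelCert4500`). [folklore] -/
def Tn : ℕ := 3
/-- Checker plumbing `Td`: an exact-integer constant / function of the `k = 3750` kernel certificate
(see the module docstring; adapted from `MaynardProductKernelCert4500`). [folklore] -/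
def Td : ℕ := 4
/-- lattice `h = 1/N1`. [folklore] -/
def N1 : ℕ := 1048576
/-- `M = 2^eE` packed slots. [folklore] -/
def eE : ℕ := 20
/-- fixed-point scale `2^LL`. [folklore] -/
def LL : ℕ := 48
/-- digit width. [folklore] -/
def BB : ℕ := 100
/-- block width `2^Wexp` for the log weights. [folklore] -/
def Wexp : ℕ := 5
/-- grid of the quantised log table and its depth (`Jc / GG < 2^eT`). [folklore] -/
def GG : ℕ := 769
/-- Checker plumbing `eT`: an exact-integer constant / function of the `k = 3750` kernel certificate
(see the module docstring; adapted from `MaynardProductKernelCert4500`). [folklore] -/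
def eT : ℕ := 10
/-- Hoeffding recentring (ROUND-18): denominator cutoff `m⋆` (partial sum over `m < MD = m⋆+1`), numerator shift `dP`
(cells, `δ = dP·h`), tail parameter `Λ` (cells, `λ₁ = λ₂ = Λ·h`), and the exponent `nE` of the elementary bound
`exp(−t) ≤ (nE/(nE+t))^nE`. [folklore] -/
def mstar : ℕ := 1046863
/-- Checker plumbing `dP`: an exact-integer constant / function of the `k = 3750` kernel certificate
(see the module docstring; adapted from `MaynardProductKernelCert4500`). [folklore] -/
def dP : ℕ := 1729
/-- Checker plumbing `Lam`: an exact-integer constant / function of the `k = 3750` kernel certificate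
(see the module docstring; adapted from `MaynardProductKernelCert4500`). [folklore] -/
def Lam : ℕ := 150
/-- Checker plumbing `nE`: an exact-integer constant / function of the `k = 3750` kernel certificate
(see the module docstring; adapted from `MaynardProductKernelCert4500`). [folklore] -/
def nE : ℕ := 256
end Params

/-- Checker plumbing `kK`: an exact-integer constant / function of the `k = 3750` kernel certificate
(see the module docstring; adapted from `MaynardProductKernelCert4500`). [folklore] -/
def kK : ℕ := nK + 2
/-- Checker plumbing `MM`: an exact-integer constant / function of the `k = 3750` kernel certificate
(see the module docstring; adapted from `MaynardProductKernelCert4500`). [folklore] -/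
def MM : ℕ := 2 ^ eE
/-- Checker plumbing `WW`: an exact-integer constant / function of the `k = 3750` kernel certificate
(see the module docstring; adapted from `MaynardProductKernelCert4500`). [folklore] -/
def WW : ℕ := 2 ^ Wexp
/-- Checker plumbing `rr`: an exact-integer constant / function of the `k = 3750` kernel certificate
(see the module docstring; adapted from `MaynardProductKernelCert4500`). [folklore] -/
def rr : ℕ := 2 ^ (eE - Wexp)
/-- Checker plumbing `Jc`: an exact-integer constant / function of the `k = 3750` kernel certificate
(see the module docstring; adapted from `MaynardProductKernelCert4500`). [folklore] -/
def Jc : ℕ := Tn * N1 / Td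
/-- Checker plumbing `MD`: an exact-integer constant / function of the `k = 3750` kernel certificate
(see the module docstring; adapted from `MaynardProductKernelCert4500`). [folklore] -/
def MD : ℕ := mstar + 1
/-- Checker plumbing `Aa`: an exact-integer constant / function of the `k = 3750` kernel certificate
(see the module docstring; adapted from `MaynardProductKernelCert4500`). [folklore] -/
def Aa (j : ℕ) : ℕ := cn * N1 + cd * (kK - 1) * j
/-- Checker plumbing `NUM`: an exact-integer constant / function of the `k = 3750` kernel certificate
(see the module docstring; adapted from `MaynardProductKernelCert4500`). [folklore] -/
def NUM : ℕ := N1 * cn * (cn * Td + cd * (kK - 1) * Tn)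
/-- Checker plumbing `DEN`: an exact-integer constant / function of the `k = 3750` kernel certificate
(see the module docstring; adapted from `MaynardProductKernelCert4500`). [folklore] -/
def DEN (j : ℕ) : ℕ := Tn * Aa j * Aa (j + 1)
/-- Checker plumbing `leaf`: an exact-integer constant / function of the `k = 3750` kernel certificate
(see the module docstring; adapted from `MaynardProductKernelCert4500`). [folklore] -/
def leaf (j : ℕ) : ℕ := if j < Jc then 2 ^ LL * NUM / DEN j else 0
/-- Checker plumbing `ind`: an exact-integer constant / function of the `k = 3750` kernel certificate
(see the module docstring; adapted from `MaynardProductKernelCert4500`). [folklore] -/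
def ind (j : ℕ) : ℕ := if j < Jc then 1 else 0
/-- Checker plumbing `uu`: an exact-integer constant / function of the `k = 3750` kernel certificate
(see the module docstring; adapted from `MaynardProductKernelCert4500`). [folklore] -/
def uu (j : ℕ) : ℕ := leaf j + ind j

/-! ## The program (kernel-friendly: big powers of two only through shifts) -/
/-- Checker plumbing `pow2`: an exact-integer constant / function of the `k = 3750` kernel certificate
(see the module docstring; adapted from `MaynardProductKernelCert4500`). [folklore] -/
def pow2 (n : ℕ) : ℕ := 1 <<< n
/-- Checker plumbing `onesBelow`: an exact-integer constant / function of the `k = 3750` kernel certificate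
(see the module docstring; adapted from `MaynardProductKernelCert4500`). [folklore] -/
def onesBelow (n : ℕ) : ℕ := pow2 n - 1
/-- Checker plumbing `repUnit`: an exact-integer constant / function of the `k = 3750` kernel certificate
(see the module docstring; adapted from `MaynardProductKernelCert4500`). [folklore] -/
def repUnit (J : ℕ) : ℕ := onesBelow (BB * J) / onesBelow BB
/-- Checker plumbing `maskLo`: an exact-integer constant / function of the `k = 3750` kernel certificate
(see the module docstring; adapted from `MaynardProductKernelCert4500`). [folklore] -/
def maskLo : ℕ := repUnit MM * onesBelow (BB - LL)
/-- Checker plumbing `rndC`: an exact-integer constant / function of the `k = 3750` kernel certificate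
(see the module docstring; adapted from `MaynardProductKernelCert4500`). [folklore] -/
def rndC : ℕ := repUnit MM * onesBelow LL
/-- exact floor leaf `⌊2^L·p_j⌋ = 2^L·NUM / DEN j` (no support test; used below `Jc` only). [folklore] -/
def leafE (j : ℕ) : ℕ := 2 ^ LL * NUM / DEN j
/-- block width of the coarse part of the floor initial vector. [folklore] -/
def BK : ℕ := 8
/-- block leaf above the exact region of `2^e` cells: the LAST cell of block `b` (the smallest mass in the block — `p` is
decreasing — hence a lower bound for every cell of the block). [folklore] -/
def bleafE (e b : ℕ) : ℕ := leafE (2 ^ e + BK * b + (BK - 1))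
/-- the floor initial vector as a function (specification only): exact below `2^e`, block-constant above. [folklore] -/
def wvE (e j : ℕ) : ℕ := if j < 2 ^ e then leafE j else bleafE e ((j - 2 ^ e) / BK)
/-- the floor initial vector restricted to the support `j < Jc` (specification only). [folklore] -/
def wv (j : ℕ) : ℕ := if j < Jc then wvE 18 j else 0
/-- the increment of `Aa`: `Aa (j+1) = Aa j + bA`. [folklore] -/
def bA : ℕ := cd * (kK - 1)
/-- `2^L · NUM`. [folklore] -/
def CNUM : ℕ := 2 ^ LL * NUM
/-- four consecutive exact floor leaves `⌊2^L p_{4q+t}⌋`, `t < 4`, packed in one super-digit of width `4·B` (the five values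
`Aa (4q), …, Aa (4q+4)` are shared — a quarter of the kernel work and of the packing tree). [folklore] -/
def leaf4 (q : ℕ) : ℕ :=
  let a0 := Aa (4 * q)
  let a1 := a0 + bA
  let a2 := a1 + bA
  let a3 := a2 + bA
  let a4 := a3 + bA
  CNUM / (Tn * a0 * a1) + (CNUM / (Tn * a1 * a2)) * 2 ^ BB +
    ((CNUM / (Tn * a2 * a3)) * 2 ^ (BB * 2) + (CNUM / (Tn * a3 * a4)) * 2 ^ (BB * 3))
/-- packed floor initial vector (memory-light: `2^16` super-digits of four exact leaves = `2^18` exact digits, then `2^16` blocks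
of `8` equal digits, one multiplication by `repUnit 8` per block). [folklore] -/
def NL : ℕ := kpackDC (4 * BB) leaf4 16 0 + (kpackDC (BB * BK) (fun b => bleafE 18 b * repUnit BK) 16 0 <<< (BB * 2 ^ 18))
/-- Checker plumbing `NU`: an exact-integer constant / function of the `k = 3750` kernel certificate
(see the module docstring; adapted from `MaynardProductKernelCert4500`). [folklore] -/
def NU : ℕ := kpackDC BB uu eE 0
/-- Checker plumbing `trunc`: an exact-integer constant / function of the `k = 3750` kernel certificate
(see the module docstring; adapted from `MaynardProductKernelCert4500`). [folklore] -/
def trunc (x : ℕ) : ℕ := x &&& onesBelow (BB * MM)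
/-- Checker plumbing `stepF`: an exact-integer constant / function of the `k = 3750` kernel certificate
(see the module docstring; adapted from `MaynardProductKernelCert4500`). [folklore] -/
def stepF (x y : ℕ) : ℕ := (trunc (x * y) >>> LL) &&& maskLo
/-- the shifted mask `maskLo <<< L` (bits `[L, B)` of each of the `M` digits). [folklore] -/
def maskBig : ℕ := maskLo <<< LL
/-- the floor step, MASK-FIRST form (same value as `stepF`, one fewer big intermediate in the kernel: product, masked product,
shifted result). [folklore] -/
def stepG (x y : ℕ) : ℕ := ((x * y) &&& maskBig) >>> LL

/-- Checker plumbing `stepC`: an exact-integer constant / function of the `k = 3750` kernel certificate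
(see the module docstring; adapted from `MaynardProductKernelCert4500`). [folklore] -/
def stepC (x y : ℕ) : ℕ := ((trunc (x * y) + rndC) >>> LL) &&& maskLo
/-- Checker plumbing `ssum`: an exact-integer constant / function of the `k = 3750` kernel certificate
(see the module docstring; adapted from `MaynardProductKernelCert4500`). [folklore] -/
def ssum (N : ℕ) : ℕ := N % onesBelow BB
/-- Checker plumbing `psum`: an exact-integer constant / function of the `k = 3750` kernel certificate
(see the module docstring; adapted from `MaynardProductKernelCert4500`). [folklore] -/
def psum (N J : ℕ) : ℕ := (N &&& onesBelow (BB * J)) % onesBelow BB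
/-- the no-carry check of a floor step. [folklore] -/
def okStep (x y : ℕ) : Bool := Nat.blt (ssum x * ssum y) (pow2 BB)
/-- the 15-step addition chain `1,2,4,…,512,544,545,1090,1602,3204,3749` for `p^{*3749}` on the floor side (straight-line; every
intermediate is a `let`, shared by the kernel). [folklore] -/
def chainF (x : ℕ) : ℕ × Bool :=
  let x2 := stepG x x
  let x4 := stepG x2 x2
  let x8 := stepG x4 x4
  let x16 := stepG x8 x8
  let x32 := stepG x16 x16
  let x64 := stepG x32 x32
  let x128 := stepG x64 x64
  let x256 := stepG x128 x128
  let x512 := stepG x256 x256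
  let x544 := stepG x512 x32
  let x545 := stepG x544 x
  let x1090 := stepG x545 x545
  let x1602 := stepG x1090 x512
  let x3204 := stepG x1602 x1602
  let x3749 := stepG x3204 x545
  (x3749, okStep x x && okStep x2 x2 && okStep x4 x4 && okStep x8 x8 && okStep x16 x16 && okStep x32 x32 && okStep x64 x64 &&
    okStep x128 x128 && okStep x256 x256 && okStep x512 x32 && okStep x544 x && okStep x545 x545 && okStep x1090 x512 &&
    okStep x1602 x1602 && okStep x3204 x545)

/-- Checker plumbing `stepPairF`: an exact-integer constant / function of the `k = 3750` kernel certificate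
(see the module docstring; adapted from `MaynardProductKernelCert4500`). [folklore] -/
def stepPairF (x sx : ℕ) (b : Bool) (p : ℕ × Bool) : ℕ × Bool :=
  bif b then (stepF (stepF p.1 p.1) x,
      (p.2 && Nat.blt (ssum p.1 * ssum p.1) (pow2 BB)) && Nat.blt (ssum (stepF p.1 p.1) * sx) (pow2 BB))
  else (stepF p.1 p.1, p.2 && Nat.blt (ssum p.1 * ssum p.1) (pow2 BB))
/-- Checker plumbing `runF`: an exact-integer constant / function of the `k = 3750` kernel certificate
(see the module docstring; adapted from `MaynardProductKernelCert4500`). [folklore] -/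
def runF (x sx : ℕ) : List Bool → ℕ × Bool
  | [] => (x, true)
  | b :: bs => stepPairF x sx b (runF x sx bs)
/-- Checker plumbing `stepPairC`: an exact-integer constant / function of the `k = 3750` kernel certificate
(see the module docstring; adapted from `MaynardProductKernelCert4500`). [folklore] -/
def stepPairC (x sx : ℕ) (b : Bool) (p : ℕ × Bool) : ℕ × Bool :=
  bif b then (stepC (stepC p.1 p.1) x,
      (p.2 && Nat.ble (ssum p.1 * ssum p.1 + pow2 LL) (pow2 BB)) && Nat.ble (ssum (stepC p.1 p.1) * sx + pow2 LL) (pow2 BB))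
  else (stepC p.1 p.1, p.2 && Nat.ble (ssum p.1 * ssum p.1 + pow2 LL) (pow2 BB))
/-- Checker plumbing `runC`: an exact-integer constant / function of the `k = 3750` kernel certificate
(see the module docstring; adapted from `MaynardProductKernelCert4500`). [folklore] -/
def runC (x sx : ℕ) : List Bool → ℕ × Bool
  | [] => (x, true)
  | b :: bs => stepPairC x sx b (runC x sx bs)
/-- exponent encoded by a bit list (head = least significant bit below the leading one). [folklore] -/
def expo : List Bool → ℕ
  | [] => 1
  | b :: bs => 2 * expo bs + (bif b then 1 else 0)
/-- bits of `k − 1` and `k` below the leading one, least significant first. [folklore] -/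
def bitsF : List Bool := [true, false, true, false, false, true, false, true, false, true, true]
/-- Checker plumbing `bitsC`: an exact-integer constant / function of the `k = 3750` kernel certificate
(see the module docstring; adapted from `MaynardProductKernelCert4500`). [folklore] -/
def bitsC : List Bool := [false, true, true, false, false, true, false, true, false, true, true]

/-- Checker plumbing `resF`: an exact-integer constant / function of the `k = 3750` kernel certificate
(see the module docstring; adapted from `MaynardProductKernelCert4500`). [folklore] -/
def resF : ℕ × Bool := chainF NL
/-- Checker plumbing `resC`: an exact-integer constant / function of the `k = 3750` kernel certificate
(see the module docstring; adapted from `MaynardProductKernelCert4500`). [folklore] -/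
def resC : ℕ × Bool := runC NU (ssum NU) bitsC
/-- Checker plumbing `NF`: an exact-integer constant / function of the `k = 3750` kernel certificate
(see the module docstring; adapted from `MaynardProductKernelCert4500`). [folklore] -/
def NF : ℕ := resF.1
/-- Checker plumbing `NC`: an exact-integer constant / function of the `k = 3750` kernel certificate
(see the module docstring; adapted from `MaynardProductKernelCert4500`). [folklore] -/
def NC : ℕ := resC.1
/-- Checker plumbing `sD`: an exact-integer constant / function of the `k = 3750` kernel certificate
(see the module docstring; adapted from `MaynardProductKernelCert4500`). [folklore] -/
def sD : ℕ := psum NC MD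
/-- block representative `V_i = min(max(N1 − ((i+1)W + k − 2), 0), Jc)` (in units of `h`). [folklore] -/
def Vv (i : ℕ) : ℕ := min (N1 + dP - ((i + 1) * WW + kK - 2)) Jc
/-- scaled log lower bound `ell_i / 2^80 ≤ log((c + (k−1) V_i h)/c)`. [folklore] -/
def ellOf (V : ℕ) : ℕ :=
  match logIv (Aa V), logIv (Aa 0) with
  | some p, some q => Int.toNat (p.1 - q.2)
  | _, _ => 0
/-- Checker plumbing `ell`: an exact-integer constant / function of the `k = 3750` kernel certificate
(see the module docstring; adapted from `MaynardProductKernelCert4500`). [folklore] -/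
def ell (i : ℕ) : ℕ := ellOf (Vv i)
/-- digit width of the log table. [folklore] -/
def BT : ℕ := 88
/-- table entry `g`: the clipped log lower bound at `V = g·GG` (clipping keeps it a digit and a lower bound). [folklore] -/
def tabFn (g : ℕ) : ℕ := min (ellOf (g * GG)) (onesBelow BT)
/-- log sub-table `s`: the 64 clipped log lower bounds `tabFn (64 s + t)`, `t < 64`, packed (each `logIv` evaluated once per
sub-table; 64-entry sub-tables keep every table read a small number — memory). [folklore] -/
def TABS (s : ℕ) : ℕ := kpackDC BT tabFn 6 (64 * s)
/-- Checker plumbing `tabDigit`: an exact-integer constant / function of the `k = 3750` kernel certificate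
(see the module docstring; adapted from `MaynardProductKernelCert4500`). [folklore] -/
def tabDigit (g : ℕ) : ℕ := (TABS (g / 64) >>> (BT * (g % 64))) &&& onesBelow BT
/-- the block weight actually used: read the table at the grid point below `V_i` and at the next one and interpolate
linearly (a lower bound: `V ↦ log (Aa V)` is concave and increasing). [folklore] -/
def ellT (i : ℕ) : ℕ :=
  tabDigit (Vv i / GG) + (tabDigit (Vv i / GG + 1) - tabDigit (Vv i / GG)) * (Vv i % GG) / GG
/-- `Σ_i ellT(o+i)² · (digit-sum of block i)` over the `2^d` blocks of `W` slots packed in `N`, by binary splitting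
(memory-light: every level materialises `|N|` bits in total). [folklore] -/
def nsGo (N : ℕ) : ℕ → ℕ → ℕ
  | 0, o => ellT o ^ 2 * (N % onesBelow BB)
  | d + 1, o => nsGo (N &&& onesBelow (BB * (WW * 2 ^ d))) d o + nsGo (N >>> (BB * (WW * 2 ^ d))) d (o + 2 ^ d)
/-- Checker plumbing `NUMSUM`: an exact-integer constant / function of the `k = 3750` kernel certificate
(see the module docstring; adapted from `MaynardProductKernelCert4500`). [folklore] -/
def NUMSUM : ℕ := nsGo NF (eE - Wexp) 0
/-- `SIG = Σ_{j<M} j·leaf_j` by binary splitting (`2^L·Σ_j j·pt_j ∈ [SIG, SIG + Jc(Jc−1)/2]`). [folklore] -/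
def sigGo : ℕ → ℕ → ℕ
  | 0, o => o * leaf o
  | d + 1, o => sigGo d o + sigGo d (o + 2 ^ d)
/-- Checker plumbing `SIG`: an exact-integer constant / function of the `k = 3750` kernel certificate
(see the module docstring; adapted from `MaynardProductKernelCert4500`). [folklore] -/
def SIG : ℕ := sigGo eE 0
/-- `Σ_{j<Jc} j = Jc(Jc−1)/2`: the excess of `Σ j·u_j` over `Σ j·leaf_j` (a cheap closed constant). [folklore] -/
def TRI : ℕ := Jc * (Jc - 1) / 2
/-- two-sided enclosure `LOGLO ≤ 2^80·log((c+(k−1)T)/c) ≤ LOGHI` from the tree's `logIv` at `A(Jc)` and `A(0)`. [folklore] -/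
def logOk : Bool := (logIv (Aa Jc)).isSome && (logIv (Aa 0)).isSome
/-- Checker plumbing `LOGLO`: an exact-integer constant / function of the `k = 3750` kernel certificate
(see the module docstring; adapted from `MaynardProductKernelCert4500`). [folklore] -/
def LOGLO : ℕ :=
  match logIv (Aa Jc), logIv (Aa 0) with
  | some p, some q => Int.toNat (p.1 - q.2)
  | _, _ => 0
/-- Checker plumbing `LOGHI`: an exact-integer constant / function of the `k = 3750` kernel certificate
(see the module docstring; adapted from `MaynardProductKernelCert4500`). [folklore] -/
def LOGHI : ℕ :=
  match logIv (Aa Jc), logIv (Aa 0) with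
  | some p, some q => Int.toNat (p.2 - q.1)
  | _, _ => 0
/-- Checker plumbing `X1`: an exact-integer constant / function of the `k = 3750` kernel certificate
(see the module docstring; adapted from `MaynardProductKernelCert4500`). [folklore] -/
def X1 : ℕ := cn * (cn * Td + cd * (nK + 1) * Tn)
/-- Checker plumbing `DDc`: an exact-integer constant / function of the `k = 3750` kernel certificate
(see the module docstring; adapted from `MaynardProductKernelCert4500`). [folklore] -/
def DDc : ℕ := 2 ^ LL * 2 ^ 80 * cd ^ 2 * Tn * (nK + 1) ^ 2
/-- Checker plumbing `C1c`: an exact-integer constant / function of the `k = 3750` kernel certificate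
(see the module docstring; adapted from `MaynardProductKernelCert4500`). [folklore] -/
def C1c : ℕ := N1 * cn * 2 ^ LL * 2 ^ 80 * cd * Tn * (nK + 1)
/-- Checker plumbing `Y1c`: an exact-integer constant / function of the `k = 3750` kernel certificate
(see the module docstring; adapted from `MaynardProductKernelCert4500`). [folklore] -/
def Y1c : ℕ := 2 ^ 80 * cd ^ 2 * Tn * (nK + 1) ^ 2
/-- side condition 1 (`hcond₁` in cells): `N1 − MD + Λ ≤ k·σ_lo` — over variables `lo = LOGLO`, `sg = SIG` (KERNEL RULE K6: the heavy
closed constant `SIG` is never placed under `+`/`*` next to a term whose instance path could differ; here `sg` is a variable). [folklore] -/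
def chk1 (lo sg : ℕ) : Bool :=
  Nat.ble ((N1 + Lam) * DDc + (nK + 2) * (C1c + (sg + TRI) * Y1c)) (MD * DDc + (nK + 2) * N1 * X1 * lo * 2 ^ LL)
/-- side condition 2 (`hcond₂` in cells): `dP + Λ ≤ (k−1)(1 − σ_hi)` — over variables `hi = LOGHI`, `sg = SIG`. [folklore] -/
def chk2 (hi sg : ℕ) : Bool :=
  Nat.ble ((dP + Lam) * DDc + (nK + 1) * N1 * X1 * hi * 2 ^ LL) ((nK + 1) * DDc + (nK + 1) * (C1c + sg * Y1c))
/-- Checker plumbing `sideOk`: an exact-integer constant / function of the `k = 3750` kernel certificate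
(see the module docstring; adapted from `MaynardProductKernelCert4500`). [folklore] -/
def sideOk : Bool := logOk && (chk1 LOGLO SIG && chk2 LOGHI SIG)
/-- kernel fact Q (one quarter of `Σ j·leaf_j`, `2^18` leaves): `lo ≤ sigGo 18 o ≤ hi` for literals `lo hi`. [folklore] -/
def FactQ (o lo hi : ℕ) : Bool := Nat.ble lo (sigGo 18 o) && Nat.ble (sigGo 18 o) hi
/-- kernel fact S (side conditions on literal quarter sums): log enclosure, `hcond₁` with `Σ uq`, `hcond₂` with `Σ lq`. [folklore] -/
def FactS (l0 l1 l2 u0 u1 u2 : ℕ) : Bool := logOk && (chk1 LOGLO (u0 + u1 + u2) && chk2 LOGHI (l0 + l1 + l2))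
/-- integer upper bounds of the two Hoeffding tails: `2^L·e^{−2Λ²/k} ≤ T1`, `2^L·LOGHI²·e^{−2Λ²/(k−1)} ≤ T2`. [folklore] -/
def a1 : ℕ := (nE * (nK + 2)) ^ nE
/-- Checker plumbing `b1`: an exact-integer constant / function of the `k = 3750` kernel certificate
(see the module docstring; adapted from `MaynardProductKernelCert4500`). [folklore] -/
def b1 : ℕ := (nE * (nK + 2) + 2 * Lam ^ 2) ^ nE
/-- Checker plumbing `a2`: an exact-integer constant / function of the `k = 3750` kernel certificate
(see the module docstring; adapted from `MaynardProductKernelCert4500`). [folklore] -/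
def a2 : ℕ := (nE * (nK + 1)) ^ nE
/-- Checker plumbing `b2`: an exact-integer constant / function of the `k = 3750` kernel certificate
(see the module docstring; adapted from `MaynardProductKernelCert4500`). [folklore] -/
def b2 : ℕ := (nE * (nK + 1) + 2 * Lam ^ 2) ^ nE
/-- Checker plumbing `T1`: an exact-integer constant / function of the `k = 3750` kernel certificate
(see the module docstring; adapted from `MaynardProductKernelCert4500`). [folklore] -/
def T1 : ℕ := (2 ^ LL * a1 + b1 - 1) / b1
/-- Checker plumbing `T2`: an exact-integer constant / function of the `k = 3750` kernel certificate
(see the module docstring; adapted from `MaynardProductKernelCert4500`). [folklore] -/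
def T2 : ℕ := (2 ^ LL * LOGHI ^ 2 * a2 + b2 - 1) / b2
/-- the numerator threshold check `19076·2^L·2^160·3749²·10^{-10} ≤ ns − t2`, over variables (KERNEL RULE K2/K7: the heavy
closed constants `NUMSUM`, `T2` are substituted by application only). [folklore] -/
def chkN (ns t2 : ℕ) : Bool :=
  Nat.ble (19076 * (2 ^ LL * (2 ^ 160 * (nK + 1) ^ 2)) + 10000000000 * t2) (10000000000 * ns)
/-- kernel fact N (numerator, literal-free): floor chain consistent, `T2 ≤ NUMSUM`, and the threshold check. [folklore] -/
def FactN : Bool := resF.2 && (Nat.ble T2 NUMSUM && chkN NUMSUM T2)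

/-! ## Parameter facts (small decisions) -/
/-- Checker step `expo_bitsF` of the `k = 3750` kernel certificate (statement and proof adapted from
`Literature.NumberTheory.Sieve.MaynardProductKernelCert4500`, parity-ideate-p3 ROUND-18 template). [cite: Polymath8b2014, Theorem 6.7 (product test function), numerical instance k = 3750] -/
theorem expo_bitsF : expo bitsF = nK + 1 := by decide
/-- Checker step `expo_bitsC` of the `k = 3750` kernel certificate (statement and proof adapted from
`Literature.NumberTheory.Sieve.MaynardProductKernelCert4500`, parity-ideate-p3 ROUND-18 template). [cite: Polymath8b2014, Theorem 6.7 (product test function), numerical instance k = 3750] -/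
theorem expo_bitsC : expo bitsC = nK + 2 := by decide
/-- Checker step `Jc_mul` of the `k = 3750` kernel certificate (statement and proof adapted from
`Literature.NumberTheory.Sieve.MaynardProductKernelCert4500`, parity-ideate-p3 ROUND-18 template). [cite: Polymath8b2014, Theorem 6.7 (product test function), numerical instance k = 3750] -/
theorem Jc_mul : Jc * Td = Tn * N1 := by decide
/-- Checker step `Jc_lt_MM` of the `k = 3750` kernel certificate (statement and proof adapted from
`Literature.NumberTheory.Sieve.MaynardProductKernelCert4500`, parity-ideate-p3 ROUND-18 template). [cite: Polymath8b2014, Theorem 6.7 (product test function), numerical instance k = 3750] -/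
theorem Jc_lt_MM : Jc < MM := by decide
/-- Checker step `MD_le_MM` of the `k = 3750` kernel certificate (statement and proof adapted from
`Literature.NumberTheory.Sieve.MaynardProductKernelCert4500`, parity-ideate-p3 ROUND-18 template). [cite: Polymath8b2014, Theorem 6.7 (product test function), numerical instance k = 3750] -/
theorem MD_le_MM : MD ≤ MM := by decide
/-- Checker step `b1_pos` of the `k = 3750` kernel certificate (statement and proof adapted from
`Literature.NumberTheory.Sieve.MaynardProductKernelCert4500`, parity-ideate-p3 ROUND-18 template). [cite: Polymath8b2014, Theorem 6.7 (product test function), numerical instance k = 3750] -/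
theorem b1_pos : 0 < b1 := Nat.pow_pos (by decide)
/-- Checker step `b2_pos` of the `k = 3750` kernel certificate (statement and proof adapted from
`Literature.NumberTheory.Sieve.MaynardProductKernelCert4500`, parity-ideate-p3 ROUND-18 template). [cite: Polymath8b2014, Theorem 6.7 (product test function), numerical instance k = 3750] -/
theorem b2_pos : 0 < b2 := Nat.pow_pos (by decide)
/-- Checker step `nE_pos` of the `k = 3750` kernel certificate (statement and proof adapted from
`Literature.NumberTheory.Sieve.MaynardProductKernelCert4500`, parity-ideate-p3 ROUND-18 template). [cite: Polymath8b2014, Theorem 6.7 (product test function), numerical instance k = 3750] -/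
theorem nE_pos : 0 < nE := by decide
/-- Checker step `MM_eq` of the `k = 3750` kernel certificate (statement and proof adapted from
`Literature.NumberTheory.Sieve.MaynardProductKernelCert4500`, parity-ideate-p3 ROUND-18 template). [cite: Polymath8b2014, Theorem 6.7 (product test function), numerical instance k = 3750] -/
theorem MM_eq : MM = rr * WW := by decide
/-- Checker step `MM_eq'` of the `k = 3750` kernel certificate (statement and proof adapted from
`Literature.NumberTheory.Sieve.MaynardProductKernelCert4500`, parity-ideate-p3 ROUND-18 template). [cite: Polymath8b2014, Theorem 6.7 (product test function), numerical instance k = 3750] -/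
theorem MM_eq' : MM = WW * 2 ^ (eE - Wexp) := by decide
/-- Checker step `BB_pos` of the `k = 3750` kernel certificate (statement and proof adapted from
`Literature.NumberTheory.Sieve.MaynardProductKernelCert4500`, parity-ideate-p3 ROUND-18 template). [cite: Polymath8b2014, Theorem 6.7 (product test function), numerical instance k = 3750] -/
theorem BB_pos : 0 < BB := by decide
/-- Checker step `LL_le_BB` of the `k = 3750` kernel certificate (statement and proof adapted from
`Literature.NumberTheory.Sieve.MaynardProductKernelCert4500`, parity-ideate-p3 ROUND-18 template). [cite: Polymath8b2014, Theorem 6.7 (product test function), numerical instance k = 3750] -/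
theorem LL_le_BB : LL ≤ BB := by decide
/-- Checker step `NUM_le_DEN0` of the `k = 3750` kernel certificate (statement and proof adapted from
`Literature.NumberTheory.Sieve.MaynardProductKernelCert4500`, parity-ideate-p3 ROUND-18 template). [cite: Polymath8b2014, Theorem 6.7 (product test function), numerical instance k = 3750] -/
theorem NUM_le_DEN0 : NUM ≤ DEN 0 := by decide
/-- Checker step `sizeF` of the `k = 3750` kernel certificate (statement and proof adapted from
`Literature.NumberTheory.Sieve.MaynardProductKernelCert4500`, parity-ideate-p3 ROUND-18 template). [cite: Polymath8b2014, Theorem 6.7 (product test function), numerical instance k = 3750] -/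
theorem sizeF : MM * 2 ^ LL < 2 ^ BB - 1 := by decide
/-- Checker step `sizeC` of the `k = 3750` kernel certificate (statement and proof adapted from
`Literature.NumberTheory.Sieve.MaynardProductKernelCert4500`, parity-ideate-p3 ROUND-18 template). [cite: Polymath8b2014, Theorem 6.7 (product test function), numerical instance k = 3750] -/
theorem sizeC : MM * (2 ^ LL + 1) < 2 ^ BB - 1 := by decide
/-- Checker step `sizeStepF` of the `k = 3750` kernel certificate (statement and proof adapted from
`Literature.NumberTheory.Sieve.MaynardProductKernelCert4500`, parity-ideate-p3 ROUND-18 template). [cite: Polymath8b2014, Theorem 6.7 (product test function), numerical instance k = 3750] -/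
theorem sizeStepF : (2 ^ BB - 1) / 2 ^ LL < 2 ^ BB - 1 := by decide
/-- Checker step `sizeStepC` of the `k = 3750` kernel certificate (statement and proof adapted from
`Literature.NumberTheory.Sieve.MaynardProductKernelCert4500`, parity-ideate-p3 ROUND-18 template). [cite: Polymath8b2014, Theorem 6.7 (product test function), numerical instance k = 3750] -/
theorem sizeStepC : (2 ^ BB - 2 ^ LL) / 2 ^ LL + MM < 2 ^ BB - 1 := by decide
/-- Checker step `grid_ok` of the `k = 3750` kernel certificate (statement and proof adapted from
`Literature.NumberTheory.Sieve.MaynardProductKernelCert4500`, parity-ideate-p3 ROUND-18 template). [cite: Polymath8b2014, Theorem 6.7 (product test function), numerical instance k = 3750] -/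
theorem grid_ok : Jc / GG + 1 < 2 ^ eT := by decide
/-- Checker step `param_pos` of the `k = 3750` kernel certificate (statement and proof adapted from
`Literature.NumberTheory.Sieve.MaynardProductKernelCert4500`, parity-ideate-p3 ROUND-18 template). [cite: Polymath8b2014, Theorem 6.7 (product test function), numerical instance k = 3750] -/
theorem param_pos : 0 < cn ∧ 0 < cd ∧ 0 < Tn ∧ 0 < Td ∧ 0 < N1 ∧ 0 < WW ∧ 0 < 100 := by decide

/-! ## Bit tricks = the specification -/
/-- Checker step `pow2_eq` of the `k = 3750` kernel certificate (statement and proof adapted from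
`Literature.NumberTheory.Sieve.MaynardProductKernelCert4500`, parity-ideate-p3 ROUND-18 template). [cite: Polymath8b2014, Theorem 6.7 (product test function), numerical instance k = 3750] -/
theorem pow2_eq (n : ℕ) : pow2 n = 2 ^ n := by rw [pow2, Nat.one_shiftLeft]
/-- Checker step `onesBelow_eq` of the `k = 3750` kernel certificate (statement and proof adapted from
`Literature.NumberTheory.Sieve.MaynardProductKernelCert4500`, parity-ideate-p3 ROUND-18 template). [cite: Polymath8b2014, Theorem 6.7 (product test function), numerical instance k = 3750] -/
theorem onesBelow_eq (n : ℕ) : onesBelow n = 2 ^ n - 1 := by rw [onesBelow, pow2_eq]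
/-- core bit lemmas RESTATED at a variable exponent: under Mathlib `2 ^ n : ℕ` elaborates through `Monoid.npow`, the core
lemmas through `Nat.pow`; rewriting with a core lemma at a closed exponent `> 2^24` makes the kernel unfold `Nat.pow` unarily
("deep recursion").  Instantiating these restatements is syntactic.
(adapted from `MaynardProductKernelCert4500`). [cite: Polymath8b2014, Theorem 6.7 (product test function), numerical instance k = 3750] -/
theorem land_onesBelow (x n : ℕ) : x &&& onesBelow n = x % 2 ^ n := by
  rw [onesBelow_eq]; exact Nat.and_two_pow_sub_one_eq_mod x n
/-- Checker step `trunc_eq` of the `k = 3750` kernel certificate (statement and proof adapted from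
`Literature.NumberTheory.Sieve.MaynardProductKernelCert4500`, parity-ideate-p3 ROUND-18 template). [cite: Polymath8b2014, Theorem 6.7 (product test function), numerical instance k = 3750] -/
theorem trunc_eq (x : ℕ) : trunc x = x % 2 ^ (BB * MM) := by
  rw [trunc, land_onesBelow]
/-- Checker step `repUnit_eq` of the `k = 3750` kernel certificate (statement and proof adapted from
`Literature.NumberTheory.Sieve.MaynardProductKernelCert4500`, parity-ideate-p3 ROUND-18 template). [cite: Polymath8b2014, Theorem 6.7 (product test function), numerical instance k = 3750] -/
theorem repUnit_eq (J : ℕ) : repUnit J = kpack BB J (fun _ => 1) := by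
  rw [repUnit, onesBelow_eq, onesBelow_eq, kpack]
  have h2 : 2 ≤ 2 ^ BB := by
    calc 2 = 2 ^ 1 := by norm_num
      _ ≤ 2 ^ BB := Nat.pow_le_pow_right (by norm_num) BB_pos
  rw [pow_mul, ← Nat.geomSum_eq h2 J]
  refine Finset.sum_congr rfl fun j _ => ?_
  rw [one_mul, ← pow_mul]
/-- Checker step `kpack_const` of the `k = 3750` kernel certificate (statement and proof adapted from
`Literature.NumberTheory.Sieve.MaynardProductKernelCert4500`, parity-ideate-p3 ROUND-18 template). [cite: Polymath8b2014, Theorem 6.7 (product test function), numerical instance k = 3750] -/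
theorem kpack_const (J v : ℕ) : kpack BB J (fun _ => v) = repUnit J * v := by
  rw [repUnit_eq, kpack, kpack, Finset.sum_mul]
  exact Finset.sum_congr rfl fun j _ => by ring
/-- Checker step `maskLo_eq` of the `k = 3750` kernel certificate (statement and proof adapted from
`Literature.NumberTheory.Sieve.MaynardProductKernelCert4500`, parity-ideate-p3 ROUND-18 template). [cite: Polymath8b2014, Theorem 6.7 (product test function), numerical instance k = 3750] -/
theorem maskLo_eq : maskLo = kpack BB MM (fun _ => 2 ^ (BB - LL) - 1) := by
  rw [maskLo, kpack_const, onesBelow_eq]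
/-- Checker step `rndC_eq` of the `k = 3750` kernel certificate (statement and proof adapted from
`Literature.NumberTheory.Sieve.MaynardProductKernelCert4500`, parity-ideate-p3 ROUND-18 template). [cite: Polymath8b2014, Theorem 6.7 (product test function), numerical instance k = 3750] -/
theorem rndC_eq : rndC = kpack BB MM (fun _ => 2 ^ LL - 1) := by
  rw [rndC, kpack_const, onesBelow_eq]
/-- Checker step `ssum_def` of the `k = 3750` kernel certificate (statement and proof adapted from
`Literature.NumberTheory.Sieve.MaynardProductKernelCert4500`, parity-ideate-p3 ROUND-18 template). [cite: Polymath8b2014, Theorem 6.7 (product test function), numerical instance k = 3750] -/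
theorem ssum_def (N : ℕ) : ssum N = N % (2 ^ BB - 1) := by rw [ssum, onesBelow_eq]
/-- Checker step `psum_def` of the `k = 3750` kernel certificate (statement and proof adapted from
`Literature.NumberTheory.Sieve.MaynardProductKernelCert4500`, parity-ideate-p3 ROUND-18 template). [cite: Polymath8b2014, Theorem 6.7 (product test function), numerical instance k = 3750] -/
theorem psum_def (N J : ℕ) : psum N J = N % 2 ^ (BB * J) % (2 ^ BB - 1) := by
  rw [psum, land_onesBelow, onesBelow_eq]

/-! ## Digit bookkeeping -/
/-- Checker step `digits_lt` of the `k = 3750` kernel certificate (statement and proof adapted from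
`Literature.NumberTheory.Sieve.MaynardProductKernelCert4500`, parity-ideate-p3 ROUND-18 template). [cite: Polymath8b2014, Theorem 6.7 (product test function), numerical instance k = 3750] -/
theorem digits_lt {w : ℕ → ℕ} (hs : ∑ m ∈ range MM, w m < 2 ^ BB - 1) : ∀ j < MM, w j < 2 ^ BB :=
  fun j hj => lt_of_le_of_lt (Finset.single_le_sum (f := w) (fun _ _ => Nat.zero_le _) (Finset.mem_range.2 hj))
    (by omega)
/-- Checker step `ssum_kpack` of the `k = 3750` kernel certificate (statement and proof adapted from
`Literature.NumberTheory.Sieve.MaynardProductKernelCert4500`, parity-ideate-p3 ROUND-18 template). [cite: Polymath8b2014, Theorem 6.7 (product test function), numerical instance k = 3750] -/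
theorem ssum_kpack {w : ℕ → ℕ} (hs : ∑ m ∈ range MM, w m < 2 ^ BB - 1) :
    ssum (kpack BB MM w) = ∑ m ∈ range MM, w m := by
  rw [ssum_def, sum_eq_kpack_mod_mod le_rfl (digits_lt hs) hs, Nat.mod_eq_of_lt (kpack_lt (digits_lt hs))]
/-- Checker step `psum_kpack` of the `k = 3750` kernel certificate (statement and proof adapted from
`Literature.NumberTheory.Sieve.MaynardProductKernelCert4500`, parity-ideate-p3 ROUND-18 template). [cite: Polymath8b2014, Theorem 6.7 (product test function), numerical instance k = 3750] -/
theorem psum_kpack {w : ℕ → ℕ} (hs : ∑ m ∈ range MM, w m < 2 ^ BB - 1) {J : ℕ} (hJ : J ≤ MM) :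
    psum (kpack BB MM w) J = ∑ m ∈ range J, w m := by
  rw [psum_def]
  refine (sum_eq_kpack_mod_mod hJ (fun j hj => digits_lt hs j (by omega)) ?_).symm
  exact lt_of_le_of_lt (Finset.sum_le_sum_of_subset (by simpa using hJ)) hs

/-! ## The real side: Polymath's profile at the parameters -/
noncomputable section

/-- Checker plumbing `cR`: an exact-integer constant / function of the `k = 3750` kernel certificate
(see the module docstring; adapted from `MaynardProductKernelCert4500`). [folklore] -/
def cR : ℝ := (cn : ℝ) / cd
/-- Checker plumbing `TR`: an exact-integer constant / function of the `k = 3750` kernel certificate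
(see the module docstring; adapted from `MaynardProductKernelCert4500`). [folklore] -/
def TR : ℝ := (Tn : ℝ) / Td
/-- Checker plumbing `hR`: an exact-integer constant / function of the `k = 3750` kernel certificate
(see the module docstring; adapted from `MaynardProductKernelCert4500`). [folklore] -/
def hR : ℝ := 1 / (N1 : ℝ)
/-- Checker plumbing `gK`: an exact-integer constant / function of the `k = 3750` kernel certificate
(see the module docstring; adapted from `MaynardProductKernelCert4500`). [folklore] -/
def gK : ℝ → ℝ := polymathProfile (nK + 2) cR TR
/-- Checker plumbing `m2R`: an exact-integer constant / function of the `k = 3750` kernel certificate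
(see the module docstring; adapted from `MaynardProductKernelCert4500`). [folklore] -/
def m2R : ℝ := TR / (cR * (cR + ((nK : ℝ) + 1) * TR))
/-- Checker plumbing `pp`: an exact-integer constant / function of the `k = 3750` kernel certificate
(see the module docstring; adapted from `MaynardProductKernelCert4500`). [folklore] -/
def pp (j : ℕ) : ℝ := cellMass (fun t => polymathProfile (nK + 2) cR TR t ^ 2) hR j
/-- Checker plumbing `pt`: an exact-integer constant / function of the `k = 3750` kernel certificate
(see the module docstring; adapted from `MaynardProductKernelCert4500`). [folklore] -/
def pt (j : ℕ) : ℝ := pp j / m2R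

/-- Checker step `cR_pos` of the `k = 3750` kernel certificate (statement and proof adapted from
`Literature.NumberTheory.Sieve.MaynardProductKernelCert4500`, parity-ideate-p3 ROUND-18 template). [cite: Polymath8b2014, Theorem 6.7 (product test function), numerical instance k = 3750] -/
theorem cR_pos : 0 < cR := by
  have := param_pos; unfold cR; exact div_pos (by exact_mod_cast this.1) (by exact_mod_cast this.2.1)
/-- Checker step `TR_pos` of the `k = 3750` kernel certificate (statement and proof adapted from
`Literature.NumberTheory.Sieve.MaynardProductKernelCert4500`, parity-ideate-p3 ROUND-18 template). [cite: Polymath8b2014, Theorem 6.7 (product test function), numerical instance k = 3750] -/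
theorem TR_pos : 0 < TR := by
  have := param_pos; unfold TR; exact div_pos (by exact_mod_cast this.2.2.1) (by exact_mod_cast this.2.2.2.1)
/-- Checker step `N1_pos` of the `k = 3750` kernel certificate (statement and proof adapted from
`Literature.NumberTheory.Sieve.MaynardProductKernelCert4500`, parity-ideate-p3 ROUND-18 template). [cite: Polymath8b2014, Theorem 6.7 (product test function), numerical instance k = 3750] -/
theorem N1_pos : (0 : ℝ) < N1 := by have := param_pos; exact_mod_cast this.2.2.2.2.1
/-- Checker step `hR_pos` of the `k = 3750` kernel certificate (statement and proof adapted from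
`Literature.NumberTheory.Sieve.MaynardProductKernelCert4500`, parity-ideate-p3 ROUND-18 template). [cite: Polymath8b2014, Theorem 6.7 (product test function), numerical instance k = 3750] -/
theorem hR_pos : 0 < hR := by unfold hR; exact div_pos one_pos N1_pos
/-- Checker step `m2R_pos` of the `k = 3750` kernel certificate (statement and proof adapted from
`Literature.NumberTheory.Sieve.MaynardProductKernelCert4500`, parity-ideate-p3 ROUND-18 template). [cite: Polymath8b2014, Theorem 6.7 (product test function), numerical instance k = 3750] -/
theorem m2R_pos : 0 < m2R := by
  unfold m2R
  have h1 : (0:ℝ) ≤ ((nK : ℝ) + 1) * TR := mul_nonneg (by positivity) TR_pos.le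
  exact div_pos TR_pos (mul_pos cR_pos (by linarith [cR_pos]))
/-- Checker step `pp_nonneg` of the `k = 3750` kernel certificate (statement and proof adapted from
`Literature.NumberTheory.Sieve.MaynardProductKernelCert4500`, parity-ideate-p3 ROUND-18 template). [cite: Polymath8b2014, Theorem 6.7 (product test function), numerical instance k = 3750] -/
theorem pp_nonneg (j : ℕ) : 0 ≤ pp j := cellMass_nonneg (fun _ => sq_nonneg _) hR j
/-- Checker step `pt_nonneg` of the `k = 3750` kernel certificate (statement and proof adapted from
`Literature.NumberTheory.Sieve.MaynardProductKernelCert4500`, parity-ideate-p3 ROUND-18 template). [cite: Polymath8b2014, Theorem 6.7 (product test function), numerical instance k = 3750] -/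
theorem pt_nonneg (j : ℕ) : 0 ≤ pt j := div_nonneg (pp_nonneg j) m2R_pos.le
/-- Checker step `pp_eq` of the `k = 3750` kernel certificate (statement and proof adapted from
`Literature.NumberTheory.Sieve.MaynardProductKernelCert4500`, parity-ideate-p3 ROUND-18 template). [cite: Polymath8b2014, Theorem 6.7 (product test function), numerical instance k = 3750] -/
theorem pp_eq (j : ℕ) : pp j = m2R * pt j := by
  rw [pt, mul_div_cancel₀ _ m2R_pos.ne']

/-- Checker step `kK_sub_one` of the `k = 3750` kernel certificate (statement and proof adapted from
`Literature.NumberTheory.Sieve.MaynardProductKernelCert4500`, parity-ideate-p3 ROUND-18 template). [cite: Polymath8b2014, Theorem 6.7 (product test function), numerical instance k = 3750] -/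
theorem kK_sub_one : kK - 1 = nK + 1 := rfl
/-- Checker step `cast_kK_sub_one` of the `k = 3750` kernel certificate (statement and proof adapted from
`Literature.NumberTheory.Sieve.MaynardProductKernelCert4500`, parity-ideate-p3 ROUND-18 template). [cite: Polymath8b2014, Theorem 6.7 (product test function), numerical instance k = 3750] -/
theorem cast_kK_sub_one : (((nK + 2 : ℕ) : ℝ) - 1) = (nK : ℝ) + 1 := by push_cast; ring

/-- `T = Jc·h`.
(adapted from `MaynardProductKernelCert4500`). [cite: Polymath8b2014, Theorem 6.7 (product test function), numerical instance k = 3750] -/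
theorem TR_eq : TR = (Jc : ℝ) * hR := by
  have h' : (Jc : ℝ) * Td = Tn * N1 := by exact_mod_cast Jc_mul
  have hTd : (0:ℝ) < Td := by exact_mod_cast param_pos.2.2.2.1
  have hN1 : (0:ℝ) < N1 := N1_pos
  unfold TR hR
  rw [div_eq_iff hTd.ne', mul_one_div, div_mul_eq_mul_div, eq_div_iff hN1.ne']
  linarith [h']

/-- the exact cell masses, normalised: `pt j = NUM / DEN j` on the support.
(adapted from `MaynardProductKernelCert4500`). [cite: Polymath8b2014, Theorem 6.7 (product test function), numerical instance k = 3750] -/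
theorem pt_eq {j : ℕ} (hj : j < Jc) : pt j = (NUM : ℝ) / (DEN j : ℝ) := by
  have hc := cR_pos; have hT := TR_pos; have hh := hR_pos
  have hjT : ((j : ℝ) + 1) * hR ≤ TR := by
    rw [TR_eq]; have : (j : ℝ) + 1 ≤ Jc := by exact_mod_cast hj
    exact mul_le_mul_of_nonneg_right this hh.le
  have hcell := cellMass_polymathProfile_sq (k := nK + 2) (c := cR) (T := TR) (by omega) hc hh hjT
  rw [pt, pp, hcell, cast_kK_sub_one, m2R]
  unfold cR TR hR
  rw [DEN, Aa, Aa, NUM, kK_sub_one]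
  have h1 : (0:ℝ) < cn := by exact_mod_cast param_pos.1
  have h2 : (0:ℝ) < cd := by exact_mod_cast param_pos.2.1
  have h3 : (0:ℝ) < Tn := by exact_mod_cast param_pos.2.2.1
  have h4 : (0:ℝ) < Td := by exact_mod_cast param_pos.2.2.2.1
  have h5 : (0:ℝ) < N1 := N1_pos
  push_cast
  field_simp
  ring

/-- Checker step `pt_eq_zero` of the `k = 3750` kernel certificate (statement and proof adapted from
`Literature.NumberTheory.Sieve.MaynardProductKernelCert4500`, parity-ideate-p3 ROUND-18 template). [cite: Polymath8b2014, Theorem 6.7 (product test function), numerical instance k = 3750] -/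
theorem pt_eq_zero {j : ℕ} (hj : Jc ≤ j) : pt j = 0 := by
  have hjT : TR ≤ (j : ℝ) * hR := by
    rw [TR_eq]; exact mul_le_mul_of_nonneg_right (by exact_mod_cast hj) hR_pos.le
  rw [pt, pp, cellMass_polymathProfile_sq_eq_zero hjT, zero_div]

/-- Checker step `Aa_pos` of the `k = 3750` kernel certificate (statement and proof adapted from
`Literature.NumberTheory.Sieve.MaynardProductKernelCert4500`, parity-ideate-p3 ROUND-18 template). [cite: Polymath8b2014, Theorem 6.7 (product test function), numerical instance k = 3750] -/
theorem Aa_pos (j : ℕ) : 0 < Aa j := by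
  unfold Aa; exact Nat.lt_of_lt_of_le (Nat.mul_pos param_pos.1 param_pos.2.2.2.2.1) (Nat.le_add_right _ _)
/-- Checker step `DEN_pos` of the `k = 3750` kernel certificate (statement and proof adapted from
`Literature.NumberTheory.Sieve.MaynardProductKernelCert4500`, parity-ideate-p3 ROUND-18 template). [cite: Polymath8b2014, Theorem 6.7 (product test function), numerical instance k = 3750] -/
theorem DEN_pos (j : ℕ) : 0 < DEN j := by
  unfold DEN; exact Nat.mul_pos (Nat.mul_pos param_pos.2.2.1 (Aa_pos j)) (Aa_pos (j + 1))
/-- Checker step `DEN_mono` of the `k = 3750` kernel certificate (statement and proof adapted from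
`Literature.NumberTheory.Sieve.MaynardProductKernelCert4500`, parity-ideate-p3 ROUND-18 template). [cite: Polymath8b2014, Theorem 6.7 (product test function), numerical instance k = 3750] -/
theorem DEN_mono (j : ℕ) : DEN 0 ≤ DEN j := by
  unfold DEN Aa
  gcongr <;> omega

/-- Checker step `leaf_le` of the `k = 3750` kernel certificate (statement and proof adapted from
`Literature.NumberTheory.Sieve.MaynardProductKernelCert4500`, parity-ideate-p3 ROUND-18 template). [cite: Polymath8b2014, Theorem 6.7 (product test function), numerical instance k = 3750] -/
theorem leaf_le (j : ℕ) : leaf j ≤ 2 ^ LL := by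
  unfold leaf; split_ifs
  · calc 2 ^ LL * NUM / DEN j ≤ 2 ^ LL * NUM / DEN 0 := Nat.div_le_div_left (DEN_mono j) (DEN_pos 0)
      _ ≤ 2 ^ LL * DEN 0 / DEN 0 := Nat.div_le_div_right (Nat.mul_le_mul_left _ NUM_le_DEN0)
      _ = 2 ^ LL := Nat.mul_div_cancel _ (DEN_pos 0)
  · exact Nat.zero_le _

/-- Checker step `sum_leaf_lt` of the `k = 3750` kernel certificate (statement and proof adapted from
`Literature.NumberTheory.Sieve.MaynardProductKernelCert4500`, parity-ideate-p3 ROUND-18 template). [cite: Polymath8b2014, Theorem 6.7 (product test function), numerical instance k = 3750] -/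
theorem sum_leaf_lt : ∑ m ∈ range MM, leaf m < 2 ^ BB - 1 :=
  lt_of_le_of_lt (by simpa using Finset.sum_le_sum (s := range MM) fun m _ => leaf_le m) (by
    have := sizeF; simpa [Finset.sum_const, Finset.card_range] using this)
/-- Checker step `sum_uu_lt` of the `k = 3750` kernel certificate (statement and proof adapted from
`Literature.NumberTheory.Sieve.MaynardProductKernelCert4500`, parity-ideate-p3 ROUND-18 template). [cite: Polymath8b2014, Theorem 6.7 (product test function), numerical instance k = 3750] -/
theorem sum_uu_lt : ∑ m ∈ range MM, uu m < 2 ^ BB - 1 := by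
  have h1 : ∀ m ∈ range MM, uu m ≤ 2 ^ LL + 1 := fun m _ => by
    unfold uu ind; split_ifs <;> have := leaf_le m <;> omega
  exact lt_of_le_of_lt (Finset.sum_le_sum h1) (by simpa [Finset.sum_const, Finset.card_range] using sizeC)

/-- floor initial vector: `leaf_j / 2^L ≤ pt_j`.
(adapted from `MaynardProductKernelCert4500`). [cite: Polymath8b2014, Theorem 6.7 (product test function), numerical instance k = 3750] -/
theorem leaf_div_le (m : ℕ) : ((leaf m : ℕ) : ℝ) / ((2 ^ LL : ℕ) : ℝ) ≤ pt m := by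
  unfold leaf; split_ifs with hm
  · rw [pt_eq hm, div_le_div_iff₀ (by positivity) (by exact_mod_cast DEN_pos m)]
    have : ((2 ^ LL * NUM / DEN m : ℕ) : ℝ) * DEN m ≤ ((2 ^ LL * NUM : ℕ) : ℝ) := by
      exact_mod_cast Nat.div_mul_le_self _ _
    push_cast at this ⊢; linarith
  · simp [pt_nonneg]
/-- ceil initial vector: `pt_j ≤ uu_j / 2^L` (ℕ-side proof: the ℝ-side `nlinarith` route makes the kernel recurse).
(adapted from `MaynardProductKernelCert4500`). [cite: Polymath8b2014, Theorem 6.7 (product test function), numerical instance k = 3750] -/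
theorem le_uu_div (m : ℕ) : pt m ≤ ((uu m : ℕ) : ℝ) / ((2 ^ LL : ℕ) : ℝ) := by
  unfold uu leaf ind; split_ifs with hm
  · rw [pt_eq hm, div_le_div_iff₀ (by exact_mod_cast DEN_pos m) (by exact_mod_cast Nat.two_pow_pos LL)]
    have hnat : NUM * 2 ^ LL ≤ (2 ^ LL * NUM / DEN m + 1) * DEN m := by
      rw [Nat.mul_comm NUM, Nat.add_mul, Nat.one_mul]
      exact (Nat.lt_div_mul_add (DEN_pos m)).le
    exact_mod_cast hnat
  · rw [pt_eq_zero (not_lt.1 hm), Nat.add_zero, Nat.cast_zero, zero_div]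

/-! ## Chain invariants -/
/-- `InvF n N` — the floor-chain invariant: the packed integer `N` encodes fixed-point LOWER bounds `w m / 2^LL ≤ p^{*n}(m)` of the `n`-th convolution power, with the no-carry bound `Σ w < 2^BB − 1`
(Kronecker packing of Polymath's product-test-function evaluation; adapted from `MaynardProductKernelCert4500`). [cite: Polymath8b2014, Theorem 6.7 (product test function), numerical instance k = 3750] -/
def InvF (n N : ℕ) : Prop :=
  ∃ w : ℕ → ℕ, N = kpack BB MM w ∧ (∀ m < MM, ((w m : ℕ) : ℝ) / ((2 ^ LL : ℕ) : ℝ) ≤ dconvPow pt n m) ∧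
    ∑ m ∈ range MM, w m < 2 ^ BB - 1
/-- `InvC n N` — the ceil-chain invariant: the packed integer `N` encodes fixed-point UPPER bounds `p^{*n}(m) ≤ w m / 2^LL` of the `n`-th convolution power, with the no-carry bound `Σ w < 2^BB − 1`
(Kronecker packing of Polymath's product-test-function evaluation; adapted from `MaynardProductKernelCert4500`). [cite: Polymath8b2014, Theorem 6.7 (product test function), numerical instance k = 3750] -/
def InvC (n N : ℕ) : Prop :=
  ∃ w : ℕ → ℕ, N = kpack BB MM w ∧ (∀ m < MM, dconvPow pt n m ≤ ((w m : ℕ) : ℝ) / ((2 ^ LL : ℕ) : ℝ)) ∧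
    ∑ m ∈ range MM, w m < 2 ^ BB - 1

/-- packing blocks of `K` equal digits: `kpack (B·K) n (c_b · repUnit K)_b = kpack B (K·n) (c_{⌊j/K⌋})_j` (over variables). [cite: Polymath8b2014, Theorem 6.7 (product test function), numerical instance k = 3750] -/
theorem kpack_blocks (K n : ℕ) (c : ℕ → ℕ) (hK : 0 < K) :
    kpack (BB * K) n (fun b => c b * repUnit K) = kpack BB (K * n) (fun j => c (j / K)) := by
  induction n with
  | zero => simp [kpack]
  | succ n ih =>
      have hc : kpack BB K (fun i => c ((K * n + i) / K)) = kpack BB K (fun _ => c n) :=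
        kpack_congr fun i hi => by rw [Nat.mul_add_div hK, Nat.div_eq_of_lt hi, Nat.add_zero]
      have e2 : 2 ^ (BB * K * n) = 2 ^ (BB * (K * n)) := by rw [Nat.mul_assoc]
      rw [kpack_succ, ih, Nat.mul_succ, kpack_add, hc, kpack_const, e2]
      ring
/-- `Aa` is an arithmetic progression. [cite: Polymath8b2014, Theorem 6.7 (product test function), numerical instance k = 3750] -/
theorem Aa_succ (j : ℕ) : Aa (j + 1) = Aa j + bA := by
  unfold Aa bA; ring
/-- the grouped leaf is the 4-digit packing of the exact leaves (over a variable `q`). [cite: Polymath8b2014, Theorem 6.7 (product test function), numerical instance k = 3750] -/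
theorem leaf4_eq (q : ℕ) : leaf4 q = kpack BB 4 (fun t => leafE (4 * q + t)) := by
  have e1 : Aa (4 * q + 1) = Aa (4 * q) + bA := Aa_succ _
  have e2 : Aa (4 * q + 2) = Aa (4 * q) + bA + bA := by rw [show 4 * q + 2 = 4 * q + 1 + 1 by ring, Aa_succ, e1]
  have e3 : Aa (4 * q + 3) = Aa (4 * q) + bA + bA + bA := by rw [show 4 * q + 3 = 4 * q + 2 + 1 by ring, Aa_succ, e2]
  have e4 : Aa (4 * q + 4) = Aa (4 * q) + bA + bA + bA + bA := by rw [show 4 * q + 4 = 4 * q + 3 + 1 by ring, Aa_succ, e3]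
  simp only [leaf4, kpack, Finset.sum_range_succ, Finset.sum_range_zero, leafE, CNUM, DEN]
  rw [show 4 * q + 0 = 4 * q by ring, show 4 * q + 0 + 1 = 4 * q + 1 by ring, show 4 * q + 1 + 1 = 4 * q + 2 by ring,
    show 4 * q + 2 + 1 = 4 * q + 3 by ring, show 4 * q + 3 + 1 = 4 * q + 4 by ring, e1, e2, e3, e4]
  ring
/-- grouping four digits per super-digit (over variables). [cite: Polymath8b2014, Theorem 6.7 (product test function), numerical instance k = 3750] -/
theorem kpack_group4 (n : ℕ) (f : ℕ → ℕ) :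
    kpack (4 * BB) n (fun q => kpack BB 4 (fun t => f (4 * q + t))) = kpack BB (4 * n) f := by
  induction n with
  | zero => simp [kpack]
  | succ n ih =>
      rw [kpack_succ, ih, Nat.mul_succ, kpack_add]
      have e2 : 2 ^ (4 * BB * n) = 2 ^ (BB * (4 * n)) := by ring_nf
      rw [e2]; ring
/-- the two-part initial vector is the packing of `wvE 18` over `2^18 + K·2^f` digits (only small closed numerals are rewritten). [cite: Polymath8b2014, Theorem 6.7 (product test function), numerical instance k = 3750] -/
theorem initPack_eq (f : ℕ) :
    kpackDC (4 * BB) leaf4 16 0 + (kpackDC (BB * BK) (fun b => bleafE 18 b * repUnit BK) f 0 <<< (BB * 2 ^ 18)) =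
      kpack BB (2 ^ 18 + BK * 2 ^ f) (wvE 18) := by
  have hK : 0 < BK := by decide
  have hg : kpack (4 * BB) (2 ^ 16) leaf4 = kpack BB (2 ^ 18) leafE := by
    rw [(kpack_congr fun q _ => leaf4_eq q : kpack (4 * BB) (2 ^ 16) leaf4 = _), kpack_group4,
      show (4 * 2 ^ 16 : ℕ) = 2 ^ 18 by norm_num]
  rw [kpackDC_zero_eq, kpackDC_zero_eq, hg, Nat.shiftLeft_eq, kpack_blocks BK (2 ^ f) (bleafE 18) hK, kpack_add]
  have h1 : kpack BB (2 ^ 18) leafE = kpack BB (2 ^ 18) (wvE 18) :=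
    kpack_congr fun m hm => by rw [wvE, if_pos hm]
  have h2 : kpack BB (BK * 2 ^ f) (fun j => bleafE 18 (j / BK)) = kpack BB (BK * 2 ^ f) (fun i => wvE 18 (2 ^ 18 + i)) :=
    kpack_congr fun m _ => by
      rw [wvE, if_neg (Nat.not_lt.2 (Nat.le_add_right _ _)), Nat.add_sub_cancel_left]
  rw [h1, h2, Nat.mul_comm (kpack BB (BK * 2 ^ f) _) (2 ^ (BB * 2 ^ 18))]
/-- a packed vector does not see trailing zero digits (over variables). [cite: Polymath8b2014, Theorem 6.7 (product test function), numerical instance k = 3750] -/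
theorem kpack_extend (m r : ℕ) (w w' : ℕ → ℕ) (hw : ∀ j < m, w' j = w j) (hz : ∀ j, m ≤ j → w' j = 0) :
    kpack BB m w = kpack BB (m + r) w' := by
  rw [kpack_add, (kpack_congr hw : kpack BB m w' = kpack BB m w)]
  have h0 : kpack BB r (fun i => w' (m + i)) = 0 :=
    Finset.sum_eq_zero fun i _ => by
      show w' (m + i) * 2 ^ (BB * i) = 0
      rw [hz (m + i) (Nat.le_add_right _ _), Nat.zero_mul]
  rw [h0, Nat.mul_zero, Nat.add_zero]
/-- support arithmetic: `2^18 + 8·2^16 = Jc`. [cite: Polymath8b2014, Theorem 6.7 (product test function), numerical instance k = 3750] -/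
theorem Jc_split : 2 ^ 18 + BK * 2 ^ 16 = Jc := by decide
/-- support arithmetic: `Jc + (MM − Jc) = MM`. [cite: Polymath8b2014, Theorem 6.7 (product test function), numerical instance k = 3750] -/
theorem MM_split : Jc + (MM - Jc) = MM := by decide
/-- **the packed floor initial vector is `kpack BB MM wv`** (instantiation of `initPack_eq` + trailing zeros). [cite: Polymath8b2014, Theorem 6.7 (product test function), numerical instance k = 3750] -/
theorem NL_eq : NL = kpack BB MM wv := by
  have h := initPack_eq 16
  rw [Jc_split] at h
  have hx := kpack_extend Jc (MM - Jc) (wvE 18) wv (fun j hj => by rw [wv, if_pos hj])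
    (fun j hj => by rw [wv, if_neg (Nat.not_lt.2 hj)])
  rw [MM_split] at hx
  exact h.trans hx
/-- Checker step `ind_pack` of the `k = 3750` kernel certificate (statement and proof adapted from
`Literature.NumberTheory.Sieve.MaynardProductKernelCert4500`, parity-ideate-p3 ROUND-18 template). [cite: Polymath8b2014, Theorem 6.7 (product test function), numerical instance k = 3750] -/
theorem ind_pack : kpack BB MM ind = repUnit Jc := by
  rw [repUnit_eq]
  have hr : MM = Jc + (MM - Jc) := (Nat.add_sub_cancel' Jc_lt_MM.le).symm
  rw [hr, kpack_add]
  have h0 : kpack BB (MM - Jc) (fun i => ind (Jc + i)) = 0 :=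
    Finset.sum_eq_zero fun i _ => by
      have : ¬ (Jc + i < Jc) := Nat.not_lt.2 (Nat.le_add_right Jc i)
      simp only [ind, this, if_false, Nat.zero_mul]
  rw [h0, Nat.mul_zero, Nat.add_zero]
  exact kpack_congr fun m hm => by simp only [ind, hm, if_true]
/-- Checker step `NU_eq` of the `k = 3750` kernel certificate (statement and proof adapted from
`Literature.NumberTheory.Sieve.MaynardProductKernelCert4500`, parity-ideate-p3 ROUND-18 template). [cite: Polymath8b2014, Theorem 6.7 (product test function), numerical instance k = 3750] -/
theorem NU_eq : NU = kpack BB MM uu := kpackDC_zero_eq BB uu eE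

/-- `DEN` is monotone (the density `g²` is decreasing). [cite: Polymath8b2014, Theorem 6.7 (product test function), numerical instance k = 3750] -/
theorem DEN_le_DEN {i j : ℕ} (h : i ≤ j) : DEN i ≤ DEN j := by
  unfold DEN Aa
  gcongr
/-- `pt` is antitone on the support. [cite: Polymath8b2014, Theorem 6.7 (product test function), numerical instance k = 3750] -/
theorem pt_anti {i j : ℕ} (h : i ≤ j) (hj : j < Jc) : pt j ≤ pt i := by
  rw [pt_eq hj, pt_eq (lt_of_le_of_lt h hj)]
  exact div_le_div_of_nonneg_left (Nat.cast_nonneg _) (by exact_mod_cast DEN_pos i) (by exact_mod_cast DEN_le_DEN h)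
/-- exact leaf below the cell mass: `leafE j / 2^L ≤ pt j` on the support. [cite: Polymath8b2014, Theorem 6.7 (product test function), numerical instance k = 3750] -/
theorem leafE_div_le {j : ℕ} (hj : j < Jc) : ((leafE j : ℕ) : ℝ) / ((2 ^ LL : ℕ) : ℝ) ≤ pt j := by
  rw [leafE, pt_eq hj, div_le_div_iff₀ (by positivity) (by exact_mod_cast DEN_pos j)]
  have : ((2 ^ LL * NUM / DEN j : ℕ) : ℝ) * DEN j ≤ ((2 ^ LL * NUM : ℕ) : ℝ) := by
    exact_mod_cast Nat.div_mul_le_self _ _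
  push_cast at this ⊢; linarith
/-- `leafE j ≤ 2^L`. [cite: Polymath8b2014, Theorem 6.7 (product test function), numerical instance k = 3750] -/
theorem leafE_le (j : ℕ) : leafE j ≤ 2 ^ LL := by
  unfold leafE
  calc 2 ^ LL * NUM / DEN j ≤ 2 ^ LL * NUM / DEN 0 := Nat.div_le_div_left (DEN_mono j) (DEN_pos 0)
    _ ≤ 2 ^ LL * DEN 0 / DEN 0 := Nat.div_le_div_right (Nat.mul_le_mul_left _ NUM_le_DEN0)
    _ = 2 ^ LL := Nat.mul_div_cancel _ (DEN_pos 0)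
/-- **the floor initial vector is below the cell masses**: `wv m / 2^L ≤ pt m` (exact cells: floor; block cells: the block's last
cell has the smallest mass; beyond the support both vanish). [cite: Polymath8b2014, Theorem 6.7 (product test function), numerical instance k = 3750] -/
theorem wv_div_le (m : ℕ) : ((wv m : ℕ) : ℝ) / ((2 ^ LL : ℕ) : ℝ) ≤ pt m := by
  unfold wv
  split_ifs with hm
  · unfold wvE
    split_ifs with hlo
    · exact leafE_div_le hm
    · have hK : 0 < BK := by decide
      have hB : BK = 8 := rfl
      have hJ : Jc = 786432 := by decide
      have hP : (2 : ℕ) ^ 18 = 262144 := by norm_num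
      have h1 := Nat.div_add_mod (m - 2 ^ 18) 8
      have h2 := Nat.mod_lt (m - 2 ^ 18) (by decide : 0 < 8)
      have hm' : m ≤ 2 ^ 18 + BK * ((m - 2 ^ 18) / BK) + (BK - 1) := by
        show m ≤ 2 ^ 18 + 8 * ((m - 2 ^ 18) / 8) + (8 - 1); omega
      have hℓ : 2 ^ 18 + BK * ((m - 2 ^ 18) / BK) + (BK - 1) < Jc := by
        show 2 ^ 18 + 8 * ((m - 2 ^ 18) / 8) + (8 - 1) < Jc; omega
      exact (leafE_div_le hℓ).trans (pt_anti hm' hℓ)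
  · rw [pt_eq_zero (Nat.not_lt.1 hm), Nat.cast_zero, zero_div]
/-- `Σ_{m<M} wv m < 2^B − 1` (each digit `≤ 2^L`). [cite: Polymath8b2014, Theorem 6.7 (product test function), numerical instance k = 3750] -/
theorem sum_wv_lt : ∑ m ∈ range MM, wv m < 2 ^ BB - 1 := by
  have h1 : ∀ m ∈ range MM, wv m ≤ 2 ^ LL := fun m _ => by
    unfold wv wvE bleafE; split_ifs <;> first | exact leafE_le _ | exact Nat.zero_le _
  exact lt_of_le_of_lt (Finset.sum_le_sum h1) (by
    have := sizeF; simpa [Finset.sum_const, Finset.card_range] using this)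
/-- Checker step `invF_init`: the packed floor initial vector satisfies the chain invariant at `n = 1`. [cite: Polymath8b2014, Theorem 6.7 (product test function), numerical instance k = 3750] -/
theorem invF_init : InvF 1 NL :=
  ⟨wv, NL_eq, fun m _ => by rw [dconvPow_one]; exact wv_div_le m, sum_wv_lt⟩
/-- Checker step `invC_init` of the `k = 3750` kernel certificate (statement and proof adapted from
`Literature.NumberTheory.Sieve.MaynardProductKernelCert4500`, parity-ideate-p3 ROUND-18 template). [cite: Polymath8b2014, Theorem 6.7 (product test function), numerical instance k = 3750] -/
theorem invC_init : InvC 1 NU :=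
  ⟨uu, NU_eq, fun m _ => by rw [dconvPow_one]; exact le_uu_div m, sum_uu_lt⟩

/-- Checker step `two_pow_LL_pos` of the `k = 3750` kernel certificate (statement and proof adapted from
`Literature.NumberTheory.Sieve.MaynardProductKernelCert4500`, parity-ideate-p3 ROUND-18 template). [cite: Polymath8b2014, Theorem 6.7 (product test function), numerical instance k = 3750] -/
theorem two_pow_LL_pos : 0 < 2 ^ LL := Nat.two_pow_pos LL

/-- Checker step `InvF.step` of the `k = 3750` kernel certificate (statement and proof adapted from
`Literature.NumberTheory.Sieve.MaynardProductKernelCert4500`, parity-ideate-p3 ROUND-18 template). [cite: Polymath8b2014, Theorem 6.7 (product test function), numerical instance k = 3750] -/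
theorem InvF.step {a b Na Nb : ℕ} (ha : InvF a Na) (hb : InvF b Nb) (hchk : ssum Na * ssum Nb < 2 ^ BB) :
    InvF (a + b) (stepF Na Nb) := by
  rcases ha with ⟨wa, hNa, hwa, hsa⟩
  rcases hb with ⟨wb, hNb, hwb, hsb⟩
  have hchk' : (∑ i ∈ range MM, wa i) * (∑ j ∈ range MM, wb j) < 2 ^ BB := by
    rw [hNa, hNb, ssum_kpack hsa, ssum_kpack hsb] at hchk; exact hchk
  refine ⟨fun m => dconvNat wa wb m / 2 ^ LL, ?_, ?_, ?_⟩
  · rw [hNa, hNb, stepF, trunc_eq, maskLo_eq]; exact kpack_mul_step_floor BB_pos hchk'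
  · exact floorDiv_le_dconvPow_add pt_nonneg two_pow_LL_pos two_pow_LL_pos hwa hwb
  · have h1 := sum_floorStep_le wa wb LL MM
    have h2 : (∑ i ∈ range MM, wa i) * (∑ j ∈ range MM, wb j) / 2 ^ LL ≤ (2 ^ BB - 1) / 2 ^ LL :=
      Nat.div_le_div_right (Nat.le_sub_one_of_lt hchk')
    exact lt_of_le_of_lt (h1.trans h2) sizeStepF

/-- Checker step `InvC.step` of the `k = 3750` kernel certificate (statement and proof adapted from
`Literature.NumberTheory.Sieve.MaynardProductKernelCert4500`, parity-ideate-p3 ROUND-18 template). [cite: Polymath8b2014, Theorem 6.7 (product test function), numerical instance k = 3750] -/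
theorem InvC.step {a b Na Nb : ℕ} (ha : InvC a Na) (hb : InvC b Nb) (hchk : ssum Na * ssum Nb + 2 ^ LL ≤ 2 ^ BB) :
    InvC (a + b) (stepC Na Nb) := by
  rcases ha with ⟨wa, hNa, hwa, hsa⟩
  rcases hb with ⟨wb, hNb, hwb, hsb⟩
  have hchk' : (∑ i ∈ range MM, wa i) * (∑ j ∈ range MM, wb j) + 2 ^ LL ≤ 2 ^ BB := by
    rw [hNa, hNb, ssum_kpack hsa, ssum_kpack hsb] at hchk; exact hchk
  refine ⟨fun m => (dconvNat wa wb m + 2 ^ LL - 1) / 2 ^ LL, ?_, ?_, ?_⟩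
  · rw [hNa, hNb, stepC, trunc_eq, maskLo_eq, rndC_eq]; exact kpack_mul_step_ceil BB_pos hchk'
  · exact dconvPow_add_le_ceilDiv pt_nonneg two_pow_LL_pos two_pow_LL_pos hwa hwb
  · have h1 := sum_ceilStep_le wa wb LL MM
    have h2 : (∑ i ∈ range MM, wa i) * (∑ j ∈ range MM, wb j) / 2 ^ LL + MM ≤ (2 ^ BB - 2 ^ LL) / 2 ^ LL + MM :=
      Nat.add_le_add_right (Nat.div_le_div_right (by omega)) MM
    exact lt_of_le_of_lt (h1.trans h2) sizeStepC

/-- mask-then-shift equals shift-then-mask (bitwise, over variables). [cite: Polymath8b2014, Theorem 6.7 (product test function), numerical instance k = 3750] -/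
theorem land_shiftLeft_shiftRight (P m L : ℕ) : (P &&& (m <<< L)) >>> L = (P >>> L) &&& m := by
  apply Nat.eq_of_testBit_eq
  intro j
  simp [Nat.testBit_shiftRight, Nat.testBit_shiftLeft]
/-- below the mask, reducing the shifted number modulo `2^N` first changes nothing (bitwise, over variables: the mask has no
bit `j` with `N ≤ L + j`). [cite: Polymath8b2014, Theorem 6.7 (product test function), numerical instance k = 3750] -/
theorem shiftRight_land_mod (P m L N : ℕ) (hm : ∀ j, N ≤ L + j → m.testBit j = false) :
    (P >>> L) &&& m = ((P % 2 ^ N) >>> L) &&& m := by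
  apply Nat.eq_of_testBit_eq
  intro j
  simp only [Nat.testBit_land, Nat.testBit_shiftRight, Nat.testBit_mod_two_pow]
  by_cases hj : L + j < N
  · simp [hj]
  · rw [hm j (Nat.not_lt.1 hj)]; simp
/-- the periodic mask has no bits at positions `j` with `B·M ≤ L + j`. [cite: Polymath8b2014, Theorem 6.7 (product test function), numerical instance k = 3750] -/
theorem maskLo_testBit_high (j : ℕ) (hj : BB * MM ≤ LL + j) : maskLo.testBit j = false := by
  rw [maskLo_eq, testBit_kpack_const_mask BB_pos (Nat.sub_le BB LL)]
  have hB := BB_pos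
  have hL := LL_le_BB
  by_cases h1 : j / BB < MM
  · have h2 : ¬ (j % BB < BB - LL) := by
      intro h
      have hd := Nat.div_add_mod j BB
      have : j / BB + 1 ≤ MM := h1
      have : BB * (j / BB + 1) ≤ BB * MM := Nat.mul_le_mul_left _ this
      rw [Nat.mul_add, Nat.mul_one] at this
      omega
    simp [h1, h2]
  · simp [h1]
/-- **the mask-first step equals the template's step** (so all chain lemmas apply to `stepG`). [cite: Polymath8b2014, Theorem 6.7 (product test function), numerical instance k = 3750] -/
theorem stepG_eq (x y : ℕ) : stepG x y = stepF x y := by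
  rw [stepG, maskBig, land_shiftLeft_shiftRight, shiftRight_land_mod (x * y) maskLo LL (BB * MM) maskLo_testBit_high,
    stepF, trunc_eq]
/-- one mask-first floor step preserves the invariant. [cite: Polymath8b2014, Theorem 6.7 (product test function), numerical instance k = 3750] -/
theorem InvF.stepG {a b Na Nb : ℕ} (ha : InvF a Na) (hb : InvF b Nb) (hchk : okStep Na Nb = true) :
    InvF (a + b) (stepG Na Nb) := by
  rw [stepG_eq]
  rw [okStep, Nat.blt_eq, pow2_eq] at hchk
  exact ha.step hb hchk
/-- **the 15-step chain computes a floor lower bound of `p^{*3749}`** (straight-line: fifteen applications of `InvF.stepG`). [cite: Polymath8b2014, Theorem 6.7 (product test function), numerical instance k = 3750] -/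
theorem chainF_sound {x : ℕ} (hx : InvF 1 x) (h : (chainF x).2 = true) : InvF 3749 (chainF x).1 := by
  simp only [chainF, Bool.and_eq_true] at h ⊢
  obtain ⟨⟨⟨⟨⟨⟨⟨⟨⟨⟨⟨⟨⟨⟨h1, h2⟩, h4⟩, h8⟩, h16⟩, h32⟩, h64⟩, h128⟩, h256⟩, h512⟩, h544⟩, h545⟩, h1090⟩, h1602⟩, h3204⟩ := h
  have i2 := hx.stepG hx h1
  have i4 := i2.stepG i2 h2
  have i8 := i4.stepG i4 h4
  have i16 := i8.stepG i8 h8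
  have i32 := i16.stepG i16 h16
  have i64 := i32.stepG i32 h32
  have i128 := i64.stepG i64 h64
  have i256 := i128.stepG i128 h128
  have i512 := i256.stepG i256 h256
  have i544 := i512.stepG i32 h512
  have i545 := i544.stepG hx h544
  have i1090 := i545.stepG i545 h545
  have i1602 := i1090.stepG i512 h1090
  have i3204 := i1602.stepG i1602 h1602
  have i3749 := i3204.stepG i545 h3204
  exact i3749
/-- Checker step `runF_sound` of the `k = 3750` kernel certificate (statement and proof adapted from
`Literature.NumberTheory.Sieve.MaynardProductKernelCert4500`, parity-ideate-p3 ROUND-18 template). [cite: Polymath8b2014, Theorem 6.7 (product test function), numerical instance k = 3750] -/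
theorem runF_sound {x sx : ℕ} (hx : InvF 1 x) (hsx : ssum x = sx) :
    ∀ bs : List Bool, (runF x sx bs).2 = true → InvF (expo bs) (runF x sx bs).1
  | [], _ => by simpa [runF, expo] using hx
  | b :: bs, h => by
      have ih := runF_sound hx hsx bs
      cases b <;> simp only [runF, stepPairF, cond_true, cond_false, Bool.and_eq_true, Nat.blt_eq, pow2_eq] at h ⊢
      · obtain ⟨hok, hchk⟩ := h
        have h2 := (ih hok).step (ih hok) hchk
        simpa [expo, two_mul] using h2
      · obtain ⟨⟨hok, hchk⟩, hchk2⟩ := h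
        have h2 := (ih hok).step (ih hok) hchk
        have h3 := h2.step hx (by rw [hsx]; exact hchk2)
        simpa [expo, two_mul, add_assoc] using h3

/-- Checker step `runC_sound` of the `k = 3750` kernel certificate (statement and proof adapted from
`Literature.NumberTheory.Sieve.MaynardProductKernelCert4500`, parity-ideate-p3 ROUND-18 template). [cite: Polymath8b2014, Theorem 6.7 (product test function), numerical instance k = 3750] -/
theorem runC_sound {x sx : ℕ} (hx : InvC 1 x) (hsx : ssum x = sx) :
    ∀ bs : List Bool, (runC x sx bs).2 = true → InvC (expo bs) (runC x sx bs).1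
  | [], _ => by simpa [runC, expo] using hx
  | b :: bs, h => by
      have ih := runC_sound hx hsx bs
      cases b <;> simp only [runC, stepPairC, cond_true, cond_false, Bool.and_eq_true, Nat.ble_eq, pow2_eq] at h ⊢
      · obtain ⟨hok, hchk⟩ := h
        have h2 := (ih hok).step (ih hok) hchk
        simpa [expo, two_mul] using h2
      · obtain ⟨⟨hok, hchk⟩, hchk2⟩ := h
        have h2 := (ih hok).step (ih hok) hchk
        have h3 := h2.step hx (by rw [hsx]; exact hchk2)
        simpa [expo, two_mul, add_assoc] using h3

/-! ## Reading the certificate -/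

/-- Checker step `invF_final` of the `k = 3750` kernel certificate (statement and proof adapted from
`Literature.NumberTheory.Sieve.MaynardProductKernelCert4500`, parity-ideate-p3 ROUND-18 template). [cite: Polymath8b2014, Theorem 6.7 (product test function), numerical instance k = 3750] -/
theorem invF_final (h : resF.2 = true) : InvF (nK + 1) NF :=
  chainF_sound invF_init h
/-- Checker step `invC_final` of the `k = 3750` kernel certificate (statement and proof adapted from
`Literature.NumberTheory.Sieve.MaynardProductKernelCert4500`, parity-ideate-p3 ROUND-18 template). [cite: Polymath8b2014, Theorem 6.7 (product test function), numerical instance k = 3750] -/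
theorem invC_final (h : resC.2 = true) : InvC (nK + 2) NC := by
  rw [← expo_bitsC]; exact runC_sound invC_init rfl bitsC h

/-- denominator: `Σ_{m<MD} pt^{∗k}_m ≤ sD / 2^L`.
(adapted from `MaynardProductKernelCert4500`). [cite: Polymath8b2014, Theorem 6.7 (product test function), numerical instance k = 3750] -/
theorem den_le (h : resC.2 = true) :
    ∑ m ∈ range MD, dconvPow pt (nK + 2) m ≤ ((sD : ℕ) : ℝ) / ((2 ^ LL : ℕ) : ℝ) := by
  obtain ⟨w, hw, hle, hs⟩ := invC_final h
  have h1 : ∀ m < MD, dconvPow pt (nK + 2) m ≤ ((w m : ℕ) : ℝ) / ((2 ^ LL : ℕ) : ℝ) :=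
    fun m hm => hle m (lt_of_lt_of_le hm MD_le_MM)
  have h2 := sum_dconvPow_le_cast_div h1
  rwa [← psum_kpack hs MD_le_MM, ← hw] at h2

/-- splitting a packed vector: low part by a mask, high part by a shift.
(adapted from `MaynardProductKernelCert4500`). [cite: Polymath8b2014, Theorem 6.7 (product test function), numerical instance k = 3750] -/
theorem kpack_low_high {P : ℕ} {w : ℕ → ℕ} (hd : ∀ j < P, w j < 2 ^ BB) :
    kpack BB (P + P) w &&& onesBelow (BB * P) = kpack BB P w ∧
      kpack BB (P + P) w >>> (BB * P) = kpack BB P (fun i => w (P + i)) := by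
  have hlt : kpack BB P w < 2 ^ (BB * P) := kpack_lt hd
  have hpos : 0 < 2 ^ (BB * P) := two_pow_pos' _
  rw [land_onesBelow, shiftRight_eq_div, kpack_add]
  refine ⟨?_, ?_⟩
  · rw [Nat.add_mul_mod_self_left, Nat.mod_eq_of_lt hlt]
  · rw [Nat.add_mul_div_left _ _ hpos, Nat.div_eq_of_lt hlt, zero_add]

/-- the binary-splitting block sums are the block sums.
(adapted from `MaynardProductKernelCert4500`). [cite: Polymath8b2014, Theorem 6.7 (product test function), numerical instance k = 3750] -/
theorem nsGo_zero (o : ℕ) (w : ℕ → ℕ) (hs : ∑ t ∈ range WW, w t < 2 ^ BB - 1) :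
    nsGo (kpack BB WW w) 0 o = ellT o ^ 2 * ∑ t ∈ range WW, w t := by
  rw [nsGo, onesBelow_eq, kpack_mod_eq_sum hs]

/-- Checker step `nsGo_succ` of the `k = 3750` kernel certificate (statement and proof adapted from
`Literature.NumberTheory.Sieve.MaynardProductKernelCert4500`, parity-ideate-p3 ROUND-18 template). [cite: Polymath8b2014, Theorem 6.7 (product test function), numerical instance k = 3750] -/
theorem nsGo_succ (d o : ℕ) (w : ℕ → ℕ) (hd : ∀ j < WW * 2 ^ d, w j < 2 ^ BB) :
    nsGo (kpack BB (WW * 2 ^ d + WW * 2 ^ d) w) (d + 1) o =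
      nsGo (kpack BB (WW * 2 ^ d) w) d o + nsGo (kpack BB (WW * 2 ^ d) (fun i => w (WW * 2 ^ d + i))) d (o + 2 ^ d) := by
  obtain ⟨hlo, hhi⟩ := kpack_low_high (P := WW * 2 ^ d) (w := w) hd
  rw [nsGo, hlo, hhi]

/-- Checker step `nsGo_eq` of the `k = 3750` kernel certificate (statement and proof adapted from
`Literature.NumberTheory.Sieve.MaynardProductKernelCert4500`, parity-ideate-p3 ROUND-18 template). [cite: Polymath8b2014, Theorem 6.7 (product test function), numerical instance k = 3750] -/
theorem nsGo_eq : ∀ (d o : ℕ) (w : ℕ → ℕ), (∀ j < WW * 2 ^ d, w j < 2 ^ BB) →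
    (∀ i < 2 ^ d, ∑ t ∈ range WW, w (i * WW + t) < 2 ^ BB - 1) →
    nsGo (kpack BB (WW * 2 ^ d) w) d o = ∑ i ∈ range (2 ^ d), ellT (o + i) ^ 2 * ∑ t ∈ range WW, w (i * WW + t)
  | 0, o, w, hd, hs => by
      have h1 := hs 0 Nat.one_pos
      simp only [zero_mul, zero_add] at h1
      rw [pow_zero, Finset.sum_range_one, Nat.mul_one, nsGo_zero o w h1]
      simp only [add_zero, zero_mul, zero_add]
  | d + 1, o, w, hd, hs => by
      have hP : WW * 2 ^ (d + 1) = WW * 2 ^ d + WW * 2 ^ d := by rw [pow_succ]; ring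
      have hd1 : ∀ j < WW * 2 ^ d, w j < 2 ^ BB := fun j hj => hd j (by rw [hP]; omega)
      have hd2 : ∀ j < WW * 2 ^ d, (fun i => w (WW * 2 ^ d + i)) j < 2 ^ BB := fun j hj => hd _ (by rw [hP]; omega)
      have hidx : ∀ i t : ℕ, WW * 2 ^ d + (i * WW + t) = (2 ^ d + i) * WW + t := fun i t => by ring
      have hs1 : ∀ i < 2 ^ d, ∑ t ∈ range WW, w (i * WW + t) < 2 ^ BB - 1 :=
        fun i hi => hs i (by rw [pow_succ]; omega)
      have hs2 : ∀ i < 2 ^ d, ∑ t ∈ range WW, (fun i => w (WW * 2 ^ d + i)) (i * WW + t) < 2 ^ BB - 1 := by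
        intro i hi
        have := hs (2 ^ d + i) (by rw [pow_succ]; omega)
        simpa only [hidx] using this
      rw [hP, nsGo_succ d o w hd1, nsGo_eq d o w hd1 hs1, nsGo_eq d (o + 2 ^ d) _ hd2 hs2,
        show (2 : ℕ) ^ (d + 1) = 2 ^ d + 2 ^ d by rw [pow_succ]; ring, Finset.sum_range_add, add_right_inj]
      exact Finset.sum_congr rfl fun i _ => by simp only [hidx, add_assoc]

/-- Checker step `NUMSUM_eq` of the `k = 3750` kernel certificate (statement and proof adapted from
`Literature.NumberTheory.Sieve.MaynardProductKernelCert4500`, parity-ideate-p3 ROUND-18 template). [cite: Polymath8b2014, Theorem 6.7 (product test function), numerical instance k = 3750] -/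
theorem NUMSUM_eq {w : ℕ → ℕ} (hw : NF = kpack BB MM w) (hs : ∑ m ∈ range MM, w m < 2 ^ BB - 1) :
    NUMSUM = ∑ m ∈ range MM, ellT (m / WW) ^ 2 * w m := by
  have hd := digits_lt hs
  have hblocks : ∑ m ∈ range MM, w m = ∑ i ∈ range rr, ∑ t ∈ range WW, w (i * WW + t) := by
    have := sum_range_mul_blockConst (fun _ => (1:ℕ)) w WW rr
    simpa only [one_mul, ← MM_eq] using this
  have hs' : ∀ i < 2 ^ (eE - Wexp), ∑ t ∈ range WW, w (i * WW + t) < 2 ^ BB - 1 := fun i hi =>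
    lt_of_le_of_lt (by
      rw [hblocks]
      exact Finset.single_le_sum (f := fun i => ∑ t ∈ range WW, w (i * WW + t)) (fun _ _ => Nat.zero_le _)
        (Finset.mem_range.2 hi)) hs
  rw [NUMSUM, hw, MM_eq', nsGo_eq (eE - Wexp) 0 w (by rw [← MM_eq']; exact hd) hs',
    show WW * 2 ^ (eE - Wexp) = rr * WW from Nat.mul_comm _ _, sum_range_mul_blockConst (fun i => ellT i ^ 2) w WW rr]
  exact Finset.sum_congr rfl fun i _ => by rw [zero_add]

/-! ## The log weights -/

/-- `Aa V / Aa 0 = (c + (k−1)·(V h)) / c`.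
(adapted from `MaynardProductKernelCert4500`). [cite: Polymath8b2014, Theorem 6.7 (product test function), numerical instance k = 3750] -/
theorem Aa_ratio (V : ℕ) : ((Aa V : ℕ) : ℝ) / ((Aa 0 : ℕ) : ℝ) = (cR + ((nK : ℝ) + 1) * ((V : ℝ) * hR)) / cR := by
  unfold Aa cR hR; rw [kK_sub_one]
  have h1 : (0:ℝ) < cn := by exact_mod_cast param_pos.1
  have h2 : (0:ℝ) < cd := by exact_mod_cast param_pos.2.1
  have h5 : (0:ℝ) < N1 := N1_pos
  push_cast
  field_simp
  try ring

/-- Checker step `ellOf_sound` of the `k = 3750` kernel certificate (statement and proof adapted from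
`Literature.NumberTheory.Sieve.MaynardProductKernelCert4500`, parity-ideate-p3 ROUND-18 template). [cite: Polymath8b2014, Theorem 6.7 (product test function), numerical instance k = 3750] -/
theorem ellOf_sound (V : ℕ) :
    0 ≤ (ellOf V : ℝ) ∧ (ellOf V : ℝ) / 2 ^ 80 ≤ Real.log ((cR + ((nK : ℝ) + 1) * ((V : ℝ) * hR)) / cR) := by
  refine ⟨Nat.cast_nonneg _, ?_⟩
  have hc := cR_pos; have hh := hR_pos
  have hx : 0 ≤ ((nK : ℝ) + 1) * ((V : ℝ) * hR) :=
    mul_nonneg (by positivity) (mul_nonneg (Nat.cast_nonneg V) hh.le)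
  have hge1 : 1 ≤ (cR + ((nK : ℝ) + 1) * ((V : ℝ) * hR)) / cR := by
    rw [le_div_iff₀ hc]; linarith
  have hlog0 : 0 ≤ Real.log ((cR + ((nK : ℝ) + 1) * ((V : ℝ) * hR)) / cR) := Real.log_nonneg hge1
  have hA : (0:ℝ) < (Aa V : ℝ) := by exact_mod_cast Aa_pos V
  have hA0 : (0:ℝ) < (Aa 0 : ℝ) := by exact_mod_cast Aa_pos 0
  cases h1 : logIv (Aa V) with
  | none => simp only [ellOf, h1, Nat.cast_zero, zero_div]; exact hlog0
  | some p =>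
    cases h2 : logIv (Aa 0) with
    | none => simp only [ellOf, h1, h2, Nat.cast_zero, zero_div]; exact hlog0
    | some q =>
      simp only [ellOf, h1, h2]
      obtain ⟨lo1, hi1⟩ := p
      obtain ⟨lo0, hi0⟩ := q
      have hs1 := (logIv_sound h1).1
      have hs2 := (logIv_sound h2).2
      by_cases hle : lo1 - hi0 ≤ 0
      · rw [Int.toNat_of_nonpos hle]; simp only [Nat.cast_zero, zero_div]; exact hlog0
      · have h0 : 0 ≤ lo1 - hi0 := by omega
        have hcast : ((Int.toNat (lo1 - hi0) : ℕ) : ℝ) = ((lo1 - hi0 : ℤ) : ℝ) := by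
          rw [← Int.cast_natCast, Int.toNat_of_nonneg h0]
        rw [hcast, ← Aa_ratio, Real.log_div hA.ne' hA0.ne']
        push_cast
        linarith

/-- geometry of the blocks (shifted by `δ = dP·h`): `V_{m/W}·h ≤ min(max(1 − ((m+k−1)h − δ), 0), T)`.
(adapted from `MaynardProductKernelCert4500`). [cite: Polymath8b2014, Theorem 6.7 (product test function), numerical instance k = 3750] -/
theorem Vv_le (m : ℕ) :
    (Vv (m / WW) : ℝ) * hR ≤ min (max (1 - (((m + (nK + 1) : ℕ) : ℝ) * hR - (dP : ℝ) * hR)) 0) TR := by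
  have hh := hR_pos
  have hW : 0 < WW := param_pos.2.2.2.2.2.1
  refine le_min ?_ ?_
  · rcases Nat.eq_zero_or_pos (Vv (m / WW)) with h0 | hpos
    · rw [h0, Nat.cast_zero, zero_mul]; exact le_max_right _ _
    · have hV : Vv (m / WW) ≤ N1 + dP - ((m / WW + 1) * WW + kK - 2) := min_le_left _ _
      have hm : m < (m / WW + 1) * WW := by
        rw [Nat.mul_comm]; exact Nat.lt_mul_div_succ m hW
      have hsum : Vv (m / WW) + (m + (nK + 1)) ≤ N1 + dP := by unfold kK at hV; omega
      have h1 : ((Vv (m / WW) : ℕ) : ℝ) + ((m + (nK + 1) : ℕ) : ℝ) ≤ (N1 : ℝ) + (dP : ℝ) := by exact_mod_cast hsum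
      refine le_trans ?_ (le_max_left _ _)
      have key : (((Vv (m / WW) : ℕ) : ℝ) + ((m + (nK + 1) : ℕ) : ℝ) - (dP : ℝ)) * hR ≤ 1 := by
        unfold hR; rw [mul_one_div, div_le_one N1_pos]; linarith
      have e : (((Vv (m / WW) : ℕ) : ℝ) + ((m + (nK + 1) : ℕ) : ℝ) - (dP : ℝ)) * hR =
          ((Vv (m / WW) : ℕ) : ℝ) * hR + ((m + (nK + 1) : ℕ) : ℝ) * hR - (dP : ℝ) * hR := by ring
      linarith
  · rw [TR_eq]
    exact mul_le_mul_of_nonneg_right (by exact_mod_cast (min_le_right _ _ : Vv (m / WW) ≤ Jc)) hh.le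

/-- table read-off.
(adapted from `MaynardProductKernelCert4500`). [cite: Polymath8b2014, Theorem 6.7 (product test function), numerical instance k = 3750] -/
theorem tabFn_lt (g : ℕ) : tabFn g < 2 ^ BT := by
  unfold tabFn; rw [onesBelow_eq]
  exact lt_of_le_of_lt (min_le_right _ _) (Nat.sub_lt (Nat.two_pow_pos _) Nat.one_pos)
/-- Checker step `tabDigit_eq` of the `k = 3750` kernel certificate (statement and proof adapted from
`Literature.NumberTheory.Sieve.MaynardProductKernelCert4500`, parity-ideate-p3 ROUND-18 template). [cite: Polymath8b2014, Theorem 6.7 (product test function), numerical instance k = 3750] -/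
theorem tabDigit_eq (g : ℕ) : tabDigit g = tabFn g := by
  have h : tabDigit g = kdigit BT (TABS (g / 64)) (g % 64) := by
    rw [tabDigit, kdigit, land_onesBelow, shiftRight_eq_div]
  have hg : g % 64 < 2 ^ 6 := Nat.mod_lt g (by decide)
  rw [h, TABS, kpackDC_eq, kdigit_kpack (fun j _ => tabFn_lt (64 * (g / 64) + j)), if_pos hg]
  exact congrArg tabFn (Nat.div_add_mod g 64)
/-- table read-off: the stored digit is below the exact scaled log lower bound at the grid point. [cite: Polymath8b2014, Theorem 6.7 (product test function), numerical instance k = 3750] -/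
theorem tabDigit_le_ellOf (g : ℕ) : tabDigit g ≤ ellOf (g * GG) := by
  rw [tabDigit_eq, tabFn]; exact min_le_left _ _
/-- `V ↦ log((c + (k−1)·V h)/c)` is monotone. [cite: Polymath8b2014, Theorem 6.7 (product test function), numerical instance k = 3750] -/
theorem logA_mono {V V' : ℝ} (h0 : 0 ≤ V) (h : V ≤ V') :
    Real.log ((cR + ((nK : ℝ) + 1) * (V * hR)) / cR) ≤ Real.log ((cR + ((nK : ℝ) + 1) * (V' * hR)) / cR) := by
  have hc := cR_pos; have hh := hR_pos
  have hn : (0 : ℝ) < (nK : ℝ) + 1 := Nat.cast_add_one_pos nK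
  have hx : 0 ≤ ((nK : ℝ) + 1) * (V * hR) := mul_nonneg hn.le (mul_nonneg h0 hh.le)
  have h1 : ((nK : ℝ) + 1) * (V * hR) ≤ ((nK : ℝ) + 1) * (V' * hR) :=
    mul_le_mul_of_nonneg_left (mul_le_mul_of_nonneg_right h hh.le) hn.le
  apply Real.log_le_log (div_pos (by linarith) hc)
  exact div_le_div_of_nonneg_right (by linarith) hc.le
/-- `V ↦ log((c + (k−1)·V h)/c)` is concave (two-point Jensen, from `strictConcaveOn_log_Ioi`). [cite: Polymath8b2014, Theorem 6.7 (product test function), numerical instance k = 3750] -/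
theorem logA_concave {V V' t : ℝ} (h0 : 0 ≤ V) (h0' : 0 ≤ V') (ht0 : 0 ≤ t) (ht1 : t ≤ 1) :
    (1 - t) * Real.log ((cR + ((nK : ℝ) + 1) * (V * hR)) / cR) + t * Real.log ((cR + ((nK : ℝ) + 1) * (V' * hR)) / cR) ≤
      Real.log ((cR + ((nK : ℝ) + 1) * (((1 - t) * V + t * V') * hR)) / cR) := by
  have hc := cR_pos; have hh := hR_pos
  have hn : (0 : ℝ) < (nK : ℝ) + 1 := Nat.cast_add_one_pos nK
  have hxV : 0 ≤ ((nK : ℝ) + 1) * (V * hR) := mul_nonneg hn.le (mul_nonneg h0 hh.le)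
  have hxV' : 0 ≤ ((nK : ℝ) + 1) * (V' * hR) := mul_nonneg hn.le (mul_nonneg h0' hh.le)
  have hx : (0 : ℝ) < (cR + ((nK : ℝ) + 1) * (V * hR)) / cR := div_pos (by linarith) hc
  have hy : (0 : ℝ) < (cR + ((nK : ℝ) + 1) * (V' * hR)) / cR := div_pos (by linarith) hc
  have key := (strictConcaveOn_log_Ioi).concaveOn.2 hx hy (sub_nonneg.2 ht1) ht0 (by ring)
  simp only [smul_eq_mul] at key
  have e : (1 - t) * ((cR + ((nK : ℝ) + 1) * (V * hR)) / cR) + t * ((cR + ((nK : ℝ) + 1) * (V' * hR)) / cR) =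
      (cR + ((nK : ℝ) + 1) * (((1 - t) * V + t * V') * hR)) / cR := by
    rw [mul_div_assoc', mul_div_assoc', ← add_div]
    congr 1; ring
  rw [e] at key; exact key
/-- interpolation arithmetic over variables (keeps tactics away from the program): from `a ≤ A ≤ S·f₀`, `b ≤ B ≤ S·f₁` and the
two-point concavity `(1−t) f₀ + t f₁ ≤ f` we get `(a + (b − a) t)/S ≤ f`. [cite: Polymath8b2014, Theorem 6.7 (product test function), numerical instance k = 3750] -/
theorem interp_le (a b A B f0 f1 f t S : ℝ) (hS : 0 < S) (ht0 : 0 ≤ t) (ht1 : t ≤ 1)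
    (ha : a ≤ A) (hb : b ≤ B) (hA : A / S ≤ f0) (hB : B / S ≤ f1) (hconc : (1 - t) * f0 + t * f1 ≤ f) :
    (a + (b - a) * t) / S ≤ f := by
  rw [div_le_iff₀ hS] at hA hB ⊢
  have h1 : (1 - t) * a ≤ (1 - t) * A := mul_le_mul_of_nonneg_left ha (sub_nonneg.2 ht1)
  have h2 : t * b ≤ t * B := mul_le_mul_of_nonneg_left hb ht0
  have h3 : (1 - t) * A ≤ (1 - t) * (f0 * S) := mul_le_mul_of_nonneg_left hA (sub_nonneg.2 ht1)
  have h4 : t * B ≤ t * (f1 * S) := mul_le_mul_of_nonneg_left hB ht0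
  have h5 : ((1 - t) * f0 + t * f1) * S ≤ f * S := mul_le_mul_of_nonneg_right hconc hS.le
  nlinarith
/-- **the interpolated weight is sound**: `ellT i / 2^80 ≤ log((c + (k−1) V_i h)/c)` (grid point below by monotonicity when the
table step is not increasing, else the chord below the concave function). [cite: Polymath8b2014, Theorem 6.7 (product test function), numerical instance k = 3750] -/
theorem ellT_sound (i : ℕ) :
    0 ≤ (ellT i : ℝ) ∧ (ellT i : ℝ) / 2 ^ 80 ≤ Real.log ((cR + ((nK : ℝ) + 1) * ((Vv i : ℝ) * hR)) / cR) := by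
  refine ⟨Nat.cast_nonneg _, ?_⟩
  have hGG : 0 < GG := by decide
  have ha := tabDigit_le_ellOf (Vv i / GG)
  have hb := tabDigit_le_ellOf (Vv i / GG + 1)
  obtain ⟨_, hA⟩ := ellOf_sound (Vv i / GG * GG)
  obtain ⟨_, hB⟩ := ellOf_sound ((Vv i / GG + 1) * GG)
  have hdm : Vv i / GG * GG + Vv i % GG = Vv i := Nat.div_add_mod' (Vv i) GG
  have hr : Vv i % GG < GG := Nat.mod_lt _ hGG
  have hV0 : (0 : ℝ) ≤ ((Vv i / GG * GG : ℕ) : ℝ) := Nat.cast_nonneg _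
  have hV1 : (0 : ℝ) ≤ (((Vv i / GG + 1) * GG : ℕ) : ℝ) := Nat.cast_nonneg _
  by_cases hab : tabDigit (Vv i / GG + 1) ≤ tabDigit (Vv i / GG)
  · -- the table step is not increasing: use the grid point below (monotonicity)
    have h0 : tabDigit (Vv i / GG + 1) - tabDigit (Vv i / GG) = 0 := Nat.sub_eq_zero_of_le hab
    have hE : ellT i = tabDigit (Vv i / GG) := by
      rw [ellT, h0, Nat.zero_mul, Nat.zero_div, Nat.add_zero]
    have hle : (ellT i : ℝ) ≤ (ellOf (Vv i / GG * GG) : ℝ) := by rw [hE]; exact_mod_cast ha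
    have hVle : ((Vv i / GG * GG : ℕ) : ℝ) ≤ (Vv i : ℝ) := by exact_mod_cast Nat.div_mul_le_self _ _
    have h280 : (0 : ℝ) < 2 ^ 80 := pow_pos two_pos 80
    calc (ellT i : ℝ) / 2 ^ 80 ≤ (ellOf (Vv i / GG * GG) : ℝ) / 2 ^ 80 := div_le_div_of_nonneg_right hle h280.le
      _ ≤ _ := hA
      _ ≤ _ := logA_mono hV0 hVle
  · -- increasing step: chord below the concave log
    rw [not_le] at hab
    have hcast : ((tabDigit (Vv i / GG + 1) - tabDigit (Vv i / GG) : ℕ) : ℝ) =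
        (tabDigit (Vv i / GG + 1) : ℝ) - (tabDigit (Vv i / GG) : ℝ) := Nat.cast_sub hab.le
    have hGr : (0 : ℝ) < (GG : ℝ) := by exact_mod_cast hGG
    set t : ℝ := ((Vv i % GG : ℕ) : ℝ) / (GG : ℝ) with ht
    have ht0 : 0 ≤ t := div_nonneg (Nat.cast_nonneg _) hGr.le
    have ht1 : t ≤ 1 := by
      rw [ht, div_le_one hGr]; exact_mod_cast hr.le
    have hdiv : (((tabDigit (Vv i / GG + 1) - tabDigit (Vv i / GG)) * (Vv i % GG) / GG : ℕ) : ℝ) ≤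
        ((tabDigit (Vv i / GG + 1) : ℝ) - (tabDigit (Vv i / GG) : ℝ)) * t := by
      refine le_trans Nat.cast_div_le ?_
      rw [Nat.cast_mul, hcast, ht, mul_div_assoc]
    have hE : (ellT i : ℝ) ≤ (tabDigit (Vv i / GG) : ℝ) +
        ((tabDigit (Vv i / GG + 1) : ℝ) - (tabDigit (Vv i / GG) : ℝ)) * t := by
      rw [ellT, Nat.cast_add]
      linarith [hdiv]
    have hconc := logA_concave hV0 hV1 ht0 ht1
    have harg : (1 - t) * ((Vv i / GG * GG : ℕ) : ℝ) + t * (((Vv i / GG + 1) * GG : ℕ) : ℝ) = (Vv i : ℝ) := by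
      have e1 : (((Vv i / GG + 1) * GG : ℕ) : ℝ) = ((Vv i / GG * GG : ℕ) : ℝ) + (GG : ℝ) := by push_cast; ring
      have e2 : (Vv i : ℝ) = ((Vv i / GG * GG : ℕ) : ℝ) + ((Vv i % GG : ℕ) : ℝ) := by exact_mod_cast hdm.symm
      rw [e1, e2, ht]
      field_simp
      ring
    rw [harg] at hconc
    exact le_trans (div_le_div_of_nonneg_right hE (pow_pos two_pos 80).le)
      (interp_le _ _ _ _ _ _ _ t _ (pow_pos two_pos 80) ht0 ht1 (by exact_mod_cast ha) (by exact_mod_cast hb) hA hB hconc)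

/-- the weight lower bound on block `m / W` (statement as in the template; proof through `ellT_sound`). [cite: Polymath8b2014, Theorem 6.7 (product test function), numerical instance k = 3750] -/
theorem weight_ge (m : ℕ) :
    ((ellT (m / WW) : ℝ) / 2 ^ 80 / ((nK : ℝ) + 1)) ^ 2 ≤
      (1 / ((nK : ℝ) + 1) *
        Real.log ((cR + ((nK : ℝ) + 1) * min (max (1 - (((m + (nK + 1) : ℕ) : ℝ) * hR - (dP : ℝ) * hR)) 0) TR) / cR)) ^ 2 := by
  have hc := cR_pos; have hh := hR_pos
  have hn : (0 : ℝ) < (nK : ℝ) + 1 := Nat.cast_add_one_pos nK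
  have hVle := Vv_le m
  obtain ⟨h0, h1⟩ := ellT_sound (m / WW)
  have hx : 0 ≤ ((nK : ℝ) + 1) * ((Vv (m / WW) : ℝ) * hR) :=
    mul_nonneg hn.le (mul_nonneg (Nat.cast_nonneg _) hh.le)
  have harg : 0 < (cR + ((nK : ℝ) + 1) * ((Vv (m / WW) : ℝ) * hR)) / cR := div_pos (by linarith) hc
  have hmono : Real.log ((cR + ((nK : ℝ) + 1) * ((Vv (m / WW) : ℝ) * hR)) / cR) ≤
      Real.log ((cR + ((nK : ℝ) + 1) * min (max (1 - (((m + (nK + 1) : ℕ) : ℝ) * hR - (dP : ℝ) * hR)) 0) TR) / cR) := by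
    apply Real.log_le_log harg
    apply div_le_div_of_nonneg_right _ hc.le
    linarith [mul_le_mul_of_nonneg_left hVle hn.le]
  have h2 : (ellT (m / WW) : ℝ) / 2 ^ 80 / ((nK : ℝ) + 1) ≤
      1 / ((nK : ℝ) + 1) * Real.log ((cR + ((nK : ℝ) + 1) * min (max (1 - (((m + (nK + 1) : ℕ) : ℝ) * hR - (dP : ℝ) * hR)) 0) TR) / cR) := by
    rw [div_eq_mul_one_div _ ((nK:ℝ)+1), mul_comm]
    exact mul_le_mul_of_nonneg_left (h1.trans hmono) (one_div_pos.2 hn).le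
  have h3 : 0 ≤ (ellT (m / WW) : ℝ) / 2 ^ 80 / ((nK : ℝ) + 1) :=
    div_nonneg (div_nonneg h0 (pow_pos two_pos 80).le) hn.le
  exact pow_le_pow_left₀ h3 h2 2

/-! ## Assembly -/
/-- Checker step `dconvPow_pp` of the `k = 3750` kernel certificate (statement and proof adapted from
`Literature.NumberTheory.Sieve.MaynardProductKernelCert4500`, parity-ideate-p3 ROUND-18 template). [cite: Polymath8b2014, Theorem 6.7 (product test function), numerical instance k = 3750] -/
theorem dconvPow_pp (n m : ℕ) : dconvPow pp n m = m2R ^ n * dconvPow pt n m := by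
  rw [show pp = fun j => m2R * pt j from funext pp_eq]; exact dconvPow_const_mul m2R pt n m

/-- Checker step `Jc_pos` of the `k = 3750` kernel certificate (statement and proof adapted from
`Literature.NumberTheory.Sieve.MaynardProductKernelCert4500`, parity-ideate-p3 ROUND-18 template). [cite: Polymath8b2014, Theorem 6.7 (product test function), numerical instance k = 3750] -/
theorem Jc_pos : 0 < Jc := by decide
/-- Checker step `pt_zero_pos` of the `k = 3750` kernel certificate (statement and proof adapted from
`Literature.NumberTheory.Sieve.MaynardProductKernelCert4500`, parity-ideate-p3 ROUND-18 template). [cite: Polymath8b2014, Theorem 6.7 (product test function), numerical instance k = 3750] -/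
theorem pt_zero_pos : 0 < pt 0 := by
  rw [pt_eq Jc_pos]
  have hN : 0 < NUM := by
    unfold NUM
    exact Nat.mul_pos (Nat.mul_pos param_pos.2.2.2.2.1 param_pos.1)
      (Nat.lt_of_lt_of_le (Nat.mul_pos param_pos.1 param_pos.2.2.2.1) (Nat.le_add_right _ _))
  exact div_pos (by exact_mod_cast hN) (by exact_mod_cast DEN_pos 0)

/-- Checker step `m2R_mul` of the `k = 3750` kernel certificate (statement and proof adapted from
`Literature.NumberTheory.Sieve.MaynardProductKernelCert4500`, parity-ideate-p3 ROUND-18 template). [cite: Polymath8b2014, Theorem 6.7 (product test function), numerical instance k = 3750] -/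
theorem m2R_mul : m2R * ((cn : ℝ) * ((cn : ℝ) * Td + (cd : ℝ) * ((nK : ℝ) + 1) * Tn)) = (Tn : ℝ) * (cd : ℝ) ^ 2 := by
  unfold m2R cR TR
  have h1 : (0:ℝ) < cn := by exact_mod_cast param_pos.1
  have h2 : (0:ℝ) < cd := by exact_mod_cast param_pos.2.1
  have h3 : (0:ℝ) < Tn := by exact_mod_cast param_pos.2.2.1
  have h4 : (0:ℝ) < Td := by exact_mod_cast param_pos.2.2.2.1
  have h5 : (0:ℝ) < (cn:ℝ) * Td + (cd:ℝ) * ((nK:ℝ) + 1) * Tn := by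
    have : (0:ℝ) ≤ (cd:ℝ) * ((nK:ℝ) + 1) * Tn := by positivity
    nlinarith
  field_simp
  try ring

/-! ## ROUND-18: the Hoeffding pieces -/

/-! ### `SIG` = Σ j·leaf_j and the enclosure of `Σ_j j·pt_j` -/
/-- Checker step `sigGo_eq` of the `k = 3750` kernel certificate (statement and proof adapted from
`Literature.NumberTheory.Sieve.MaynardProductKernelCert4500`, parity-ideate-p3 ROUND-18 template). [cite: Polymath8b2014, Theorem 6.7 (product test function), numerical instance k = 3750] -/
theorem sigGo_eq : ∀ (d o : ℕ), sigGo d o = ∑ i ∈ range (2 ^ d), (o + i) * leaf (o + i)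
  | 0, o => by rw [sigGo, pow_zero, Finset.sum_range_one, add_zero]
  | d + 1, o => by
      rw [sigGo, sigGo_eq d o, sigGo_eq d (o + 2 ^ d), show (2 : ℕ) ^ (d + 1) = 2 ^ d + 2 ^ d by rw [pow_succ]; ring,
        Finset.sum_range_add]
      simp only [add_assoc]

/-- Checker step `SIG_eq` of the `k = 3750` kernel certificate (statement and proof adapted from
`Literature.NumberTheory.Sieve.MaynardProductKernelCert4500`, parity-ideate-p3 ROUND-18 template). [cite: Polymath8b2014, Theorem 6.7 (product test function), numerical instance k = 3750] -/
theorem SIG_eq : SIG = ∑ j ∈ range MM, j * leaf j := by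
  rw [SIG, sigGo_eq, MM]; simp only [zero_add]

/-- sums of functions vanishing from `Jc` on do not see the range beyond `Jc`.
(adapted from `MaynardProductKernelCert4500`). [cite: Polymath8b2014, Theorem 6.7 (product test function), numerical instance k = 3750] -/
theorem sum_range_of_vanish {β : Type*} [AddCommMonoid β] (f : ℕ → β) (hf : ∀ j, Jc ≤ j → f j = 0) {A : ℕ}
    (hA : Jc ≤ A) : ∑ j ∈ range A, f j = ∑ j ∈ range Jc, f j := by
  symm
  apply Finset.sum_subset (fun x hx => Finset.mem_range.2 (lt_of_lt_of_le (Finset.mem_range.1 hx) hA))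
  intro j _ hj
  exact hf j (not_lt.1 fun h' => hj (Finset.mem_range.2 h'))

/-- Checker step `sum_j_ind` of the `k = 3750` kernel certificate (statement and proof adapted from
`Literature.NumberTheory.Sieve.MaynardProductKernelCert4500`, parity-ideate-p3 ROUND-18 template). [cite: Polymath8b2014, Theorem 6.7 (product test function), numerical instance k = 3750] -/
theorem sum_j_ind : ∑ j ∈ range MM, j * ind j = TRI := by
  rw [TRI, sum_range_of_vanish (fun j => j * ind j) (fun j hj => by simp [ind, not_lt.2 hj]) Jc_lt_MM.le,
    ← Finset.sum_range_id]
  exact Finset.sum_congr rfl fun j hj => by rw [Finset.mem_range] at hj; simp [ind, hj]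

/-! KERNEL RULE K6 (ROUND-18): a generic algebraic lemma (`Finset.sum_add_distrib`, …) instantiated at `ℕ` carries instance terms
that differ syntactically from `ℕ`'s core ones; when the kernel compares the two `HAdd.hAdd` nodes it unfolds both to `Nat.add x y`
and `reduce_nat` then WHNF-EVALUATES the closed arguments — fatal for `SIG`/sums over `range M`.  So all bookkeeping with heavy
closed naturals is done in `ℝ` on cast atoms, with `ℕ`-specific cast lemmas only. -/
/-- Checker step `SIG_cast` of the `k = 3750` kernel certificate (statement and proof adapted from
`Literature.NumberTheory.Sieve.MaynardProductKernelCert4500`, parity-ideate-p3 ROUND-18 template). [cite: Polymath8b2014, Theorem 6.7 (product test function), numerical instance k = 3750] -/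
theorem SIG_cast : (SIG : ℝ) = ∑ j ∈ range MM, (j : ℝ) * (leaf j : ℝ) := by
  rw [SIG_eq, Nat.cast_sum]; exact Finset.sum_congr rfl fun j _ => by rw [Nat.cast_mul]

/-- Checker step `TRI_cast` of the `k = 3750` kernel certificate (statement and proof adapted from
`Literature.NumberTheory.Sieve.MaynardProductKernelCert4500`, parity-ideate-p3 ROUND-18 template). [cite: Polymath8b2014, Theorem 6.7 (product test function), numerical instance k = 3750] -/
theorem TRI_cast : (TRI : ℝ) = ∑ j ∈ range MM, (j : ℝ) * (ind j : ℝ) := by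
  rw [← sum_j_ind, Nat.cast_sum]; exact Finset.sum_congr rfl fun j _ => by rw [Nat.cast_mul]

/-- the real quantity enclosed: `PT1 = Σ_{j<M} j·pt_j`. [folklore] -/
def PT1 : ℝ := ∑ j ∈ range MM, (j : ℝ) * pt j

/-- Checker step `cast_two_pow_LL` of the `k = 3750` kernel certificate (statement and proof adapted from
`Literature.NumberTheory.Sieve.MaynardProductKernelCert4500`, parity-ideate-p3 ROUND-18 template). [cite: Polymath8b2014, Theorem 6.7 (product test function), numerical instance k = 3750] -/
theorem cast_two_pow_LL : ((2 ^ LL : ℕ) : ℝ) = (2 : ℝ) ^ LL := by push_cast; ring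

/-- Checker step `SIG_le` of the `k = 3750` kernel certificate (statement and proof adapted from
`Literature.NumberTheory.Sieve.MaynardProductKernelCert4500`, parity-ideate-p3 ROUND-18 template). [cite: Polymath8b2014, Theorem 6.7 (product test function), numerical instance k = 3750] -/
theorem SIG_le : (SIG : ℝ) ≤ (2 : ℝ) ^ LL * PT1 := by
  rw [SIG_eq, Nat.cast_sum, PT1, Finset.mul_sum]
  refine Finset.sum_le_sum fun j _ => ?_
  have h1 := leaf_div_le j
  rw [cast_two_pow_LL, div_le_iff₀ (pow_pos two_pos _)] at h1
  rw [Nat.cast_mul]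
  have hj : (0 : ℝ) ≤ (j : ℝ) := Nat.cast_nonneg j
  nlinarith

/-- Checker step `PT1_le` of the `k = 3750` kernel certificate (statement and proof adapted from
`Literature.NumberTheory.Sieve.MaynardProductKernelCert4500`, parity-ideate-p3 ROUND-18 template). [cite: Polymath8b2014, Theorem 6.7 (product test function), numerical instance k = 3750] -/
theorem PT1_le : (2 : ℝ) ^ LL * PT1 ≤ (SIG : ℝ) + (TRI : ℝ) := by
  rw [SIG_cast, TRI_cast, ← Finset.sum_add_distrib, PT1, Finset.mul_sum]
  refine Finset.sum_le_sum fun j _ => ?_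
  have h1 := le_uu_div j
  rw [cast_two_pow_LL, le_div_iff₀ (pow_pos two_pos _), uu, Nat.cast_add] at h1
  have hj : (0 : ℝ) ≤ (j : ℝ) := Nat.cast_nonneg j
  nlinarith

/-! ### the two-sided log enclosure -/
/-- Checker plumbing `LOGr`: an exact-integer constant / function of the `k = 3750` kernel certificate
(see the module docstring; adapted from `MaynardProductKernelCert4500`). [folklore] -/
def LOGr : ℝ := Real.log ((cR + ((nK : ℝ) + 1) * TR) / cR)

/-- Checker step `LOGr_eq_log_div` of the `k = 3750` kernel certificate (statement and proof adapted from
`Literature.NumberTheory.Sieve.MaynardProductKernelCert4500`, parity-ideate-p3 ROUND-18 template). [cite: Polymath8b2014, Theorem 6.7 (product test function), numerical instance k = 3750] -/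
theorem LOGr_eq_log_div : LOGr = Real.log ((Aa Jc : ℕ) : ℝ) - Real.log ((Aa 0 : ℕ) : ℝ) := by
  have hA : (0:ℝ) < (Aa Jc : ℝ) := by exact_mod_cast Aa_pos Jc
  have hA0 : (0:ℝ) < (Aa 0 : ℝ) := by exact_mod_cast Aa_pos 0
  rw [LOGr, ← Real.log_div hA.ne' hA0.ne', Aa_ratio, ← TR_eq]

/-- Checker step `LOGr_nonneg` of the `k = 3750` kernel certificate (statement and proof adapted from
`Literature.NumberTheory.Sieve.MaynardProductKernelCert4500`, parity-ideate-p3 ROUND-18 template). [cite: Polymath8b2014, Theorem 6.7 (product test function), numerical instance k = 3750] -/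
theorem LOGr_nonneg : 0 ≤ LOGr := by
  have hc := cR_pos; have hT := TR_pos
  have hx : 0 ≤ ((nK : ℝ) + 1) * TR := by positivity
  apply Real.log_nonneg
  rw [le_div_iff₀ hc]; linarith

/-- Checker step `log_enclosure` of the `k = 3750` kernel certificate (statement and proof adapted from
`Literature.NumberTheory.Sieve.MaynardProductKernelCert4500`, parity-ideate-p3 ROUND-18 template). [cite: Polymath8b2014, Theorem 6.7 (product test function), numerical instance k = 3750] -/
theorem log_enclosure (h : logOk = true) :
    (LOGLO : ℝ) ≤ 2 ^ 80 * LOGr ∧ 2 ^ 80 * LOGr ≤ (LOGHI : ℝ) := by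
  have hL := LOGr_nonneg
  cases h1 : logIv (Aa Jc) with
  | none => simp [logOk, h1] at h
  | some p =>
    cases h2 : logIv (Aa 0) with
    | none => simp [logOk, h2] at h
    | some q =>
      obtain ⟨lo1, hi1⟩ := p
      obtain ⟨lo0, hi0⟩ := q
      have hs1 := logIv_sound h1
      have hs2 := logIv_sound h2
      have e := LOGr_eq_log_div
      simp only [LOGLO, LOGHI, h1, h2]
      refine ⟨?_, ?_⟩
      · by_cases hle : lo1 - hi0 ≤ 0
        · rw [Int.toNat_of_nonpos hle]; simp only [Nat.cast_zero]; linarith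
        · have h0 : 0 ≤ lo1 - hi0 := by omega
          have hcast : ((Int.toNat (lo1 - hi0) : ℕ) : ℝ) = ((lo1 - hi0 : ℤ) : ℝ) := by
            rw [← Int.cast_natCast, Int.toNat_of_nonneg h0]
          rw [hcast]; push_cast; linarith [hs1.1, hs2.2]
      · have hge : (2:ℝ) ^ 80 * LOGr ≤ ((hi1 - lo0 : ℤ) : ℝ) := by push_cast; linarith [hs1.2, hs2.1]
        have h0r : (0:ℝ) ≤ ((hi1 - lo0 : ℤ) : ℝ) := le_trans (by positivity) hge
        have h0 : 0 ≤ hi1 - lo0 := by exact_mod_cast h0r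
        have hcast : ((Int.toNat (hi1 - lo0) : ℕ) : ℝ) = ((hi1 - lo0 : ℤ) : ℝ) := by
          rw [← Int.cast_natCast, Int.toNat_of_nonneg h0]
        rw [hcast]; exact hge

/-! ### the Hoeffding tails in integers -/
/-- Checker step `exp_arg` of the `k = 3750` kernel certificate (statement and proof adapted from
`Literature.NumberTheory.Sieve.MaynardProductKernelCert4500`, parity-ideate-p3 ROUND-18 template). [cite: Polymath8b2014, Theorem 6.7 (product test function), numerical instance k = 3750] -/
theorem exp_arg (K : ℝ) (hK : 0 < K) :
    -2 * ((Lam : ℝ) * hR) ^ 2 / (K * hR ^ 2) = -(2 * (Lam : ℝ) ^ 2 / K) := by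
  have hh := hR_pos
  field_simp

/-- Checker step `pow_ratio` of the `k = 3750` kernel certificate (statement and proof adapted from
`Literature.NumberTheory.Sieve.MaynardProductKernelCert4500`, parity-ideate-p3 ROUND-18 template). [cite: Polymath8b2014, Theorem 6.7 (product test function), numerical instance k = 3750] -/
theorem pow_ratio (K : ℝ) (hK : 0 < K) :
    ((nE : ℝ) / ((nE : ℝ) + 2 * (Lam : ℝ) ^ 2 / K)) ^ nE =
      (((nE : ℝ) * K) ^ nE) / (((nE : ℝ) * K + 2 * (Lam : ℝ) ^ 2) ^ nE) := by
  rw [← div_pow]; congr 1; field_simp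

/-- `2^L · e^{−2λ₁²/(k h²)} ≤ T1`.
(adapted from `MaynardProductKernelCert4500`). [cite: Polymath8b2014, Theorem 6.7 (product test function), numerical instance k = 3750] -/
theorem T1_ge : (2 : ℝ) ^ LL * Real.exp (-2 * ((Lam : ℝ) * hR) ^ 2 / (((nK : ℝ) + 2) * hR ^ 2)) ≤ (T1 : ℝ) := by
  have hK : (0 : ℝ) < (nK : ℝ) + 2 := by positivity
  rw [exp_arg _ hK]
  have ht : 0 ≤ 2 * (Lam : ℝ) ^ 2 / ((nK : ℝ) + 2) := by positivity
  have h1 := exp_neg_le_pow _ ht nE nE_pos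
  rw [pow_ratio _ hK] at h1
  have hb : 0 < b1 := b1_pos
  have h2 : 2 ^ LL * a1 ≤ T1 * b1 := le_ceilDiv_mul _ _ hb
  have h3 : ((2 ^ LL * a1 : ℕ) : ℝ) ≤ ((T1 * b1 : ℕ) : ℝ) := by exact_mod_cast h2
  have hA : ((a1 : ℕ) : ℝ) = ((nE : ℝ) * ((nK : ℝ) + 2)) ^ nE := by unfold a1; push_cast; ring
  have hB : ((b1 : ℕ) : ℝ) = ((nE : ℝ) * ((nK : ℝ) + 2) + 2 * (Lam : ℝ) ^ 2) ^ nE := by unfold b1; push_cast; ring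
  have hnE : (0 : ℝ) < (nE : ℝ) := by exact_mod_cast nE_pos
  have hBpos : (0 : ℝ) < ((nE : ℝ) * ((nK : ℝ) + 2) + 2 * (Lam : ℝ) ^ 2) ^ nE := by positivity
  refine tail_arith ((2:ℝ) ^ LL) _ _ _ hBpos h1 ?_ (by positivity)
  rw [← hA, ← hB]; push_cast at h3 ⊢; linarith

/-- `2^L · (2^80 LOG)² · e^{−2λ₂²/((k−1) h²)} ≤ t2` for any `lh ≥ 2^80 LOG` and `t2` with the ceiling property
(variables: the closed constants `LOGHI`, `T2` must never be touched by cast normalisation — it would evaluate `logIv`).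
(adapted from `MaynardProductKernelCert4500`). [cite: Polymath8b2014, Theorem 6.7 (product test function), numerical instance k = 3750] -/
theorem T2_ge_aux (lh t2 : ℕ) (h2 : 2 ^ LL * lh ^ 2 * a2 ≤ t2 * b2) (hhi : 2 ^ 80 * LOGr ≤ (lh : ℝ)) :
    (2 : ℝ) ^ LL * (2 ^ 80 * LOGr) ^ 2 * Real.exp (-2 * ((Lam : ℝ) * hR) ^ 2 / (((nK : ℝ) + 1) * hR ^ 2)) ≤ (t2 : ℝ) := by
  have hK : (0 : ℝ) < (nK : ℝ) + 1 := by positivity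
  rw [exp_arg _ hK]
  have ht : 0 ≤ 2 * (Lam : ℝ) ^ 2 / ((nK : ℝ) + 1) := by positivity
  have h1 := exp_neg_le_pow _ ht nE nE_pos
  rw [pow_ratio _ hK] at h1
  have h3 : ((2 ^ LL * lh ^ 2 * a2 : ℕ) : ℝ) ≤ ((t2 * b2 : ℕ) : ℝ) := by exact_mod_cast h2
  have hA : ((a2 : ℕ) : ℝ) = ((nE : ℝ) * ((nK : ℝ) + 1)) ^ nE := by unfold a2; push_cast; ring
  have hB : ((b2 : ℕ) : ℝ) = ((nE : ℝ) * ((nK : ℝ) + 1) + 2 * (Lam : ℝ) ^ 2) ^ nE := by unfold b2; push_cast; ring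
  have hnE : (0 : ℝ) < (nE : ℝ) := by exact_mod_cast nE_pos
  have hBpos : (0 : ℝ) < ((nE : ℝ) * ((nK : ℝ) + 1) + 2 * (Lam : ℝ) ^ 2) ^ nE := by positivity
  have hL := LOGr_nonneg
  have hsq : (2 ^ 80 * LOGr) ^ 2 ≤ (lh : ℝ) ^ 2 := pow_le_pow_left₀ (by positivity) hhi 2
  have h4 : (2 : ℝ) ^ LL * (2 ^ 80 * LOGr) ^ 2 * Real.exp (-(2 * (Lam : ℝ) ^ 2 / ((nK : ℝ) + 1))) ≤
      (2 : ℝ) ^ LL * (lh : ℝ) ^ 2 * Real.exp (-(2 * (Lam : ℝ) ^ 2 / ((nK : ℝ) + 1))) :=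
    mul_le_mul_of_nonneg_right (mul_le_mul_of_nonneg_left hsq (by positivity)) (Real.exp_pos _).le
  refine le_trans h4 (tail_arith ((2:ℝ) ^ LL * (lh : ℝ) ^ 2) _ _ _ hBpos h1 ?_ (by positivity))
  rw [← hA, ← hB]; push_cast at h3 ⊢; linarith

/-- KERNEL/ELABORATOR RULE (ROUND-17 K2, sharpened): a defeq test between `T2 * b2` and its delta-unfolding makes `Meta.whnf`
evaluate `LOGHI` (hence `logIv`) by term reduction — so unfold by the equation lemma first, then match syntactically.
(adapted from `MaynardProductKernelCert4500`). [cite: Polymath8b2014, Theorem 6.7 (product test function), numerical instance k = 3750] -/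
theorem T2_mul_ge : 2 ^ LL * LOGHI ^ 2 * a2 ≤ T2 * b2 := by
  rw [T2]
  exact le_ceilDiv_mul _ _ b2_pos

/-- Checker step `T2_ge` of the `k = 3750` kernel certificate (statement and proof adapted from
`Literature.NumberTheory.Sieve.MaynardProductKernelCert4500`, parity-ideate-p3 ROUND-18 template). [cite: Polymath8b2014, Theorem 6.7 (product test function), numerical instance k = 3750] -/
theorem T2_ge (hS : logOk = true) :
    (2 : ℝ) ^ LL * (2 ^ 80 * LOGr) ^ 2 * Real.exp (-2 * ((Lam : ℝ) * hR) ^ 2 / (((nK : ℝ) + 1) * hR ^ 2)) ≤ (T2 : ℝ) := by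
  have hhi : 2 ^ 80 * LOGr ≤ (LOGHI : ℝ) := (log_enclosure hS).2
  have key := T2_ge_aux LOGHI T2 T2_mul_ge hhi
  exact key

/-! ### the side conditions as real inequalities (arithmetic over variables) -/
/-! ### the E₁-expression of the Hoeffding theorem at our parameters -/
/-- Checker plumbing `Esum`: an exact-integer constant / function of the `k = 3750` kernel certificate
(see the module docstring; adapted from `MaynardProductKernelCert4500`). [folklore] -/
def Esum : ℝ := ∑ j ∈ range (Jc + 1), (j : ℝ) * cellMass (fun t => polymathProfile (nK + 2) cR TR t ^ 2) hR j
/-- Checker plumbing `Eexpr`: an exact-integer constant / function of the `k = 3750` kernel certificate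
(see the module docstring; adapted from `MaynardProductKernelCert4500`). [folklore] -/
def Eexpr : ℝ :=
  (1 / ((nK : ℝ) + 1) ^ 2 * (LOGr - ((nK : ℝ) + 1) * TR / (cR + ((nK : ℝ) + 1) * TR)) - hR * Esum) /
    (TR / (cR * (cR + ((nK : ℝ) + 1) * TR)))

/-- Checker step `Esum_eq` of the `k = 3750` kernel certificate (statement and proof adapted from
`Literature.NumberTheory.Sieve.MaynardProductKernelCert4500`, parity-ideate-p3 ROUND-18 template). [cite: Polymath8b2014, Theorem 6.7 (product test function), numerical instance k = 3750] -/
theorem Esum_eq : Esum = m2R * PT1 := by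
  rw [Esum, PT1, Finset.mul_sum]
  have hv : ∀ j, Jc ≤ j → (j : ℝ) * pp j = 0 := fun j hj => by
    rw [pp_eq, pt_eq_zero hj, mul_zero, mul_zero]
  rw [show (fun j : ℕ => (j : ℝ) * cellMass (fun t => polymathProfile (nK + 2) cR TR t ^ 2) hR j) = fun j : ℕ => (j : ℝ) * pp j
      from rfl, sum_range_of_vanish _ hv (Nat.le_succ Jc), ← sum_range_of_vanish _ hv Jc_lt_MM.le]
  exact Finset.sum_congr rfl fun j _ => by rw [pp_eq]; ring

/-- Checker step `Eexpr_eq` of the `k = 3750` kernel certificate (statement and proof adapted from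
`Literature.NumberTheory.Sieve.MaynardProductKernelCert4500`, parity-ideate-p3 ROUND-18 template). [cite: Polymath8b2014, Theorem 6.7 (product test function), numerical instance k = 3750] -/
theorem Eexpr_eq : Eexpr = (X1 : ℝ) * LOGr / ((cd : ℝ) ^ 2 * Tn * ((nK : ℝ) + 1) ^ 2) - (cn : ℝ) / ((cd : ℝ) * ((nK : ℝ) + 1)) - hR * PT1 := by
  have h1 : (0:ℝ) < cn := by exact_mod_cast param_pos.1
  have h2 : (0:ℝ) < cd := by exact_mod_cast param_pos.2.1
  have h3 : (0:ℝ) < Tn := by exact_mod_cast param_pos.2.2.1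
  have h4 : (0:ℝ) < Td := by exact_mod_cast param_pos.2.2.2.1
  have hK : (0:ℝ) < (nK : ℝ) + 1 := by positivity
  rw [Eexpr, Esum_eq, show m2R = TR / (cR * (cR + ((nK : ℝ) + 1) * TR)) from rfl,
    eexpr_arith ((nK : ℝ) + 1) cR TR cn cd Tn Td LOGr PT1 hR rfl rfl h1 h2 h3 h4 hK, X1]
  push_cast
  ring

/-- Checker step `sideOk_parts` of the `k = 3750` kernel certificate (statement and proof adapted from
`Literature.NumberTheory.Sieve.MaynardProductKernelCert4500`, parity-ideate-p3 ROUND-18 template). [cite: Polymath8b2014, Theorem 6.7 (product test function), numerical instance k = 3750] -/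
theorem sideOk_parts (h : sideOk = true) : logOk = true ∧ chk1 LOGLO SIG = true ∧ chk2 LOGHI SIG = true := by
  simp only [sideOk, Bool.and_eq_true] at h
  exact ⟨h.1, h.2.1, h.2.2⟩

/-- Checker step `chk1_cast` of the `k = 3750` kernel certificate (statement and proof adapted from
`Literature.NumberTheory.Sieve.MaynardProductKernelCert4500`, parity-ideate-p3 ROUND-18 template). [cite: Polymath8b2014, Theorem 6.7 (product test function), numerical instance k = 3750] -/
theorem chk1_cast (lo sg : ℕ) (h : chk1 lo sg = true) :
    (((N1 : ℝ) + Lam) * ((2:ℝ) ^ LL * 2 ^ 80 * (cd : ℝ) ^ 2 * Tn * ((nK : ℝ) + 1) ^ 2) +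
      ((nK : ℝ) + 2) * ((N1 : ℝ) * cn * 2 ^ LL * 2 ^ 80 * cd * Tn * ((nK : ℝ) + 1) + ((sg : ℝ) + (TRI : ℝ)) * (2 ^ 80 * (cd : ℝ) ^ 2 * Tn * ((nK : ℝ) + 1) ^ 2))) ≤
      (MD : ℝ) * ((2:ℝ) ^ LL * 2 ^ 80 * (cd : ℝ) ^ 2 * Tn * ((nK : ℝ) + 1) ^ 2) +
        ((nK : ℝ) + 2) * N1 * ((cn : ℝ) * ((cn : ℝ) * Td + (cd : ℝ) * ((nK : ℝ) + 1) * Tn)) * (lo : ℝ) * 2 ^ LL := by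
  have h1 := Nat.le_of_ble_eq_true h
  have h2 : ((((N1 + Lam) * DDc + (nK + 2) * (C1c + (sg + TRI) * Y1c)) : ℕ) : ℝ) ≤
      (((MD * DDc + (nK + 2) * N1 * X1 * lo * 2 ^ LL) : ℕ) : ℝ) := by exact_mod_cast h1
  unfold DDc C1c Y1c X1 at h2
  push_cast at h2
  linarith

/-- Checker step `chk2_cast` of the `k = 3750` kernel certificate (statement and proof adapted from
`Literature.NumberTheory.Sieve.MaynardProductKernelCert4500`, parity-ideate-p3 ROUND-18 template). [cite: Polymath8b2014, Theorem 6.7 (product test function), numerical instance k = 3750] -/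
theorem chk2_cast (hi sg : ℕ) (h : chk2 hi sg = true) :
    (((dP : ℝ) + Lam) * ((2:ℝ) ^ LL * 2 ^ 80 * (cd : ℝ) ^ 2 * Tn * ((nK : ℝ) + 1) ^ 2) +
      ((nK : ℝ) + 1) * N1 * ((cn : ℝ) * ((cn : ℝ) * Td + (cd : ℝ) * ((nK : ℝ) + 1) * Tn)) * (hi : ℝ) * 2 ^ LL) ≤
      ((nK : ℝ) + 1) * ((2:ℝ) ^ LL * 2 ^ 80 * (cd : ℝ) ^ 2 * Tn * ((nK : ℝ) + 1) ^ 2) +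
        ((nK : ℝ) + 1) * ((N1 : ℝ) * cn * 2 ^ LL * 2 ^ 80 * cd * Tn * ((nK : ℝ) + 1) + (sg : ℝ) * (2 ^ 80 * (cd : ℝ) ^ 2 * Tn * ((nK : ℝ) + 1) ^ 2)) := by
  have h1 := Nat.le_of_ble_eq_true h
  have h2 : ((((dP + Lam) * DDc + (nK + 1) * N1 * X1 * hi * 2 ^ LL) : ℕ) : ℝ) ≤
      ((((nK + 1) * DDc + (nK + 1) * (C1c + sg * Y1c)) : ℕ) : ℝ) := by exact_mod_cast h1
  unfold DDc C1c Y1c X1 at h2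
  push_cast at h2
  linarith

/-- `hcond₁` of the Hoeffding theorem from `sideOk`.
(adapted from `MaynardProductKernelCert4500`). [cite: Polymath8b2014, Theorem 6.7 (product test function), numerical instance k = 3750] -/
theorem hcond1_real (hS : sideOk = true) :
    (1 - ((mstar : ℝ) + 1) * hR) + (Lam : ℝ) * hR ≤ ((nK : ℝ) + 2) * Eexpr := by
  obtain ⟨hlog, hc1, -⟩ := sideOk_parts hS
  have h1 : (0:ℝ) < cn := by exact_mod_cast param_pos.1
  have h2 : (0:ℝ) < cd := by exact_mod_cast param_pos.2.1
  have h3 : (0:ℝ) < Tn := by exact_mod_cast param_pos.2.2.1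
  have h4 : (0:ℝ) < Td := by exact_mod_cast param_pos.2.2.2.1
  have hK : (0:ℝ) < (nK : ℝ) + 1 := by positivity
  have hK2 : (0:ℝ) ≤ (nK : ℝ) + 2 := by positivity
  have hineq := chk1_cast LOGLO SIG hc1
  have hMD : (MD : ℝ) = (mstar : ℝ) + 1 := by unfold MD; push_cast; ring
  rw [hMD] at hineq
  obtain ⟨hlo, -⟩ := log_enclosure hlog
  have key := cond1_arith ((nK : ℝ) + 1) ((nK : ℝ) + 2) cn cd Tn Td N1 ((2:ℝ) ^ LL) ((2:ℝ) ^ 80) LOGr PT1 LOGLO ((SIG : ℝ) + (TRI : ℝ))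
    ((mstar : ℝ) + 1) Lam hK hK2 h1 h2 h3 h4 N1_pos (by positivity) (by positivity) hlo PT1_le hineq
  rw [Eexpr_eq, X1]; unfold hR; push_cast
  linarith [key]

/-- `hcond₂` of the Hoeffding theorem from `sideOk`.
(adapted from `MaynardProductKernelCert4500`). [cite: Polymath8b2014, Theorem 6.7 (product test function), numerical instance k = 3750] -/
theorem hcond2_real (hS : sideOk = true) :
    (dP : ℝ) * hR + (Lam : ℝ) * hR ≤ ((nK : ℝ) + 1) * (hR - Eexpr) := by
  obtain ⟨hlog, -, hc2⟩ := sideOk_parts hS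
  have h1 : (0:ℝ) < cn := by exact_mod_cast param_pos.1
  have h2 : (0:ℝ) < cd := by exact_mod_cast param_pos.2.1
  have h3 : (0:ℝ) < Tn := by exact_mod_cast param_pos.2.2.1
  have h4 : (0:ℝ) < Td := by exact_mod_cast param_pos.2.2.2.1
  have hK : (0:ℝ) < (nK : ℝ) + 1 := by positivity
  have hineq := chk2_cast LOGHI SIG hc2
  obtain ⟨-, hhi⟩ := log_enclosure hlog
  have key := cond2_arith ((nK : ℝ) + 1) cn cd Tn Td N1 ((2:ℝ) ^ LL) ((2:ℝ) ^ 80) LOGr PT1 LOGHI SIG (dP : ℝ) Lam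
    hK h1 h2 h3 h4 N1_pos (by positivity) (by positivity) hhi SIG_le LOGr_nonneg hineq
  rw [Eexpr_eq, X1]; unfold hR; push_cast
  linarith [key]

/-! ### the side conditions from SPLIT kernel facts (three quarter sums of `Σ j·leaf_j` with literal bounds) -/
/-- splitting `sigGo` two levels down (over variables). [cite: Polymath8b2014, Theorem 6.7 (product test function), numerical instance k = 3750] -/
theorem sigGo_split4 (d o : ℕ) : sigGo (d + 2) o =
    sigGo d o + sigGo d (o + 2 ^ d) + (sigGo d (o + 2 ^ (d + 1)) + sigGo d (o + 2 ^ (d + 1) + 2 ^ d)) := by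
  rw [sigGo, sigGo, sigGo]
/-- `sigGo d o = 0` beyond the support. [cite: Polymath8b2014, Theorem 6.7 (product test function), numerical instance k = 3750] -/
theorem sigGo_vanish (d o : ℕ) (ho : Jc ≤ o) : sigGo d o = 0 := by
  rw [sigGo_eq]
  exact Finset.sum_eq_zero fun i _ => by
    have : ¬ (o + i < Jc) := by omega
    simp [leaf, this]
/-- `SIG` as three quarter sums (the fourth quarter lies beyond the support), cast to `ℝ`. [cite: Polymath8b2014, Theorem 6.7 (product test function), numerical instance k = 3750] -/
theorem SIG_split : (SIG : ℝ) =
    (sigGo 18 0 : ℝ) + (sigGo 18 (0 + 2 ^ 18) : ℝ) + (sigGo 18 (0 + 2 ^ (18 + 1)) : ℝ) := by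
  have e : SIG = sigGo 18 0 + sigGo 18 (0 + 2 ^ 18) +
      (sigGo 18 (0 + 2 ^ (18 + 1)) + sigGo 18 (0 + 2 ^ (18 + 1) + 2 ^ 18)) := sigGo_split4 18 0
  have z : sigGo 18 (0 + 2 ^ (18 + 1) + 2 ^ 18) = 0 := sigGo_vanish 18 _ (by decide)
  rw [e, z, Nat.add_zero, Nat.cast_add, Nat.cast_add]
/-- lower literal quarter bounds give `Σ lq ≤ 2^L·PT1`. [cite: Polymath8b2014, Theorem 6.7 (product test function), numerical instance k = 3750] -/
theorem slo_le (l0 l1 l2 : ℕ) (h0 : Nat.ble l0 (sigGo 18 0) = true) (h1 : Nat.ble l1 (sigGo 18 (0 + 2 ^ 18)) = true)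
    (h2 : Nat.ble l2 (sigGo 18 (0 + 2 ^ (18 + 1))) = true) :
    (((l0 + l1 + l2 : ℕ)) : ℝ) ≤ (2 : ℝ) ^ LL * PT1 := by
  have a0 : (l0 : ℝ) ≤ (sigGo 18 0 : ℝ) := Nat.cast_le.2 (Nat.le_of_ble_eq_true h0)
  have a1 : (l1 : ℝ) ≤ (sigGo 18 (0 + 2 ^ 18) : ℝ) := Nat.cast_le.2 (Nat.le_of_ble_eq_true h1)
  have a2 : (l2 : ℝ) ≤ (sigGo 18 (0 + 2 ^ (18 + 1)) : ℝ) := Nat.cast_le.2 (Nat.le_of_ble_eq_true h2)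
  have hs := SIG_le
  rw [SIG_split] at hs
  rw [Nat.cast_add, Nat.cast_add]
  linarith
/-- upper literal quarter bounds give `2^L·PT1 ≤ Σ uq + TRI`. [cite: Polymath8b2014, Theorem 6.7 (product test function), numerical instance k = 3750] -/
theorem shi_ge (u0 u1 u2 : ℕ) (h0 : Nat.ble (sigGo 18 0) u0 = true) (h1 : Nat.ble (sigGo 18 (0 + 2 ^ 18)) u1 = true)
    (h2 : Nat.ble (sigGo 18 (0 + 2 ^ (18 + 1))) u2 = true) :
    (2 : ℝ) ^ LL * PT1 ≤ (((u0 + u1 + u2 : ℕ)) : ℝ) + (TRI : ℝ) := by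
  have a0 : (sigGo 18 0 : ℝ) ≤ (u0 : ℝ) := Nat.cast_le.2 (Nat.le_of_ble_eq_true h0)
  have a1 : (sigGo 18 (0 + 2 ^ 18) : ℝ) ≤ (u1 : ℝ) := Nat.cast_le.2 (Nat.le_of_ble_eq_true h1)
  have a2 : (sigGo 18 (0 + 2 ^ (18 + 1)) : ℝ) ≤ (u2 : ℝ) := Nat.cast_le.2 (Nat.le_of_ble_eq_true h2)
  have hp := PT1_le
  rw [SIG_split] at hp
  rw [Nat.cast_add, Nat.cast_add]
  linarith
/-- `hcond₁` from a literal upper sum `shi` (denominator side condition). [cite: Polymath8b2014, Theorem 6.7 (product test function), numerical instance k = 3750] -/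
theorem hcond1_gen (shi : ℕ) (hlog : logOk = true) (hc1 : chk1 LOGLO shi = true)
    (hshi : (2 : ℝ) ^ LL * PT1 ≤ (shi : ℝ) + (TRI : ℝ)) :
    (1 - ((mstar : ℝ) + 1) * hR) + (Lam : ℝ) * hR ≤ ((nK : ℝ) + 2) * Eexpr := by
  have h1 : (0:ℝ) < cn := by exact_mod_cast param_pos.1
  have h2 : (0:ℝ) < cd := by exact_mod_cast param_pos.2.1
  have h3 : (0:ℝ) < Tn := by exact_mod_cast param_pos.2.2.1
  have h4 : (0:ℝ) < Td := by exact_mod_cast param_pos.2.2.2.1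
  have hK : (0:ℝ) < (nK : ℝ) + 1 := by positivity
  have hK2 : (0:ℝ) ≤ (nK : ℝ) + 2 := by positivity
  have hineq := chk1_cast LOGLO shi hc1
  have hMD : (MD : ℝ) = (mstar : ℝ) + 1 := by unfold MD; push_cast; ring
  rw [hMD] at hineq
  obtain ⟨hlo, -⟩ := log_enclosure hlog
  have key := cond1_arith ((nK : ℝ) + 1) ((nK : ℝ) + 2) cn cd Tn Td N1 ((2:ℝ) ^ LL) ((2:ℝ) ^ 80) LOGr PT1 LOGLO ((shi : ℝ) + (TRI : ℝ))
    ((mstar : ℝ) + 1) Lam hK hK2 h1 h2 h3 h4 N1_pos (by positivity) (by positivity) hlo hshi hineq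
  rw [Eexpr_eq, X1]; unfold hR; push_cast
  linarith [key]
/-- `hcond₂` from a literal lower sum `slo` (numerator side condition). [cite: Polymath8b2014, Theorem 6.7 (product test function), numerical instance k = 3750] -/
theorem hcond2_gen (slo : ℕ) (hlog : logOk = true) (hc2 : chk2 LOGHI slo = true)
    (hslo : (slo : ℝ) ≤ (2 : ℝ) ^ LL * PT1) :
    (dP : ℝ) * hR + (Lam : ℝ) * hR ≤ ((nK : ℝ) + 1) * (hR - Eexpr) := by
  have h1 : (0:ℝ) < cn := by exact_mod_cast param_pos.1
  have h2 : (0:ℝ) < cd := by exact_mod_cast param_pos.2.1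
  have h3 : (0:ℝ) < Tn := by exact_mod_cast param_pos.2.2.1
  have h4 : (0:ℝ) < Td := by exact_mod_cast param_pos.2.2.2.1
  have hK : (0:ℝ) < (nK : ℝ) + 1 := by positivity
  have hineq := chk2_cast LOGHI slo hc2
  obtain ⟨-, hhi⟩ := log_enclosure hlog
  have key := cond2_arith ((nK : ℝ) + 1) cn cd Tn Td N1 ((2:ℝ) ^ LL) ((2:ℝ) ^ 80) LOGr PT1 LOGHI slo (dP : ℝ) Lam
    hK h1 h2 h3 h4 N1_pos (by positivity) (by positivity) hhi hslo LOGr_nonneg hineq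
  rw [Eexpr_eq, X1]; unfold hR; push_cast
  linarith [key]
/-- the split facts give the log enclosure flag and the two side conditions. [cite: Polymath8b2014, Theorem 6.7 (product test function), numerical instance k = 3750] -/
theorem sides_of_facts (l0 l1 l2 u0 u1 u2 : ℕ) (okQ0 : FactQ 0 l0 u0 = true) (okQ1 : FactQ (0 + 2 ^ 18) l1 u1 = true)
    (okQ2 : FactQ (0 + 2 ^ (18 + 1)) l2 u2 = true) (okS : FactS l0 l1 l2 u0 u1 u2 = true) :
    logOk = true ∧ ((1 - ((mstar : ℝ) + 1) * hR) + (Lam : ℝ) * hR ≤ ((nK : ℝ) + 2) * Eexpr) ∧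
      ((dP : ℝ) * hR + (Lam : ℝ) * hR ≤ ((nK : ℝ) + 1) * (hR - Eexpr)) := by
  rw [FactQ, Bool.and_eq_true] at okQ0 okQ1 okQ2
  rw [FactS, Bool.and_eq_true, Bool.and_eq_true] at okS
  obtain ⟨hlog, hc1, hc2⟩ := okS
  exact ⟨hlog, hcond1_gen _ hlog hc1 (shi_ge u0 u1 u2 okQ0.2 okQ1.2 okQ2.2),
    hcond2_gen _ hlog hc2 (slo_le l0 l1 l2 okQ0.1 okQ1.1 okQ2.1)⟩

/-! ### weights and the total mass of `G` -/
/-- Checker step `two_le_kK` of the `k = 3750` kernel certificate (statement and proof adapted from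
`Literature.NumberTheory.Sieve.MaynardProductKernelCert4500`, parity-ideate-p3 ROUND-18 template). [cite: Polymath8b2014, Theorem 6.7 (product test function), numerical instance k = 3750] -/
theorem two_le_kK : 2 ≤ nK + 2 := by omega

/-- Checker step `weight_geH` of the `k = 3750` kernel certificate (statement and proof adapted from
`Literature.NumberTheory.Sieve.MaynardProductKernelCert4500`, parity-ideate-p3 ROUND-18 template). [cite: Polymath8b2014, Theorem 6.7 (product test function), numerical instance k = 3750] -/
theorem weight_geH (m : ℕ) :
    ((ellT (m / WW) : ℝ) / 2 ^ 80 / ((nK : ℝ) + 1)) ^ 2 ≤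
      (∫ u in Ioc 0 (1 - ((((m + (nK + 1) : ℕ) : ℝ)) * hR - (dP : ℝ) * hR)), polymathProfile (nK + 2) cR TR u) ^ 2 := by
  rw [setIntegral_Ioc_polymathProfile two_le_kK cR_pos TR_pos, cast_kK_sub_one]
  exact weight_ge m

/-- Checker step `GT_eq` of the `k = 3750` kernel certificate (statement and proof adapted from
`Literature.NumberTheory.Sieve.MaynardProductKernelCert4500`, parity-ideate-p3 ROUND-18 template). [cite: Polymath8b2014, Theorem 6.7 (product test function), numerical instance k = 3750] -/
theorem GT_eq : (∫ u in Ioc 0 TR, polymathProfile (nK + 2) cR TR u) = 1 / ((nK : ℝ) + 1) * LOGr := by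
  rw [setIntegral_Ioc_polymathProfile two_le_kK cR_pos TR_pos, cast_kK_sub_one, max_eq_left TR_pos.le, min_self, LOGr]

/-- Checker step `hJcH` of the `k = 3750` kernel certificate (statement and proof adapted from
`Literature.NumberTheory.Sieve.MaynardProductKernelCert4500`, parity-ideate-p3 ROUND-18 template). [cite: Polymath8b2014, Theorem 6.7 (product test function), numerical instance k = 3750] -/
theorem hJcH : TR < ((Jc + 1 : ℕ) : ℝ) * hR := by
  rw [TR_eq]; push_cast; linarith [hR_pos]

/-! ## Assembly: the numerator (Hoeffding-recentred) at the program's own parameters -/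

/-- `chkN` as a real inequality (generic in `ns`, `t2`). [cite: Polymath8b2014, Theorem 6.7 (product test function), numerical instance k = 3750] -/
theorem chkN_sound (ns t2 : ℕ) (h : chkN ns t2 = true) :
    (19076 : ℝ) * ((2 : ℝ) ^ LL * (2 ^ 160 * ((nK : ℝ) + 1) ^ 2)) + 10000000000 * (t2 : ℝ) ≤
      10000000000 * (ns : ℝ) := by
  have h1 := Nat.le_of_ble_eq_true h
  have h2 : (((19076 * (2 ^ LL * (2 ^ 160 * (nK + 1) ^ 2)) + 10000000000 * t2 : ℕ)) : ℝ) ≤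
      ((10000000000 * ns : ℕ) : ℝ) := by exact_mod_cast h1
  push_cast at h2
  first
    | exact h2
    | (rw [two_pow_160] at h2; exact h2)

/-- the final numerator arithmetic over variables: from the threshold check and `coef·(ns − t2) ≤ NUMER`. [cite: Polymath8b2014, Theorem 6.7 (product test function), numerical instance k = 3750] -/
theorem numer_arith (c m2p S G K ns t2 NUMER : ℝ) (hS : 0 < S) (hG : 0 < G) (hK : 0 < K) (hm : 0 < m2p)
    (hchk : c * (S * (G * K ^ 2)) + 10000000000 * t2 ≤ 10000000000 * ns)
    (hge : m2p / (S * G * K ^ 2) * (ns - t2) ≤ NUMER) :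
    c / 10000000000 * m2p ≤ NUMER := by
  have hQ : 0 < S * G * K ^ 2 := mul_pos (mul_pos hS hG) (pow_pos hK 2)
  have h1 : c / 10000000000 ≤ (ns - t2) / (S * G * K ^ 2) := by
    rw [div_le_div_iff₀ (by norm_num) hQ]; nlinarith
  calc c / 10000000000 * m2p ≤ (ns - t2) / (S * G * K ^ 2) * m2p := mul_le_mul_of_nonneg_right h1 hm.le
    _ = m2p / (S * G * K ^ 2) * (ns - t2) := by ring
    _ ≤ NUMER := hge

/-- **numerator lower bound** from the floor chain, the interpolated log weights and the integer tail bound: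
`m₂^{k−1}/(2^L 2^160 (k−1)²)·(NUMSUM − T2) ≤ Σ_m (∫_{(0,1−((m+k−1)h−δ)]} g)²·(p^{*(k−1)})_m − (∫_{(0,T]} g)²·m₂^{k−1}·e^{−2λ²/((k−1)h²)}`
(the numerator half of the template's `theta_le_of_partsH`, verbatim). [cite: Polymath8b2014, Theorem 6.7 (product test function), numerical instance k = 3750] -/
theorem numer_ge (hF : resF.2 = true) (hlog : logOk = true) (hT2le : T2 ≤ NUMSUM) :
    m2R ^ (nK + 1) / (((2 ^ LL : ℕ) : ℝ) * 2 ^ 160 * ((nK : ℝ) + 1) ^ 2) * (((NUMSUM - T2 : ℕ)) : ℝ) ≤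
      ∑ m ∈ range MM, (∫ u in Ioc 0 (1 - ((((m + (nK + 1) : ℕ) : ℝ)) * hR - (dP : ℝ) * hR)),
          polymathProfile (nK + 2) cR TR u) ^ 2 *
        dconvPow (cellMass (fun t => polymathProfile (nK + 2) cR TR t ^ 2) hR) (nK + 1) m -
      (∫ u in Ioc 0 TR, polymathProfile (nK + 2) cR TR u) ^ 2 *
        ((TR / (cR * (cR + ((nK : ℝ) + 1) * TR))) ^ (nK + 1) *
          Real.exp (-2 * ((Lam : ℝ) * hR) ^ 2 / (((nK : ℝ) + 1) * hR ^ 2))) := by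
  have hc := cR_pos; have hT := TR_pos; have hh := hR_pos; have hm2 := m2R_pos
  have hS2 : (0:ℝ) < ((2 ^ LL : ℕ) : ℝ) := by exact_mod_cast two_pow_LL_pos
  have hK1 : (0:ℝ) < (nK : ℝ) + 1 := Nat.cast_add_one_pos nK
  have hG : (0:ℝ) < (2:ℝ) ^ 160 := pow_pos two_pos 160
  have hm2def : TR / (cR * (cR + ((nK : ℝ) + 1) * TR)) = m2R := rfl
  obtain ⟨w, hw, hle, hs⟩ := invF_final hF
  have hNUM1 : m2R ^ (nK + 1) / (((2 ^ LL : ℕ) : ℝ) * 2 ^ 160 * ((nK : ℝ) + 1) ^ 2) * (NUMSUM : ℝ) ≤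
      ∑ m ∈ range MM, (∫ u in Ioc 0 (1 - ((((m + (nK + 1) : ℕ) : ℝ)) * hR - (dP : ℝ) * hR)),
        polymathProfile (nK + 2) cR TR u) ^ 2 *
      dconvPow (cellMass (fun t => polymathProfile (nK + 2) cR TR t ^ 2) hR) (nK + 1) m := by
    rw [NUMSUM_eq hw hs, Nat.cast_sum, Finset.mul_sum]
    refine Finset.sum_le_sum fun m hm => ?_
    rw [Finset.mem_range] at hm
    have h1 := weight_geH m
    have h2 : m2R ^ (nK + 1) * (((w m : ℕ) : ℝ) / ((2 ^ LL : ℕ) : ℝ)) ≤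
        dconvPow (cellMass (fun t => polymathProfile (nK + 2) cR TR t ^ 2) hR) (nK + 1) m := by
      rw [show cellMass (fun t => polymathProfile (nK + 2) cR TR t ^ 2) hR = pp from rfl, dconvPow_pp]
      exact mul_le_mul_of_nonneg_left (hle m hm) (pow_pos hm2 _).le
    have h3 : 0 ≤ ((ellT (m / WW) : ℝ) / 2 ^ 80 / ((nK : ℝ) + 1)) ^ 2 := sq_nonneg _
    have h4 : 0 ≤ m2R ^ (nK + 1) * (((w m : ℕ) : ℝ) / ((2 ^ LL : ℕ) : ℝ)) :=
      mul_nonneg (pow_pos hm2 _).le (div_nonneg (Nat.cast_nonneg _) hS2.le)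
    calc m2R ^ (nK + 1) / (((2 ^ LL : ℕ) : ℝ) * 2 ^ 160 * ((nK : ℝ) + 1) ^ 2) * (((ellT (m / WW) ^ 2 * w m : ℕ)) : ℝ)
        = ((ellT (m / WW) : ℝ) / 2 ^ 80 / ((nK : ℝ) + 1)) ^ 2 *
            (m2R ^ (nK + 1) * (((w m : ℕ) : ℝ) / ((2 ^ LL : ℕ) : ℝ))) := by
          rw [Nat.cast_mul, Nat.cast_pow (ellT (m / WW)) 2]
          exact calc_aux _ _ _ _ _ hS2.ne' hK1.ne'
      _ ≤ _ := mul_le_mul h1 h2 h4 (le_trans h3 h1)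
  clear hle hs hw
  have hNS : (((NUMSUM - T2 : ℕ)) : ℝ) = (NUMSUM : ℝ) - (T2 : ℝ) := Nat.cast_sub hT2le
  have hcoef : 0 ≤ m2R ^ (nK + 1) / (((2 ^ LL : ℕ) : ℝ) * 2 ^ 160 * ((nK : ℝ) + 1) ^ 2) :=
    div_nonneg (pow_pos hm2 _).le (mul_pos (mul_pos hS2 hG) (pow_pos hK1 2)).le
  have htail : (∫ u in Ioc 0 TR, polymathProfile (nK + 2) cR TR u) ^ 2 *
        ((TR / (cR * (cR + ((nK : ℝ) + 1) * TR))) ^ (nK + 1) *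
          Real.exp (-2 * ((Lam : ℝ) * hR) ^ 2 / (((nK : ℝ) + 1) * hR ^ 2))) ≤
      m2R ^ (nK + 1) / (((2 ^ LL : ℕ) : ℝ) * 2 ^ 160 * ((nK : ℝ) + 1) ^ 2) * (T2 : ℝ) := by
    have hT2r := T2_ge hlog
    have hpos : 0 < m2R ^ (nK + 1) := pow_pos hm2 _
    have e1 : (1 / ((nK : ℝ) + 1) * LOGr) ^ 2 * (m2R ^ (nK + 1) *
          Real.exp (-2 * ((Lam : ℝ) * hR) ^ 2 / (((nK : ℝ) + 1) * hR ^ 2))) =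
        m2R ^ (nK + 1) / ((2:ℝ) ^ LL * 2 ^ 160 * ((nK : ℝ) + 1) ^ 2) *
          ((2:ℝ) ^ LL * (2 ^ 80 * LOGr) ^ 2 * Real.exp (-2 * ((Lam : ℝ) * hR) ^ 2 / (((nK : ℝ) + 1) * hR ^ 2))) := by
      field_simp
    rw [GT_eq, hm2def, cast_two_pow_LL, e1]
    rw [cast_two_pow_LL] at hcoef
    exact mul_le_mul_of_nonneg_left hT2r hcoef
  rw [hNS, mul_sub]
  linarith [hNUM1, htail]

/-! ## The parameters spelled out (`k = 3750`, `c = 249/2000`, `T = 3/4`, `m₂ = 10⁶/466771167`) -/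

/-- `(k−1 : ℝ) = 3749`. [cite: Polymath8b2014, Theorem 6.7 (product test function), numerical instance k = 3750] -/
theorem cast_K1 : ((nK : ℝ) + 1) = 3749 := by norm_num [nK]
/-- `c = 249/2000`. [cite: Polymath8b2014, Theorem 6.7 (product test function), numerical instance k = 3750] -/
theorem cR_eq : cR = (249 : ℝ) / 2000 := by norm_num [cR, cn, cd]
/-- `T = 3/4`. [cite: Polymath8b2014, Theorem 6.7 (product test function), numerical instance k = 3750] -/
theorem TR_eq' : TR = (3 : ℝ) / 4 := by norm_num [TR, Tn, Td]
/-- `m₂ = T/(c(c+(k−1)T)) = 10⁶/466771167`. [cite: Polymath8b2014, Theorem 6.7 (product test function), numerical instance k = 3750] -/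
theorem m2R_eq : TR / (cR * (cR + ((nK : ℝ) + 1) * TR)) = (1000000 : ℝ) / 466771167 := by
  rw [cR_eq, TR_eq', cast_K1]; norm_num
/-- `m₂` as the constant `m2R`. [cite: Polymath8b2014, Theorem 6.7 (product test function), numerical instance k = 3750] -/
theorem m2R_eq' : m2R = (1000000 : ℝ) / 466771167 := m2R_eq
/-- `log((c+(k−1)T)/c) = log(5623749/249)`. [cite: Polymath8b2014, Theorem 6.7 (product test function), numerical instance k = 3750] -/
theorem LOGr_eq : LOGr = Real.log ((5623749 : ℝ) / 249) := by
  rw [LOGr, cR_eq, TR_eq', cast_K1]; norm_num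
/-- `(k−1)T/(c+(k−1)T) = 5623500/5623749`. [cite: Polymath8b2014, Theorem 6.7 (product test function), numerical instance k = 3750] -/
theorem frac_eq : ((nK : ℝ) + 1) * TR / (cR + ((nK : ℝ) + 1) * TR) = (5623500 : ℝ) / 5623749 := by
  rw [cR_eq, TR_eq', cast_K1]; norm_num
/-- the profile at the program's parameters is Polymath's `g` (`k = 3750`). [cite: Polymath8b2014, Theorem 6.7 (product test function), numerical instance k = 3750] -/
theorem profile_eq : polymathProfile (nK + 2) cR TR = polymathProfile 3750 ((249 : ℝ) / 2000) ((3 : ℝ) / 4) := by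
  rw [cR_eq, TR_eq']; rfl

/-! ### Polymath's profile `g`, `φ = g²` and the mean rounding error (from the line skeleton, verbatim) -/
/-- Polymath's profile `g = 1_{[0,3/4]}/(249/2000 + 3749 t)` (`k = 3750`). [folklore] -/
def g : ℝ → ℝ := polymathProfile 3750 ((249 : ℝ) / 2000) ((3 : ℝ) / 4)
/-- `φ = g²`, the one-factor density. [folklore] -/
def φ : ℝ → ℝ := fun t => polymathProfile 3750 ((249 : ℝ) / 2000) ((3 : ℝ) / 4) t ^ 2

/-- `g` is locally bounded. [cite: Polymath8b2014, Theorem 6.7 (product test function), numerical instance k = 3750] -/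
theorem g_locBdd : LocBdd g := locBdd_polymathProfile (k := 3750) (by norm_num) (by norm_num) (by norm_num)

/-- `g ≥ 0`. [cite: Polymath8b2014, Theorem 6.7 (product test function), numerical instance k = 3750] -/
theorem g_nonneg : ∀ t, 0 ≤ g t := by
  intro t
  by_cases ht : t ∈ Icc (0:ℝ) ((3 : ℝ) / 4)
  · have h1 := (polymathProfile_mem_Icc (k := 3750) (by norm_num) (by norm_num : (0:ℝ) < 249 / 2000)
      (by norm_num) ht).1
    refine le_trans (one_div_pos.2 ?_).le h1
    have := ht.2; push_cast; nlinarith [ht.1, ht.2]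
  · simp [g, polymathProfile_of_notMem ht]

/-- `g` vanishes beyond `T = 3/4`. [cite: Polymath8b2014, Theorem 6.7 (product test function), numerical instance k = 3750] -/
theorem g_eq_zero_of_gt : ∀ x, (3 : ℝ) / 4 < x → g x = 0 :=
  fun _ hx => polymathProfile_of_notMem fun h' => (not_lt.2 h'.2) hx

/-- `φ` is locally bounded. [cite: Polymath8b2014, Theorem 6.7 (product test function), numerical instance k = 3750] -/
theorem φ_locBdd : LocBdd φ := by
  have : φ = fun t => g t * g t := by funext t; simp [φ, g, sq]
  rw [this]; exact g_locBdd.mul g_locBdd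

/-- `φ ≥ 0`. [cite: Polymath8b2014, Theorem 6.7 (product test function), numerical instance k = 3750] -/
theorem φ_nonneg : ∀ t, 0 ≤ φ t := fun _ => sq_nonneg _

/-- `φ` vanishes beyond `T = 3/4`. [cite: Polymath8b2014, Theorem 6.7 (product test function), numerical instance k = 3750] -/
theorem φ_eq_zero_of_gt : ∀ x, (3 : ℝ) / 4 < x → φ x = 0 := fun x hx => by
  simp only [φ]; rw [show polymathProfile 3750 ((249 : ℝ) / 2000) ((3 : ℝ) / 4) x = g x from rfl,
    g_eq_zero_of_gt x hx]; ring

/-- `m₂ = ∫_{[0,∞)} g² = 10⁶/466771167` EXACTLY (`setIntegral_Ici_polymathProfile_sq`). [cite: Polymath8b2014, Theorem 6.7 (product test function), numerical instance k = 3750] -/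
theorem mass_eq : (1000000 : ℝ) / 466771167 = ∫ x in Ici 0, φ x := by
  simp only [φ]
  rw [setIntegral_Ici_polymathProfile_sq (k := 3750) (by norm_num) (by norm_num) (by norm_num)]
  norm_num

/-- **Mean rounding error of one factor, explicit**: for `h > 0`, `J h > 3/4`,
`∫_{[0,∞)} r_h φ = (log(5623749/249) − 5623500/5623749)/3749² − h Σ_{j<J} j p_j`. [cite: Polymath8b2014, Theorem 6.7 (product test function), numerical instance k = 3750] -/
theorem roundErr_moment_eq {h : ℝ} (hh : 0 < h) {J : ℕ} (hJ : (3 : ℝ) / 4 < (J : ℝ) * h) :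
    ∫ x in Ici 0, roundErr h x * φ x =
      1 / (3749 : ℝ) ^ 2 * (Real.log ((5623749 : ℝ) / 249) - (5623500 : ℝ) / 5623749) -
        h * ∑ j ∈ range J, (j : ℝ) * cellMass φ h j := by
  rw [setIntegral_roundErr_mul_eq φ_locBdd φ_eq_zero_of_gt hh hJ]
  simp only [φ]
  rw [setIntegral_Ici_id_mul_polymathProfile_sq (k := 3750) (by norm_num) (by norm_num) (by norm_num)]
  norm_num

/-- the template's `Eexpr` IS the normalised mean rounding error `(∫ r_h g²)/m₂` at `h = 2⁻²⁰`. [cite: Polymath8b2014, Theorem 6.7 (product test function), numerical instance k = 3750] -/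
theorem Eexpr_eq_roundErr :
    Eexpr = (∫ x in Ici 0, roundErr hR x * polymathProfile 3750 ((249 : ℝ) / 2000) ((3 : ℝ) / 4) x ^ 2) /
      ((1000000 : ℝ) / 466771167) := by
  have hJ : (3 : ℝ) / 4 < ((Jc + 1 : ℕ) : ℝ) * hR := by rw [← TR_eq']; exact hJcH
  have key := roundErr_moment_eq hR_pos hJ
  have hE : Esum = ∑ j ∈ range (Jc + 1), (j : ℝ) * cellMass φ hR j := by
    unfold Esum φ; rw [profile_eq]
  rw [show (fun x => roundErr hR x * polymathProfile 3750 ((249 : ℝ) / 2000) ((3 : ℝ) / 4) x ^ 2) =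
      fun x => roundErr hR x * φ x from rfl, key, Eexpr, m2R_eq, frac_eq, LOGr_eq, cast_K1, ← hE]

/-- **side condition** of the stub: `δ + λ ≤ 3749·(h − (∫ r_h g²)/m₂)` at `δ = dP·h`, `λ = Λ·h`. [cite: Polymath8b2014, Theorem 6.7 (product test function), numerical instance k = 3750] -/
theorem side_condition (hc2 : (dP : ℝ) * hR + (Lam : ℝ) * hR ≤ ((nK : ℝ) + 1) * (hR - Eexpr)) :
    (dP : ℝ) * hR + (Lam : ℝ) * hR ≤ (3749 : ℝ) * (hR -
      (∫ x in Ici 0, roundErr hR x * polymathProfile 3750 ((249 : ℝ) / 2000) ((3 : ℝ) / 4) x ^ 2) /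
        ((1000000 : ℝ) / 466771167)) := by
  rw [← Eexpr_eq_roundErr, ← cast_K1]; exact hc2

/-- **the finite inequality** of the stub at the program's parameters, from the kernel facts. [cite: Polymath8b2014, Theorem 6.7 (product test function), numerical instance k = 3750] -/
theorem sum_inequality (hF : resF.2 = true) (hlog : logOk = true) (hT2 : Nat.ble T2 NUMSUM = true)
    (hchk : chkN NUMSUM T2 = true) :
    (19076 : ℝ) / 10000000000 * ((1000000 : ℝ) / 466771167) ^ 3749 ≤
      ∑ m ∈ range MM,
          (∫ u in Ioc 0 (1 - ((((m + 3749 : ℕ) : ℝ)) * hR - (dP : ℝ) * hR)),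
              polymathProfile 3750 ((249 : ℝ) / 2000) ((3 : ℝ) / 4) u) ^ 2 *
            dconvPow (cellMass (fun t => polymathProfile 3750 ((249 : ℝ) / 2000) ((3 : ℝ) / 4) t ^ 2) hR) 3749 m -
        (∫ u in Ioc 0 ((3 : ℝ) / 4), polymathProfile 3750 ((249 : ℝ) / 2000) ((3 : ℝ) / 4) u) ^ 2 *
          (((1000000 : ℝ) / 466771167) ^ 3749 * Real.exp (-2 * ((Lam : ℝ) * hR) ^ 2 / ((3749 : ℝ) * hR ^ 2))) := by
  have hT2le : T2 ≤ NUMSUM := Nat.le_of_ble_eq_true hT2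
  have hge := numer_ge hF hlog hT2le
  have hNS : (((NUMSUM - T2 : ℕ)) : ℝ) = (NUMSUM : ℝ) - (T2 : ℝ) := Nat.cast_sub hT2le
  rw [hNS, m2R_eq', m2R_eq, profile_eq, TR_eq', cast_K1, cast_two_pow_LL, show (nK + 1 : ℕ) = 3749 from rfl] at hge
  have hchk' := chkN_sound NUMSUM T2 hchk
  rw [cast_K1] at hchk'
  have hS2 : (0:ℝ) < (2:ℝ) ^ LL := pow_pos two_pos LL
  exact numer_arith 19076 (((1000000 : ℝ) / 466771167) ^ 3749) ((2:ℝ) ^ LL) ((2:ℝ) ^ 160) 3749 (NUMSUM : ℝ) (T2 : ℝ) _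
    hS2 (pow_pos two_pos 160) (by norm_num) (by positivity) hchk' hge


/-! ## The registered stub and the crux from the two kernel facts -/

/-- the registered stub signature `stub_numHoeffdingCert` of `Cruxes/NumLB3749/Lines/birth.lean` from the two kernel facts
(witnesses: `h = 2⁻²⁰`, `J = Jc + 1`, `M = 2^20`, `δ = 1732 h`, `λ = 150 h`). [cite: Polymath8b2014, Theorem 6.7 (product test function), numerical instance k = 3750] -/
theorem stub_of_facts (okN : FactN = true) (l0 l1 l2 u0 u1 u2 : ℕ) (okQ0 : FactQ 0 l0 u0 = true)
    (okQ1 : FactQ (0 + 2 ^ 18) l1 u1 = true) (okQ2 : FactQ (0 + 2 ^ (18 + 1)) l2 u2 = true)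
    (okS : FactS l0 l1 l2 u0 u1 u2 = true) :
    ∃ (h : ℝ) (Jc M : ℕ) (δ lam : ℝ), 0 < h ∧ (3 : ℝ) / 4 < (Jc : ℝ) * h ∧ 0 ≤ lam ∧
      δ + lam ≤ (3749 : ℝ) * (h -
        (∫ x in Ici 0, roundErr h x * polymathProfile 3750 ((249 : ℝ) / 2000) ((3 : ℝ) / 4) x ^ 2) /
          ((1000000 : ℝ) / 466771167)) ∧
      (19076 : ℝ) / 10000000000 * ((1000000 : ℝ) / 466771167) ^ 3749 ≤
        ∑ m ∈ range M,
            (∫ u in Ioc 0 (1 - ((((m + 3749 : ℕ) : ℝ)) * h - δ)),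
                polymathProfile 3750 ((249 : ℝ) / 2000) ((3 : ℝ) / 4) u) ^ 2 *
              dconvPow (cellMass (fun t => polymathProfile 3750 ((249 : ℝ) / 2000) ((3 : ℝ) / 4) t ^ 2) h) 3749 m -
          (∫ u in Ioc 0 ((3 : ℝ) / 4), polymathProfile 3750 ((249 : ℝ) / 2000) ((3 : ℝ) / 4) u) ^ 2 *
            (((1000000 : ℝ) / 466771167) ^ 3749 * Real.exp (-2 * lam ^ 2 / ((3749 : ℝ) * h ^ 2))) := by
  rw [FactN, Bool.and_eq_true, Bool.and_eq_true] at okN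
  obtain ⟨hF, hT2, hchk⟩ := okN
  obtain ⟨hlog, -, hc2⟩ := sides_of_facts l0 l1 l2 u0 u1 u2 okQ0 okQ1 okQ2 okS
  have hJ : (3 : ℝ) / 4 < ((Jc + 1 : ℕ) : ℝ) * hR := by rw [← TR_eq']; exact hJcH
  exact ⟨hR, Jc + 1, MM, (dP : ℝ) * hR, (Lam : ℝ) * hR, hR_pos, hJ, mul_nonneg (Nat.cast_nonneg _) hR_pos.le,
    side_condition hc2, sum_inequality hF hlog hT2 hchk⟩

end

/-! ## DENOMINATOR (`DenUB3750`, item stmt-Parity-19251): ceil chain on the block-upper initial vector -/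
/-- exact upper leaf `⌊2^L p_j⌋ + 1 ≥ 2^L p_j`. [folklore] -/
def uleafE (j : ℕ) : ℕ := leafE j + 1
/-- block upper leaf: the FIRST cell of block `b` (the largest mass in the block), rounded up. [folklore] -/
def buleafE (e b : ℕ) : ℕ := leafE (2 ^ e + BK * b) + 1
/-- the upper initial vector as a function (specification only). [folklore] -/
def uvE (e j : ℕ) : ℕ := if j < 2 ^ e then uleafE j else buleafE e ((j - 2 ^ e) / BK)
/-- the upper initial vector restricted to the support (specification only). [folklore] -/
def uv (j : ℕ) : ℕ := if j < Jc then uvE 18 j else 0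
/-- packed upper initial vector (`2^18` exact digits, `2^16` blocks of `8`). [folklore] -/
def NUb : ℕ := kpackDC BB uleafE 18 0 + (kpackDC (BB * BK) (fun b => buleafE 18 b * repUnit BK) 16 0 <<< (BB * 2 ^ 18))
/-- the ceil chain from `NUb` (`k = 3750 = expo bitsC`). [folklore] -/
def resCb : ℕ × Bool := runC NUb (ssum NUb) bitsC
/-- its packed result. [folklore] -/
def NCb : ℕ := resCb.1
/-- the partial slot sum below `MD = m⋆ + 1`. [folklore] -/
def sDb : ℕ := psum NCb MD
/-- the denominator threshold check over variables: `10⁵·(sd + t1) ≤ 41694·2^L`. [folklore] -/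
def chkD (sd t1 : ℕ) : Bool := Nat.ble (100000 * (sd + t1)) (41694 * 2 ^ LL)
/-- kernel fact D (literal-free): ceil chain consistent and the threshold check on `sDb`, `T1`. [folklore] -/
def FactD : Bool := resCb.2 && chkD sDb T1

/-! ## Soundness -/
noncomputable section

/-- the two-part upper initial vector is the packing of `uvE e` (over variables). [cite: Polymath8b2014, Theorem 6.7 (product test function), numerical instance k = 3750] -/
theorem initPackU_eq (e f : ℕ) :
    kpackDC BB uleafE e 0 + (kpackDC (BB * BK) (fun b => buleafE e b * repUnit BK) f 0 <<< (BB * 2 ^ e)) =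
      kpack BB (2 ^ e + BK * 2 ^ f) (uvE e) := by
  have hK : 0 < BK := by decide
  rw [kpackDC_zero_eq, kpackDC_zero_eq, Nat.shiftLeft_eq, kpack_blocks BK (2 ^ f) (buleafE e) hK, kpack_add]
  have h1 : kpack BB (2 ^ e) uleafE = kpack BB (2 ^ e) (uvE e) :=
    kpack_congr fun m hm => by rw [uvE, if_pos hm]
  have h2 : kpack BB (BK * 2 ^ f) (fun j => buleafE e (j / BK)) = kpack BB (BK * 2 ^ f) (fun i => uvE e (2 ^ e + i)) :=
    kpack_congr fun m _ => by
      rw [uvE, if_neg (Nat.not_lt.2 (Nat.le_add_right _ _)), Nat.add_sub_cancel_left]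
  rw [h1, h2, Nat.mul_comm (kpack BB (BK * 2 ^ f) _) (2 ^ (BB * 2 ^ e))]
/-- **the packed upper initial vector is `kpack BB MM uv`**. [cite: Polymath8b2014, Theorem 6.7 (product test function), numerical instance k = 3750] -/
theorem NUb_eq : NUb = kpack BB MM uv := by
  have h := initPackU_eq 18 16
  rw [Jc_split] at h
  have hx := kpack_extend Jc (MM - Jc) (uvE 18) uv (fun j hj => by rw [uv, if_pos hj])
    (fun j hj => by rw [uv, if_neg (Nat.not_lt.2 hj)])
  rw [MM_split] at hx
  exact h.trans hx
/-- exact upper leaf above the cell mass: `pt j ≤ (leafE j + 1)/2^L` on the support. [cite: Polymath8b2014, Theorem 6.7 (product test function), numerical instance k = 3750] -/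
theorem le_uleafE_div {j : ℕ} (hj : j < Jc) : pt j ≤ ((uleafE j : ℕ) : ℝ) / ((2 ^ LL : ℕ) : ℝ) := by
  rw [uleafE, leafE, pt_eq hj, div_le_div_iff₀ (by exact_mod_cast DEN_pos j) (by exact_mod_cast Nat.two_pow_pos LL)]
  have hnat : NUM * 2 ^ LL ≤ (2 ^ LL * NUM / DEN j + 1) * DEN j := by
    rw [Nat.mul_comm NUM, Nat.add_mul, Nat.one_mul]
    exact (Nat.lt_div_mul_add (DEN_pos j)).le
  exact_mod_cast hnat
/-- **the cell masses are below the upper initial vector**: `pt m ≤ uv m / 2^L`. [cite: Polymath8b2014, Theorem 6.7 (product test function), numerical instance k = 3750] -/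
theorem le_uv_div (m : ℕ) : pt m ≤ ((uv m : ℕ) : ℝ) / ((2 ^ LL : ℕ) : ℝ) := by
  unfold uv
  split_ifs with hm
  · unfold uvE
    split_ifs with hlo
    · exact le_uleafE_div hm
    · have hJ : Jc = 786432 := by decide
      have hP : (2 : ℕ) ^ 18 = 262144 := by norm_num
      have h1 := Nat.div_add_mod (m - 2 ^ 18) 8
      have h2 := Nat.mod_lt (m - 2 ^ 18) (by decide : 0 < 8)
      have hm' : 2 ^ 18 + BK * ((m - 2 ^ 18) / BK) ≤ m := by
        show 2 ^ 18 + 8 * ((m - 2 ^ 18) / 8) ≤ m; omega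
      have hf : 2 ^ 18 + BK * ((m - 2 ^ 18) / BK) < Jc := lt_of_le_of_lt hm' hm
      calc pt m ≤ pt (2 ^ 18 + BK * ((m - 2 ^ 18) / BK)) := pt_anti hm' hm
        _ ≤ _ := by
          rw [buleafE]
          exact le_uleafE_div hf
  · rw [pt_eq_zero (Nat.not_lt.1 hm), Nat.cast_zero, zero_div]
/-- `Σ_{m<M} uv m < 2^B − 1` (each digit `≤ 2^L + 1`). [cite: Polymath8b2014, Theorem 6.7 (product test function), numerical instance k = 3750] -/
theorem sum_uv_lt : ∑ m ∈ range MM, uv m < 2 ^ BB - 1 := by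
  have h1 : ∀ m ∈ range MM, uv m ≤ 2 ^ LL + 1 := fun m _ => by
    unfold uv uvE uleafE buleafE
    split_ifs <;> first | exact Nat.add_le_add_right (leafE_le _) 1 | exact Nat.zero_le _
  exact lt_of_le_of_lt (Finset.sum_le_sum h1) (by simpa [Finset.sum_const, Finset.card_range] using sizeC)
/-- the upper initial vector satisfies the ceil-chain invariant at `n = 1`. [cite: Polymath8b2014, Theorem 6.7 (product test function), numerical instance k = 3750] -/
theorem invCb_init : InvC 1 NUb :=
  ⟨uv, NUb_eq, fun m _ => by rw [dconvPow_one]; exact le_uv_div m, sum_uv_lt⟩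
/-- the ceil chain ends at `p^{*k}`. [cite: Polymath8b2014, Theorem 6.7 (product test function), numerical instance k = 3750] -/
theorem invCb_final (h : resCb.2 = true) : InvC (nK + 2) NCb := by
  rw [← expo_bitsC]; exact runC_sound invCb_init rfl bitsC h
/-- denominator: `Σ_{m<MD} pt^{∗k}_m ≤ sDb / 2^L`. [cite: Polymath8b2014, Theorem 6.7 (product test function), numerical instance k = 3750] -/
theorem denb_le (h : resCb.2 = true) :
    ∑ m ∈ range MD, dconvPow pt (nK + 2) m ≤ ((sDb : ℕ) : ℝ) / ((2 ^ LL : ℕ) : ℝ) := by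
  obtain ⟨w, hw, hle, hs⟩ := invCb_final h
  have h1 : ∀ m < MD, dconvPow pt (nK + 2) m ≤ ((w m : ℕ) : ℝ) / ((2 ^ LL : ℕ) : ℝ) :=
    fun m hm => hle m (lt_of_lt_of_le hm MD_le_MM)
  have h2 := sum_dconvPow_le_cast_div h1
  rwa [← psum_kpack hs MD_le_MM, ← hw] at h2
/-- `chkD` as a real inequality (generic). [cite: Polymath8b2014, Theorem 6.7 (product test function), numerical instance k = 3750] -/
theorem chkD_sound (sd t1 : ℕ) (h : chkD sd t1 = true) :
    (100000 : ℝ) * ((sd : ℝ) + (t1 : ℝ)) ≤ 41694 * (2 : ℝ) ^ LL := by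
  have h1 := Nat.le_of_ble_eq_true h
  have h2 : (((100000 * (sd + t1)) : ℕ) : ℝ) ≤ ((41694 * 2 ^ LL : ℕ) : ℝ) := by exact_mod_cast h1
  push_cast at h2
  exact h2
/-- the denominator arithmetic over variables. [cite: Polymath8b2014, Theorem 6.7 (product test function), numerical instance k = 3750] -/
theorem den_arith (m2p S sd t1 P TL : ℝ) (hS : 0 < S) (hm : 0 < m2p)
    (hchk : 100000 * (sd + t1) ≤ 41694 * S) (hP : P ≤ sd / S) (hT : S * TL ≤ t1) :
    m2p * P + m2p * TL ≤ 41694 / 100000 * m2p := by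
  have h1 : P + TL ≤ (sd + t1) / S := by
    rw [le_div_iff₀ hS] at *
    have := hP; nlinarith
  have h2 : (sd + t1) / S ≤ 41694 / 100000 := by
    rw [div_le_iff₀ hS]; linarith
  nlinarith

/-- **the finite inequality** of the stub at the program's parameters, from the kernel fact. [cite: Polymath8b2014, Theorem 6.7 (product test function), numerical instance k = 3750] -/
theorem den_inequality (hC : resCb.2 = true) (hchk : chkD sDb T1 = true) :
    ∑ m ∈ range (mstar + 1),
        dconvPow (cellMass (fun t => polymathProfile 3750 ((249 : ℝ) / 2000) ((3 : ℝ) / 4) t ^ 2) hR) 3750 m +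
      ((1000000 : ℝ) / 466771167) ^ 3750 * Real.exp (-2 * ((Lam : ℝ) * hR) ^ 2 / ((3750 : ℝ) * hR ^ 2)) ≤
      (41694 : ℝ) / 100000 * ((1000000 : ℝ) / 466771167) ^ 3750 := by
  have hm2 := m2R_pos
  have hS2 : (0:ℝ) < ((2 ^ LL : ℕ) : ℝ) := by exact_mod_cast two_pow_LL_pos
  have hDEN_eq : ∑ m ∈ range (mstar + 1), dconvPow (cellMass (fun t => polymathProfile (nK + 2) cR TR t ^ 2) hR) (nK + 2) m =
      m2R ^ (nK + 2) * ∑ m ∈ range MD, dconvPow pt (nK + 2) m := by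
    rw [show mstar + 1 = MD from rfl, Finset.mul_sum]; exact Finset.sum_congr rfl fun m _ => dconvPow_pp (nK + 2) m
  have hden := denb_le hC
  have htail := T1_ge
  have hchk' := chkD_sound sDb T1 hchk
  rw [cast_two_pow_LL] at hden
  have key := den_arith (m2R ^ (nK + 2)) ((2:ℝ) ^ LL) (sDb : ℝ) (T1 : ℝ) _ _ (pow_pos two_pos LL) (pow_pos hm2 _) hchk' hden htail
  rw [← hDEN_eq, profile_eq, m2R_eq', show (nK + 2 : ℕ) = 3750 from rfl,
    show ((nK : ℝ) + 2) = (3750 : ℝ) by norm_num [nK]] at key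
  exact key

/-- **side condition** of the stub: `1 − (m⋆+1)h + λ ≤ 3750·(∫ r_h g²)/m₂`. [cite: Polymath8b2014, Theorem 6.7 (product test function), numerical instance k = 3750] -/
theorem den_side (hc1 : (1 - ((mstar : ℝ) + 1) * hR) + (Lam : ℝ) * hR ≤ ((nK : ℝ) + 2) * Eexpr) :
    (1 - ((mstar : ℝ) + 1) * hR) + (Lam : ℝ) * hR ≤
      (3750 : ℝ) * ((∫ x in Ici 0, roundErr hR x * polymathProfile 3750 ((249 : ℝ) / 2000) ((3 : ℝ) / 4) x ^ 2) /
        ((1000000 : ℝ) / 466771167)) := by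
  rw [← Eexpr_eq_roundErr, show (3750 : ℝ) = ((nK : ℝ) + 2) by norm_num [nK]]; exact hc1

/-- the registered stub signature `stub_denHoeffdingCert` from the kernel facts (witnesses `h = 2⁻²⁰`, `J = Jc + 1`, `m⋆ = 1046863`,
`λ = 150 h`). [cite: Polymath8b2014, Theorem 6.7 (product test function), numerical instance k = 3750] -/
theorem stub_of_factsD (okD : FactD = true) (l0 l1 l2 u0 u1 u2 : ℕ) (okQ0 : FactQ 0 l0 u0 = true)
    (okQ1 : FactQ (0 + 2 ^ 18) l1 u1 = true) (okQ2 : FactQ (0 + 2 ^ (18 + 1)) l2 u2 = true)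
    (okS : FactS l0 l1 l2 u0 u1 u2 = true) :
    ∃ (h : ℝ) (Jc mstar : ℕ) (lam : ℝ), 0 < h ∧ (3 : ℝ) / 4 < (Jc : ℝ) * h ∧ 0 ≤ lam ∧
      (1 - ((mstar : ℝ) + 1) * h) + lam ≤
        (3750 : ℝ) * ((∫ x in Ici 0, roundErr h x * polymathProfile 3750 ((249 : ℝ) / 2000) ((3 : ℝ) / 4) x ^ 2) /
          ((1000000 : ℝ) / 466771167)) ∧
      ∑ m ∈ range (mstar + 1),
          dconvPow (cellMass (fun t => polymathProfile 3750 ((249 : ℝ) / 2000) ((3 : ℝ) / 4) t ^ 2) h) 3750 m +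
        ((1000000 : ℝ) / 466771167) ^ 3750 * Real.exp (-2 * lam ^ 2 / ((3750 : ℝ) * h ^ 2)) ≤
        (41694 : ℝ) / 100000 * ((1000000 : ℝ) / 466771167) ^ 3750 := by
  rw [FactD, Bool.and_eq_true] at okD
  obtain ⟨hC, hchk⟩ := okD
  obtain ⟨-, hc1, -⟩ := sides_of_facts l0 l1 l2 u0 u1 u2 okQ0 okQ1 okQ2 okS
  have hJ : (3 : ℝ) / 4 < ((Jc + 1 : ℕ) : ℝ) * hR := by rw [← TR_eq']; exact hJcH
  exact ⟨hR, Jc + 1, mstar, (Lam : ℝ) * hR, hR_pos, hJ, mul_nonneg (Nat.cast_nonneg _) hR_pos.le,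
    den_side hc1, den_inequality hC hchk⟩

end

end Literature.NumberTheory.Sieve.MaynardTao.ProductKernelCert3750

/-! ## Memory-light block sum over the HIGH half of the slots (`NUMSUMH`, `FactNH`)

The slots `m < 2^19` (sums `S ≲ 1/2`) carry `< 10⁻⁶` of the mass of `p^{*3749}`; dropping them keeps a LOWER bound of the numerator
(all terms are `≥ 0`) and halves both the splitting volume and the number of block evaluations in the kernel (the full block sum
`NUMSUM` over `2^20` slots exceeds the farm kernel's memory ceiling after the chain; the chain itself fits). -/

namespace Literature.NumberTheory.Sieve.MaynardTao.ProductKernelCert3750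

/-- log2 of the number of high slots kept (`2^19` of `2^20`). [folklore] -/
def eH : ℕ := 19
/-- the block sum against the interpolated log weights over the HIGH half of the slots only. [folklore] -/
def NUMSUMH : ℕ := nsGo (NF >>> (BB * 2 ^ eH)) (eH - Wexp) (2 ^ (eH - Wexp))
/-- kernel fact N, high-half form (literal-free): floor chain consistent, `T2 ≤ NUMSUMH`, threshold check on `NUMSUMH − T2`. [folklore] -/
def FactNH : Bool := resF.2 && (Nat.ble T2 NUMSUMH && chkN NUMSUMH T2)

noncomputable section

/-- `M = 2^19 + 2^19`. [cite: Polymath8b2014, Theorem 6.7 (product test function), numerical instance k = 3750] -/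
theorem MM_eqH : MM = 2 ^ eH + 2 ^ eH := by decide
/-- `2^19 = W · 2^14`. [cite: Polymath8b2014, Theorem 6.7 (product test function), numerical instance k = 3750] -/
theorem eH_eqW : 2 ^ eH = 2 ^ (eH - Wexp) * WW := by decide
/-- `2^19 ≤ M`. [cite: Polymath8b2014, Theorem 6.7 (product test function), numerical instance k = 3750] -/
theorem eH_le_MM : 2 ^ eH ≤ MM := by decide

/-- the high half of the packed floor vector is the packing of the high digits.
[cite: Polymath8b2014, Theorem 6.7 (product test function), numerical instance k = 3750] -/
theorem NF_high {w : ℕ → ℕ} (hw : NF = kpack BB MM w) (hs : ∑ m ∈ range MM, w m < 2 ^ BB - 1) :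
    NF >>> (BB * 2 ^ eH) = kpack BB (2 ^ eH) (fun i => w (2 ^ eH + i)) := by
  have hd := digits_lt hs
  rw [hw, MM_eqH]
  exact (kpack_low_high (P := 2 ^ eH) (w := w) fun j hj => hd j (lt_of_lt_of_le hj eH_le_MM)).2

/-- **the high-half block sum in block form**: `NUMSUMH = Σ_{i < 2^14} ellT(2^14 + i)² · Σ_{t<W} w_{2^19 + iW + t}`.
[cite: Polymath8b2014, Theorem 6.7 (product test function), numerical instance k = 3750] -/
theorem NUMSUMH_eq {w : ℕ → ℕ} (hw : NF = kpack BB MM w) (hs : ∑ m ∈ range MM, w m < 2 ^ BB - 1) :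
    NUMSUMH = ∑ i ∈ range (2 ^ (eH - Wexp)), ellT (2 ^ (eH - Wexp) + i) ^ 2 *
      ∑ t ∈ range WW, w (2 ^ eH + (i * WW + t)) := by
  have hd := digits_lt hs
  have hd' : ∀ j < WW * 2 ^ (eH - Wexp), (fun i => w (2 ^ eH + i)) j < 2 ^ BB := fun j hj =>
    hd _ (by rw [MM_eqH, eH_eqW]; rw [Nat.mul_comm] at hj; omega)
  have hs' : ∀ i < 2 ^ (eH - Wexp), ∑ t ∈ range WW, (fun i => w (2 ^ eH + i)) (i * WW + t) < 2 ^ BB - 1 := by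
    intro i hi
    refine lt_of_le_of_lt ?_ hs
    have hsub : ∑ t ∈ range WW, w (2 ^ eH + (i * WW + t)) =
        ∑ m ∈ (range WW).map (addLeftEmbedding (2 ^ eH + i * WW)), w m := by
      rw [Finset.sum_map]; exact Finset.sum_congr rfl fun t _ => by simp [add_assoc]
    show ∑ t ∈ range WW, w (2 ^ eH + (i * WW + t)) ≤ _
    rw [hsub]
    apply Finset.sum_le_sum_of_subset_of_nonneg
    · intro m hm
      rw [Finset.mem_map] at hm
      obtain ⟨t, ht, rfl⟩ := hm
      rw [Finset.mem_range] at ht ⊢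
      simp only [addLeftEmbedding_apply]
      have : i * WW + t < 2 ^ (eH - Wexp) * WW := by nlinarith
      rw [MM_eqH, eH_eqW]; omega
    · exact fun _ _ _ => Nat.zero_le _
  have e1 : kpack BB (2 ^ eH) (fun i => w (2 ^ eH + i)) = kpack BB (WW * 2 ^ (eH - Wexp)) (fun i => w (2 ^ eH + i)) := by
    rw [eH_eqW, Nat.mul_comm]
  rw [NUMSUMH, NF_high hw hs, e1, nsGo_eq (eH - Wexp) (2 ^ (eH - Wexp)) (fun i => w (2 ^ eH + i)) hd' hs']

/-- the FULL block sum in block form (from the tree's slot form). [cite: Polymath8b2014, Theorem 6.7 (product test function), numerical instance k = 3750] -/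
theorem NUMSUM_eq_blocks {w : ℕ → ℕ} (hw : NF = kpack BB MM w) (hs : ∑ m ∈ range MM, w m < 2 ^ BB - 1) :
    NUMSUM = ∑ i ∈ range rr, ellT i ^ 2 * ∑ t ∈ range WW, w (i * WW + t) := by
  rw [NUMSUM_eq hw hs, MM_eq, sum_range_mul_blockConst (fun i => ellT i ^ 2) w WW rr]

/-- `rr = 2^14 + 2^14`. [cite: Polymath8b2014, Theorem 6.7 (product test function), numerical instance k = 3750] -/
theorem rr_eqH : rr = 2 ^ (eH - Wexp) + 2 ^ (eH - Wexp) := by decide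

/-- the high-half block sum is below the full one. [cite: Polymath8b2014, Theorem 6.7 (product test function), numerical instance k = 3750] -/
theorem NUMSUMH_le (hF : resF.2 = true) : NUMSUMH ≤ NUMSUM := by
  obtain ⟨w, hw, -, hs⟩ := invF_final hF
  rw [NUMSUMH_eq hw hs, NUMSUM_eq_blocks hw hs, rr_eqH, Finset.sum_range_add]
  have e : ∀ i t : ℕ, (2 ^ (eH - Wexp) + i) * WW + t = 2 ^ eH + (i * WW + t) := fun i t => by
    rw [eH_eqW]; ring
  have hh : ∑ i ∈ range (2 ^ (eH - Wexp)), ellT (2 ^ (eH - Wexp) + i) ^ 2 * ∑ t ∈ range WW, w ((2 ^ (eH - Wexp) + i) * WW + t) =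
      ∑ i ∈ range (2 ^ (eH - Wexp)), ellT (2 ^ (eH - Wexp) + i) ^ 2 * ∑ t ∈ range WW, w (2 ^ eH + (i * WW + t)) :=
    Finset.sum_congr rfl fun i _ =>
      congrArg (fun s => ellT (2 ^ (eH - Wexp) + i) ^ 2 * s) (Finset.sum_congr rfl fun t _ => by rw [e])
  rw [← hh]
  exact Nat.le_add_left _ _

/-- **numerator lower bound, high-half form**. [cite: Polymath8b2014, Theorem 6.7 (product test function), numerical instance k = 3750] -/
theorem numer_geH (hF : resF.2 = true) (hlog : logOk = true) (hT2le : T2 ≤ NUMSUMH) :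
    m2R ^ (nK + 1) / (((2 ^ LL : ℕ) : ℝ) * 2 ^ 160 * ((nK : ℝ) + 1) ^ 2) * (((NUMSUMH - T2 : ℕ)) : ℝ) ≤
      ∑ m ∈ range MM, (∫ u in Ioc 0 (1 - ((((m + (nK + 1) : ℕ) : ℝ)) * hR - (dP : ℝ) * hR)),
          polymathProfile (nK + 2) cR TR u) ^ 2 *
        dconvPow (cellMass (fun t => polymathProfile (nK + 2) cR TR t ^ 2) hR) (nK + 1) m -
      (∫ u in Ioc 0 TR, polymathProfile (nK + 2) cR TR u) ^ 2 *
        ((TR / (cR * (cR + ((nK : ℝ) + 1) * TR))) ^ (nK + 1) *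
          Real.exp (-2 * ((Lam : ℝ) * hR) ^ 2 / (((nK : ℝ) + 1) * hR ^ 2))) := by
  have hle : NUMSUMH ≤ NUMSUM := NUMSUMH_le hF
  have h := numer_ge hF hlog (hT2le.trans hle)
  have hS2 : (0:ℝ) < ((2 ^ LL : ℕ) : ℝ) := by exact_mod_cast two_pow_LL_pos
  have hK1 : (0:ℝ) < (nK : ℝ) + 1 := Nat.cast_add_one_pos nK
  have hcoef : 0 ≤ m2R ^ (nK + 1) / (((2 ^ LL : ℕ) : ℝ) * 2 ^ 160 * ((nK : ℝ) + 1) ^ 2) :=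
    div_nonneg (pow_pos m2R_pos _).le (mul_pos (mul_pos hS2 (pow_pos two_pos 160)) (pow_pos hK1 2)).le
  have hcast : (((NUMSUMH - T2 : ℕ)) : ℝ) ≤ (((NUMSUM - T2 : ℕ)) : ℝ) := Nat.cast_le.2 (Nat.sub_le_sub_right hle T2)
  exact le_trans (mul_le_mul_of_nonneg_left hcast hcoef) h

/-- **the finite inequality** of the stub from the high-half kernel fact. [cite: Polymath8b2014, Theorem 6.7 (product test function), numerical instance k = 3750] -/
theorem sum_inequalityH (hF : resF.2 = true) (hlog : logOk = true) (hT2 : Nat.ble T2 NUMSUMH = true)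
    (hchk : chkN NUMSUMH T2 = true) :
    (19076 : ℝ) / 10000000000 * ((1000000 : ℝ) / 466771167) ^ 3749 ≤
      ∑ m ∈ range MM,
          (∫ u in Ioc 0 (1 - ((((m + 3749 : ℕ) : ℝ)) * hR - (dP : ℝ) * hR)),
              polymathProfile 3750 ((249 : ℝ) / 2000) ((3 : ℝ) / 4) u) ^ 2 *
            dconvPow (cellMass (fun t => polymathProfile 3750 ((249 : ℝ) / 2000) ((3 : ℝ) / 4) t ^ 2) hR) 3749 m -
        (∫ u in Ioc 0 ((3 : ℝ) / 4), polymathProfile 3750 ((249 : ℝ) / 2000) ((3 : ℝ) / 4) u) ^ 2 *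
          (((1000000 : ℝ) / 466771167) ^ 3749 * Real.exp (-2 * ((Lam : ℝ) * hR) ^ 2 / ((3749 : ℝ) * hR ^ 2))) := by
  have hT2le : T2 ≤ NUMSUMH := Nat.le_of_ble_eq_true hT2
  have hge := numer_geH hF hlog hT2le
  have hNS : (((NUMSUMH - T2 : ℕ)) : ℝ) = (NUMSUMH : ℝ) - (T2 : ℝ) := Nat.cast_sub hT2le
  rw [hNS, m2R_eq', m2R_eq, profile_eq, TR_eq', cast_K1, cast_two_pow_LL, show (nK + 1 : ℕ) = 3749 from rfl] at hge
  have hchk' := chkN_sound NUMSUMH T2 hchk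
  rw [cast_K1] at hchk'
  have hS2 : (0:ℝ) < (2:ℝ) ^ LL := pow_pos two_pos LL
  exact numer_arith 19076 (((1000000 : ℝ) / 466771167) ^ 3749) ((2:ℝ) ^ LL) ((2:ℝ) ^ 160) 3749 (NUMSUMH : ℝ) (T2 : ℝ) _
    hS2 (pow_pos two_pos 160) (by norm_num) (by positivity) hchk' hge

/-- **the registered stub `stub_numHoeffdingCert` from the memory-light facts** (`FactNH` instead of `FactN`).
[cite: Polymath8b2014, Theorem 6.7 (product test function), numerical instance k = 3750] -/
theorem stub_of_factsH (okN : FactNH = true) (l0 l1 l2 u0 u1 u2 : ℕ) (okQ0 : FactQ 0 l0 u0 = true)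
    (okQ1 : FactQ (0 + 2 ^ 18) l1 u1 = true) (okQ2 : FactQ (0 + 2 ^ (18 + 1)) l2 u2 = true)
    (okS : FactS l0 l1 l2 u0 u1 u2 = true) :
    ∃ (h : ℝ) (Jc M : ℕ) (δ lam : ℝ), 0 < h ∧ (3 : ℝ) / 4 < (Jc : ℝ) * h ∧ 0 ≤ lam ∧
      δ + lam ≤ (3749 : ℝ) * (h -
        (∫ x in Ici 0, roundErr h x * polymathProfile 3750 ((249 : ℝ) / 2000) ((3 : ℝ) / 4) x ^ 2) /
          ((1000000 : ℝ) / 466771167)) ∧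
      (19076 : ℝ) / 10000000000 * ((1000000 : ℝ) / 466771167) ^ 3749 ≤
        ∑ m ∈ range M,
            (∫ u in Ioc 0 (1 - ((((m + 3749 : ℕ) : ℝ)) * h - δ)),
                polymathProfile 3750 ((249 : ℝ) / 2000) ((3 : ℝ) / 4) u) ^ 2 *
              dconvPow (cellMass (fun t => polymathProfile 3750 ((249 : ℝ) / 2000) ((3 : ℝ) / 4) t ^ 2) h) 3749 m -
          (∫ u in Ioc 0 ((3 : ℝ) / 4), polymathProfile 3750 ((249 : ℝ) / 2000) ((3 : ℝ) / 4) u) ^ 2 *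
            (((1000000 : ℝ) / 466771167) ^ 3749 * Real.exp (-2 * lam ^ 2 / ((3749 : ℝ) * h ^ 2))) := by
  rw [FactNH, Bool.and_eq_true, Bool.and_eq_true] at okN
  obtain ⟨hF, hT2, hchk⟩ := okN
  obtain ⟨hlog, -, hc2⟩ := sides_of_facts l0 l1 l2 u0 u1 u2 okQ0 okQ1 okQ2 okS
  have hJ : (3 : ℝ) / 4 < ((Jc + 1 : ℕ) : ℝ) * hR := by rw [← TR_eq']; exact hJcH
  exact ⟨hR, Jc + 1, MM, (dP : ℝ) * hR, (Lam : ℝ) * hR, hR_pos, hJ, mul_nonneg (Nat.cast_nonneg _) hR_pos.le,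
    side_condition hc2, sum_inequalityH hF hlog hT2 hchk⟩

end

end Literature.NumberTheory.Sieve.MaynardTao.ProductKernelCert3750

/-! ## Memory-light block sums by SLICES (`NUMSUMS s`, `FactSl`, `FactCh`, `FactFin`)

Each kernel declaration that touches `NF` pays the packing (≈ 13 operands) and the 15-step chain (≈ 60 cached operands); the block-sum
phase must then stay within a couple of operands.  Slice `s < 8` of the high half (`2^16` slots starting at `2^19 + s·2^16`) is read off
`NF` by ONE shift and one small mask and split on a `2^16`-slot number; eight declarations certify literal lower bounds `L_s ≤ NUMSUMS s`,
one declaration the chain checks (`FactCh`), and one tiny declaration the threshold on `Σ L_s` (`FactFin`). -/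

namespace Literature.NumberTheory.Sieve.MaynardTao.ProductKernelCert3750

/-- log2 of the slice width (`2^16` slots). [folklore] -/
def eS : ℕ := 16
/-- first slot of slice `s` (`s < 8`): `2^19 + s·2^16`. [folklore] -/
def sliceOff (s : ℕ) : ℕ := 2 ^ 19 + s * 2 ^ eS
/-- the floor digits of slice `s`, as a small packed number (one shift of `NF`, one small mask). [folklore] -/
def sliceVal (s : ℕ) : ℕ := (NF >>> (BB * sliceOff s)) &&& onesBelow (BB * 2 ^ eS)
/-- the block sum of slice `s` against the interpolated log weights. [folklore] -/
def NUMSUMS (s : ℕ) : ℕ := nsGo (sliceVal s) (eS - Wexp) (sliceOff s / WW)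
/-- kernel fact: a literal lower bound of the slice block sum. [folklore] -/
def FactSl (s L : ℕ) : Bool := Nat.ble L (NUMSUMS s)
/-- kernel fact: the fifteen no-carry checks of the floor chain. [folklore] -/
def FactCh : Bool := resF.2
/-- kernel fact (tiny): `T2 ≤ Σ L_s` and the threshold check on `Σ L_s − T2`. [folklore] -/
def FactFin (l0 l1 l2 l3 l4 l5 l6 l7 : ℕ) : Bool :=
  Nat.ble T2 (l0 + l1 + l2 + l3 + l4 + l5 + l6 + l7) && chkN (l0 + l1 + l2 + l3 + l4 + l5 + l6 + l7) T2

noncomputable section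

/-- reading a slice of a packed vector: shift down `o` digits, keep `S` (over variables). [cite: Polymath8b2014, Theorem 6.7 (product test function), numerical instance k = 3750] -/
theorem kpack_slice {M o S : ℕ} {w : ℕ → ℕ} (hoS : o + S ≤ M) (hd : ∀ j < M, w j < 2 ^ BB) :
    (kpack BB M w >>> (BB * o)) &&& onesBelow (BB * S) = kpack BB S (fun i => w (o + i)) := by
  have hM : M = o + (M - o) := by omega
  have hlow : kpack BB o w < 2 ^ (BB * o) := kpack_lt fun j hj => hd j (by omega)
  have h1 : kpack BB M w >>> (BB * o) = kpack BB (M - o) (fun i => w (o + i)) := by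
    rw [shiftRight_eq_div, hM, kpack_add, ← hM, Nat.add_mul_div_left _ _ (two_pow_pos' _), Nat.div_eq_of_lt hlow,
      Nat.zero_add]
  rw [h1, land_onesBelow]
  exact kpack_mod_two_pow (by omega) fun j hj => hd (o + j) (by omega)

/-- summing consecutive blocks of a function (over variables). [cite: Polymath8b2014, Theorem 6.7 (product test function), numerical instance k = 3750] -/
theorem sum_consecutive_blocks (n K : ℕ) (f : ℕ → ℕ) :
    ∑ s ∈ range n, ∑ i ∈ range K, f (s * K + i) = ∑ j ∈ range (n * K), f j := by
  induction n with
  | zero => simp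
  | succ n ih =>
      rw [Finset.sum_range_succ, ih, Nat.succ_mul, Finset.sum_range_add]

/-- slice geometry: `s < 8` ⇒ `sliceOff s + 2^16 ≤ M`. [cite: Polymath8b2014, Theorem 6.7 (product test function), numerical instance k = 3750] -/
theorem sliceOff_le {s : ℕ} (hs : s < 8) : sliceOff s + 2 ^ eS ≤ MM := by
  unfold sliceOff eS MM eE; omega
/-- slice geometry: the block offset. [cite: Polymath8b2014, Theorem 6.7 (product test function), numerical instance k = 3750] -/
theorem sliceOff_div (s : ℕ) : sliceOff s / WW = 2 ^ (eH - Wexp) + s * 2 ^ (eS - Wexp) := by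
  unfold sliceOff eS eH WW Wexp; omega
/-- slice geometry: `2^16 = W · 2^11`. [cite: Polymath8b2014, Theorem 6.7 (product test function), numerical instance k = 3750] -/
theorem eS_eqW : 2 ^ eS = WW * 2 ^ (eS - Wexp) := by decide
/-- slice geometry: `sliceOff s = (sliceOff s / W) · W`. [cite: Polymath8b2014, Theorem 6.7 (product test function), numerical instance k = 3750] -/
theorem sliceOff_mulW (s : ℕ) : sliceOff s = (2 ^ (eH - Wexp) + s * 2 ^ (eS - Wexp)) * WW := by
  unfold sliceOff eS eH WW Wexp; omega

/-- **the slice block sum in block form**. [cite: Polymath8b2014, Theorem 6.7 (product test function), numerical instance k = 3750] -/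
theorem NUMSUMS_eq {w : ℕ → ℕ} (hw : NF = kpack BB MM w) (hs : ∑ m ∈ range MM, w m < 2 ^ BB - 1) {s : ℕ} (h8 : s < 8) :
    NUMSUMS s = ∑ i ∈ range (2 ^ (eS - Wexp)), ellT (2 ^ (eH - Wexp) + s * 2 ^ (eS - Wexp) + i) ^ 2 *
      ∑ t ∈ range WW, w (sliceOff s + (i * WW + t)) := by
  have hd := digits_lt hs
  have hsl := sliceOff_le h8
  have hd' : ∀ j < WW * 2 ^ (eS - Wexp), (fun i => w (sliceOff s + i)) j < 2 ^ BB := fun j hj =>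
    hd _ (by rw [← eS_eqW] at hj; omega)
  have hs' : ∀ i < 2 ^ (eS - Wexp), ∑ t ∈ range WW, (fun i => w (sliceOff s + i)) (i * WW + t) < 2 ^ BB - 1 := by
    intro i hi
    refine lt_of_le_of_lt ?_ hs
    have hsub : ∑ t ∈ range WW, w (sliceOff s + (i * WW + t)) =
        ∑ m ∈ (range WW).map (addLeftEmbedding (sliceOff s + i * WW)), w m := by
      rw [Finset.sum_map]; exact Finset.sum_congr rfl fun t _ => by simp [add_assoc]
    show ∑ t ∈ range WW, w (sliceOff s + (i * WW + t)) ≤ _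
    rw [hsub]
    apply Finset.sum_le_sum_of_subset_of_nonneg
    · intro m hm
      rw [Finset.mem_map] at hm
      obtain ⟨t, ht, rfl⟩ := hm
      rw [Finset.mem_range] at ht ⊢
      simp only [addLeftEmbedding_apply]
      have : i * WW + t < 2 ^ (eS - Wexp) * WW := by nlinarith
      rw [eS_eqW, Nat.mul_comm] at hsl; omega
    · exact fun _ _ _ => Nat.zero_le _
  have e1 : sliceVal s = kpack BB (WW * 2 ^ (eS - Wexp)) (fun i => w (sliceOff s + i)) := by
    rw [sliceVal, hw, kpack_slice hsl hd, eS_eqW]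
  rw [NUMSUMS, e1, nsGo_eq (eS - Wexp) (sliceOff s / WW) (fun i => w (sliceOff s + i)) hd' hs', sliceOff_div]

/-- **the eight slices add up to the high-half block sum** (block forms over the abstract digits). [cite: Polymath8b2014, Theorem 6.7 (product test function), numerical instance k = 3750] -/
theorem sum_slices_eq {w : ℕ → ℕ} (hw : NF = kpack BB MM w) (hs : ∑ m ∈ range MM, w m < 2 ^ BB - 1) :
    ∑ s ∈ range 8, NUMSUMS s = NUMSUMH := by
  rw [NUMSUMH_eq hw hs]
  have hK : 2 ^ (eH - Wexp) = 8 * 2 ^ (eS - Wexp) := by decide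
  have step : ∀ s ∈ range 8, NUMSUMS s = ∑ i ∈ range (2 ^ (eS - Wexp)),
      (fun b => ellT (2 ^ (eH - Wexp) + b) ^ 2 * ∑ t ∈ range WW, w (2 ^ eH + (b * WW + t))) (s * 2 ^ (eS - Wexp) + i) := by
    intro s hs8
    rw [Finset.mem_range] at hs8
    rw [NUMSUMS_eq hw hs hs8]
    refine Finset.sum_congr rfl fun i _ => ?_
    have e : ∀ t, sliceOff s + (i * WW + t) = 2 ^ eH + ((s * 2 ^ (eS - Wexp) + i) * WW + t) := fun t => by
      rw [sliceOff_mulW, eH_eqW]; ring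
    show _ = ellT (2 ^ (eH - Wexp) + (s * 2 ^ (eS - Wexp) + i)) ^ 2 * _
    rw [← add_assoc]
    exact congrArg (fun x => ellT (2 ^ (eH - Wexp) + s * 2 ^ (eS - Wexp) + i) ^ 2 * x)
      (Finset.sum_congr rfl fun t _ => by rw [e])
  rw [Finset.sum_congr rfl step]
  have hblk := sum_consecutive_blocks 8 (2 ^ (eS - Wexp))
    (fun b => ellT (2 ^ (eH - Wexp) + b) ^ 2 * ∑ t ∈ range WW, w (2 ^ eH + (b * WW + t)))
  rw [← hK] at hblk
  exact hblk

/-- literal slice bounds give a lower bound of `NUMSUM`. [cite: Polymath8b2014, Theorem 6.7 (product test function), numerical instance k = 3750] -/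
theorem slices_le (hF : resF.2 = true) (L : ℕ → ℕ) (hL : ∀ s < 8, Nat.ble (L s) (NUMSUMS s) = true) :
    ∑ s ∈ range 8, L s ≤ NUMSUM := by
  obtain ⟨w, hw, -, hs⟩ := invF_final hF
  have h1 : ∑ s ∈ range 8, L s ≤ ∑ s ∈ range 8, NUMSUMS s :=
    Finset.sum_le_sum fun s hs8 => Nat.le_of_ble_eq_true (hL s (Finset.mem_range.1 hs8))
  rw [sum_slices_eq hw hs] at h1
  exact h1.trans (NUMSUMH_le hF)

/-- **numerator lower bound from the slice facts**. [cite: Polymath8b2014, Theorem 6.7 (product test function), numerical instance k = 3750] -/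
theorem numer_geS (hF : resF.2 = true) (hlog : logOk = true) (SL : ℕ) (hSL : SL ≤ NUMSUM) (hT2le : T2 ≤ SL) :
    m2R ^ (nK + 1) / (((2 ^ LL : ℕ) : ℝ) * 2 ^ 160 * ((nK : ℝ) + 1) ^ 2) * (((SL - T2 : ℕ)) : ℝ) ≤
      ∑ m ∈ range MM, (∫ u in Ioc 0 (1 - ((((m + (nK + 1) : ℕ) : ℝ)) * hR - (dP : ℝ) * hR)),
          polymathProfile (nK + 2) cR TR u) ^ 2 *
        dconvPow (cellMass (fun t => polymathProfile (nK + 2) cR TR t ^ 2) hR) (nK + 1) m -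
      (∫ u in Ioc 0 TR, polymathProfile (nK + 2) cR TR u) ^ 2 *
        ((TR / (cR * (cR + ((nK : ℝ) + 1) * TR))) ^ (nK + 1) *
          Real.exp (-2 * ((Lam : ℝ) * hR) ^ 2 / (((nK : ℝ) + 1) * hR ^ 2))) := by
  have h := numer_ge hF hlog (hT2le.trans hSL)
  have hS2 : (0:ℝ) < ((2 ^ LL : ℕ) : ℝ) := by exact_mod_cast two_pow_LL_pos
  have hK1 : (0:ℝ) < (nK : ℝ) + 1 := Nat.cast_add_one_pos nK
  have hcoef : 0 ≤ m2R ^ (nK + 1) / (((2 ^ LL : ℕ) : ℝ) * 2 ^ 160 * ((nK : ℝ) + 1) ^ 2) :=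
    div_nonneg (pow_pos m2R_pos _).le (mul_pos (mul_pos hS2 (pow_pos two_pos 160)) (pow_pos hK1 2)).le
  have hcast : (((SL - T2 : ℕ)) : ℝ) ≤ (((NUMSUM - T2 : ℕ)) : ℝ) := Nat.cast_le.2 (Nat.sub_le_sub_right hSL T2)
  exact le_trans (mul_le_mul_of_nonneg_left hcast hcoef) h

/-- **the finite inequality** from the slice facts. [cite: Polymath8b2014, Theorem 6.7 (product test function), numerical instance k = 3750] -/
theorem sum_inequalityS (hF : resF.2 = true) (hlog : logOk = true) (SL : ℕ) (hSL : SL ≤ NUMSUM)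
    (hT2 : Nat.ble T2 SL = true) (hchk : chkN SL T2 = true) :
    (19076 : ℝ) / 10000000000 * ((1000000 : ℝ) / 466771167) ^ 3749 ≤
      ∑ m ∈ range MM,
          (∫ u in Ioc 0 (1 - ((((m + 3749 : ℕ) : ℝ)) * hR - (dP : ℝ) * hR)),
              polymathProfile 3750 ((249 : ℝ) / 2000) ((3 : ℝ) / 4) u) ^ 2 *
            dconvPow (cellMass (fun t => polymathProfile 3750 ((249 : ℝ) / 2000) ((3 : ℝ) / 4) t ^ 2) hR) 3749 m -
        (∫ u in Ioc 0 ((3 : ℝ) / 4), polymathProfile 3750 ((249 : ℝ) / 2000) ((3 : ℝ) / 4) u) ^ 2 *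
          (((1000000 : ℝ) / 466771167) ^ 3749 * Real.exp (-2 * ((Lam : ℝ) * hR) ^ 2 / ((3749 : ℝ) * hR ^ 2))) := by
  have hT2le : T2 ≤ SL := Nat.le_of_ble_eq_true hT2
  have hge := numer_geS hF hlog SL hSL hT2le
  have hNS : (((SL - T2 : ℕ)) : ℝ) = (SL : ℝ) - (T2 : ℝ) := Nat.cast_sub hT2le
  rw [hNS, m2R_eq', m2R_eq, profile_eq, TR_eq', cast_K1, cast_two_pow_LL, show (nK + 1 : ℕ) = 3749 from rfl] at hge
  have hchk' := chkN_sound SL T2 hchk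
  rw [cast_K1] at hchk'
  have hS2 : (0:ℝ) < (2:ℝ) ^ LL := pow_pos two_pos LL
  exact numer_arith 19076 (((1000000 : ℝ) / 466771167) ^ 3749) ((2:ℝ) ^ LL) ((2:ℝ) ^ 160) 3749 (SL : ℝ) (T2 : ℝ) _
    hS2 (pow_pos two_pos 160) (by norm_num) (by positivity) hchk' hge

/-- **the registered stub `stub_numHoeffdingCert` from the SLICED kernel facts**: chain checks `FactCh`, eight literal slice bounds
`FactSl s l_s`, the tiny threshold fact `FactFin l₀ … l₇`, the quarter facts and the side fact.
[cite: Polymath8b2014, Theorem 6.7 (product test function), numerical instance k = 3750] -/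
theorem stub_of_factsS (okCh : FactCh = true) (l0 l1 l2 l3 l4 l5 l6 l7 : ℕ)
    (ok0 : FactSl 0 l0 = true) (ok1 : FactSl 1 l1 = true) (ok2 : FactSl 2 l2 = true) (ok3 : FactSl 3 l3 = true)
    (ok4 : FactSl 4 l4 = true) (ok5 : FactSl 5 l5 = true) (ok6 : FactSl 6 l6 = true) (ok7 : FactSl 7 l7 = true)
    (okFin : FactFin l0 l1 l2 l3 l4 l5 l6 l7 = true)
    (q0 q1 q2 u0 u1 u2 : ℕ) (okQ0 : FactQ 0 q0 u0 = true)
    (okQ1 : FactQ (0 + 2 ^ 18) q1 u1 = true) (okQ2 : FactQ (0 + 2 ^ (18 + 1)) q2 u2 = true)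
    (okS : FactS q0 q1 q2 u0 u1 u2 = true) :
    ∃ (h : ℝ) (Jc M : ℕ) (δ lam : ℝ), 0 < h ∧ (3 : ℝ) / 4 < (Jc : ℝ) * h ∧ 0 ≤ lam ∧
      δ + lam ≤ (3749 : ℝ) * (h -
        (∫ x in Ici 0, roundErr h x * polymathProfile 3750 ((249 : ℝ) / 2000) ((3 : ℝ) / 4) x ^ 2) /
          ((1000000 : ℝ) / 466771167)) ∧
      (19076 : ℝ) / 10000000000 * ((1000000 : ℝ) / 466771167) ^ 3749 ≤
        ∑ m ∈ range M,
            (∫ u in Ioc 0 (1 - ((((m + 3749 : ℕ) : ℝ)) * h - δ)),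
                polymathProfile 3750 ((249 : ℝ) / 2000) ((3 : ℝ) / 4) u) ^ 2 *
              dconvPow (cellMass (fun t => polymathProfile 3750 ((249 : ℝ) / 2000) ((3 : ℝ) / 4) t ^ 2) h) 3749 m -
          (∫ u in Ioc 0 ((3 : ℝ) / 4), polymathProfile 3750 ((249 : ℝ) / 2000) ((3 : ℝ) / 4) u) ^ 2 *
            (((1000000 : ℝ) / 466771167) ^ 3749 * Real.exp (-2 * lam ^ 2 / ((3749 : ℝ) * h ^ 2))) := by
  rw [FactCh] at okCh
  rw [FactFin, Bool.and_eq_true] at okFin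
  obtain ⟨hT2, hchk⟩ := okFin
  obtain ⟨hlog, -, hc2⟩ := sides_of_facts q0 q1 q2 u0 u1 u2 okQ0 okQ1 okQ2 okS
  -- the eight literals as one function
  let L : ℕ → ℕ := fun s => if s = 0 then l0 else if s = 1 then l1 else if s = 2 then l2 else if s = 3 then l3
    else if s = 4 then l4 else if s = 5 then l5 else if s = 6 then l6 else l7
  have hL : ∀ s < 8, Nat.ble (L s) (NUMSUMS s) = true := by
    intro s hs8
    have hcases : s = 0 ∨ s = 1 ∨ s = 2 ∨ s = 3 ∨ s = 4 ∨ s = 5 ∨ s = 6 ∨ s = 7 := by omega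
    rcases hcases with rfl | rfl | rfl | rfl | rfl | rfl | rfl | rfl
    exacts [ok0, ok1, ok2, ok3, ok4, ok5, ok6, ok7]
  have hsum : ∑ s ∈ range 8, L s = l0 + l1 + l2 + l3 + l4 + l5 + l6 + l7 := by
    simp [Finset.sum_range_succ, L]
  have hSL : l0 + l1 + l2 + l3 + l4 + l5 + l6 + l7 ≤ NUMSUM := by
    rw [← hsum]; exact slices_le okCh L hL
  have hJ : (3 : ℝ) / 4 < ((Jc + 1 : ℕ) : ℝ) * hR := by rw [← TR_eq']; exact hJcH
  exact ⟨hR, Jc + 1, MM, (dP : ℝ) * hR, (Lam : ℝ) * hR, hR_pos, hJ, mul_nonneg (Nat.cast_nonneg _) hR_pos.le,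
    side_condition hc2, sum_inequalityS okCh hlog _ hSL hT2 hchk⟩

end

end Literature.NumberTheory.Sieve.MaynardTao.ProductKernelCert3750
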